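import Literature.Analysis.FluidPDE.PassiveVectorTensorForced
import Literature.Analysis.FluidPDE.PassiveVectorTensorDuality
import Literature.Analysis.FluidPDE.PassiveVectorTensorSpaceTimePairing
import HarnessLib

/-!
# Forced weak passive solenoidal vectors with a constant viscosity tensor: mode identities,
# the truncated energy identity with the work of the forcing, finiteness of the dissipation and
# the ENERGY INEQUALITY WITH THE WORK TERM for every weak solution

Analysis/FluidPDE proof-support file (everything proved; no definitions, no named facts), the energy
layer of the forced class `Torus.IsWeakTensorPassiveVectorForcedOn A T 𝔸 b g F w₀ w` of
`PassiveVectorTensorForced.lean` (`∂ₜw + (b·∇)w + A (w·∇)b + ∇π = 𝓛_𝔸 w + g + Σⱼ ∂ⱼ(F j)`, `∇·w = 0`;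
Frisch's constant eddy-viscosity tensor (9.57); forcing `g, F j ∈ L²((0,T) × T^d)`). The chain of the
unforced files `PassiveVectorTensorClass` → `…Fourier` → `…ModeEnergy` → `…GalerkinIdentity` →
`…EnergyDecay` is re-run WITH THE WORK OF THE FORCING carried along:

* `setIntegral_test_smul`, `ae_integral_inner_eq` — the weak formulation tested with `η(t) G(x)`, `G`
  smooth divergence free, and its a.e. du Bois-Reymond form
  `∫⟪w(t), G⟫ = ∫⟪w₀, G⟫ + ∫_{(0,t]} (Φ_G + Γ_G)`, `Γ_G(τ) = ∫⟪g(τ), G⟫ − Σⱼ ∫⟪F j(τ), ∂ⱼG⟫`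
  (Temam 1984, Ch. III §1.1; Temam 1997, Ch. II §3);
* `ae_inner_mFourierCoeff_eq` — the Leray-projected mode equations in integrated form: for `k · z = 0`,
  `⟪ŵ(t)(k), z⟫ = ⟪ŵ₀(k), z⟫ + ∫_{(0,t]} (−4π²⟪ŵ, T_𝔸(k)z⟫ + B(z) + ⟪ĝ(k), z⟫ − Σⱼ 2πikⱼ ⟪𝓕(F j)(k), z⟫)`;
* `ae_sq_norm_mFourierCoeff_eq` — the energy identity of one mode (sum over an orthonormal basis of
  `k^⊥ ⊂ ℂ^d`), and `ae_sum_sq_norm_mFourierCoeff_eq` — the TRUNCATED ENERGY IDENTITY: a.e. `t`, all `N`,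
  `Σ_{|k|≤N}‖ŵ(t)(k)‖² + 2∫₀ᵗ Q_N = Σ_{|k|≤N}‖ŵ₀(k)‖² + 2∫₀ᵗ (Flux_N + ∫⟪g, P_N w⟫ − Σⱼ ∫⟪F j, ∂ⱼP_N w⟫)`
  (Robinson–Rodrigo–Sadowski 2016, (4.20), with the work of the forcing);
* `lintegral_eGradNormSq_lt_top` — for `A = 0`, `NearIso 𝔸 lo hi` with `0 < lo`, a bounded carrier and
  a datum `w₀ ∈ L²` weakly divergence free, EVERY forced weak solution has finite dissipation
  `∫₀ᵀ ‖∇w‖² < ∞` (Young's inequality in the truncated identity, monotone convergence);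
* `ae_energy_ineq` — **the energy inequality with the work term**: for a.e. `t ∈ (0,T)`,
  `‖w(t)‖² + lo ∫₀ᵗ ‖∇w‖² ≤ ‖w₀‖² + (1/lo) Σⱼ ∫₀ᵗ ‖F j‖² + 2 ∫₀ᵗ ∫⟪g, w⟫`
  (the transport flux is a remainder `∫⟪w − P_N w, (b·∇)P_N w⟫ → 0` by dominated convergence once the
  dissipation is finite; the flux work is absorbed by Young; Temam 1997, Ch. II §3 Lemma 3.2 /
  Temam 1984, Ch. III §1 Lemma 1.2, in inequality form, for the class where `w'` is only known weakly).

Consumer: the K1L one-level split S1′/S2′ of `stub_oneLevelL_IW` (route `SolenoidalFractalHomogenisation`,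
cell `ad-ideate`, tenure rulings D24-6/D24-6′): the forced class is the vehicle for the conjugated /
distorted cell problem, whose defect is a flux `Σⱼ ∂ⱼ(F j)` with `F = O(‖G_t − 1‖) ∇w` plus an `L²` force.

## Mathlib / tree search

Tree: the unforced chain named above (every step ported; the single-mode pairings
`integral_inner_convect_add_viscAdj_realTrigPoly_singleton`, `integral_inner_realTrigPoly_singleton`,
the transversality API `mem_orthogonal_waveVec_iff`, `lo_mul_le_re_inner_symbT`, the truncation
remainder `integral_inner_convect_fourierTruncate_eq_remainder`, `abs_integral_inner_convect_le_of_norm_le`,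
`gradNormSq_fourierTruncate`, `eGradNormSq_fourierTruncate_eq_sum`, Parseval
`hasSum_sq_norm_mFourierCoeff_complexify`, `sq_const_add_setIntegral_eq`,
`FunctionSpaces.ae_eq_add_setIntegral_of_forall_test` are reused, not re-proved). Mathlib:
`lintegral_tendsto_of_tendsto_of_monotone`, `tendsto_integral_of_dominated_convergence`.

## References

* R. Temam, *Infinite-Dimensional Dynamical Systems in Mechanics and Physics*, 2nd ed. (Springer 1997),
  Ch. II §3.1–3.2, Thm. 3.1, Lemma 3.2 (energy equality of the linear problem). [`Temam1997`]
* R. Temam, *Navier–Stokes Equations* (3rd ed., North-Holland 1984), Ch. III §1.1, Lemma 1.2. [`Temam1984`]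
* J. C. Robinson, J. L. Rodrigo, W. Sadowski, *The three-dimensional Navier–Stokes equations* (CUP 2016),
  §4.2 (4.20) (Galerkin energy estimate). [`RobinsonRodrigoSadowski2016`]
* U. Frisch, *Turbulence* (CUP 1995), §9.6.3 eq. (9.57) p. 233. [`Frisch1995Turbulence`]
* M. Giaquinta, *Multiple integrals in the calculus of variations and nonlinear elliptic systems*
  (Princeton 1983), Ch. III §2 (2.2) (Legendre–Hadamard / Gårding on the torus). [`Giaquinta1983MultipleIntegrals`]
-/

noncomputable section

open MeasureTheory Set Filter Function TopologicalSpace Complex UnitAddTorus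
open scoped ENNReal NNReal InnerProductSpace Topology ComplexConjugate ContDiff

namespace Literature.Analysis.FluidPDE

namespace Torus

variable {d : Type*} [Fintype d] [DecidableEq d]

/-! ## Generic helpers -/

section Helpers

omit [DecidableEq d] in
/-- The Fourier modes `t ↦ 𝓕(G t)(k)` of a field integrable on `(0,T) × T^d` are integrable on
`(0,T)`. [folklore] -/
private theorem integrableOn_mFourierCoeff_of_integrable_uncurry₈ {G : ℝ → UnitAddTorus d → EuclideanSpace ℝ d}
    {T : ℝ} (hG : Integrable (uncurry G) (((volume : Measure ℝ).restrict (Ioo 0 T)).prod volume)) (k : d → ℤ) :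
    Integrable (fun t => mFourierCoeff (FunctionSpaces.EuclideanSpace.complexify ∘ G t) k)
      (volume.restrict (Ioo 0 T)) := by
  have h1 : Integrable (fun p : ℝ × UnitAddTorus d =>
      mFourier (-k) p.2 • FunctionSpaces.EuclideanSpace.complexify (G p.1 p.2))
      (((volume : Measure ℝ).restrict (Ioo 0 T)).prod volume) :=
    ((FunctionSpaces.EuclideanSpace.complexify (ι := d)).toContinuousLinearMap.integrable_comp hG).bdd_smul 1
      ((mFourier (-k)).continuous.comp continuous_snd).aestronglyMeasurable
      (Eventually.of_forall fun p => ((mFourier (-k)).norm_coe_le_norm p.2).trans_eq mFourier_norm)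
  have e : (fun t => mFourierCoeff (FunctionSpaces.EuclideanSpace.complexify ∘ G t) k) =
      fun t => ∫ x, mFourier (-k) x • FunctionSpaces.EuclideanSpace.complexify (G t x) := by
    funext t
    rw [FunctionSpaces.Torus.mFourierCoeff_eq_integral_volume]
    rfl
  rw [e]
  exact h1.integral_prod_left

omit [Fintype d] [DecidableEq d] in
/-- Product rule for an a.e. primitive with datum: `U(t) = c + ∫_{(0,t]} F` a.e. with `F ∈ L¹(0,T)`
gives `U(t)² = c² + 2 ∫_{(0,t]} F U` a.e. [folklore] -/
private theorem ae_sq_eq_of_ae_eq_add_setIntegral₈ {T c : ℝ} {U F : ℝ → ℝ} (hF : IntegrableOn F (Ioo 0 T) volume)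
    (hU : ∀ᵐ t ∂(volume.restrict (Ioo 0 T)), U t = c + ∫ τ in Ioc 0 t, F τ) :
    ∀ᵐ t ∂(volume.restrict (Ioo 0 T)), U t ^ 2 = c ^ 2 + 2 * ∫ τ in Ioc 0 t, F τ * U τ := by
  have hU' : ∀ᵐ τ ∂(volume : Measure ℝ), τ ∈ Ioo 0 T → U τ = c + ∫ r in Ioc 0 τ, F r :=
    (ae_restrict_iff' measurableSet_Ioo).1 hU
  filter_upwards [hU, ae_restrict_mem measurableSet_Ioo] with t ht htT
  have hsub : Ioc 0 t ⊆ Ioo 0 T := Ioc_subset_Ioo_right htT.2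
  rw [ht, sq_const_add_setIntegral_eq (hF.mono_set hsub)]
  congr 1
  congr 1
  refine setIntegral_congr_ae measurableSet_Ioc ?_
  filter_upwards [hU'] with τ hτ hτI
  rw [hτ (hsub hτI)]

omit [Fintype d] [DecidableEq d] in
/-- `‖a‖² = (Re a)² + (Im a)²`. [folklore] -/
private theorem norm_sq_eq_re_sq_add_im_sq₈ (a : ℂ) : ‖a‖ ^ 2 = a.re ^ 2 + a.im ^ 2 := by
  rw [Complex.sq_norm, Complex.normSq_apply]
  ring

omit [Fintype d] [DecidableEq d] in
/-- `Re a · Re h + Im a · Im h = Re (conj a · h)`. [folklore] -/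
private theorem re_mul_re_add_im_mul_im₈ (a h : ℂ) : a.re * h.re + a.im * h.im = (conj a * h).re := by
  simp [Complex.mul_re, Complex.conj_re, Complex.conj_im]

omit [DecidableEq d] in
/-- `‖𝓕(complexify ∘ f)(k)‖ ≤ ∫ ‖f‖` for integrable `f`. [folklore] -/
private theorem norm_mFourierCoeff_complexify_le₈ {f : UnitAddTorus d → EuclideanSpace ℝ d}
    (hf : Integrable f volume) (k : d → ℤ) :
    ‖mFourierCoeff (FunctionSpaces.EuclideanSpace.complexify ∘ f) k‖ ≤ ∫ x, ‖f x‖ := by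
  rw [FunctionSpaces.Torus.mFourierCoeff_eq_integral_volume]
  have hint : Integrable (fun x => mFourier (-k) x • (FunctionSpaces.EuclideanSpace.complexify ∘ f) x) volume :=
    FunctionSpaces.Torus.integrable_mFourier_smul' (FunctionSpaces.Torus.integrable_complexify_comp hf) k
  refine (norm_integral_le_integral_norm _).trans (integral_mono hint.norm hf.norm fun x => ?_)
  dsimp only
  rw [norm_smul, Function.comp_apply, FunctionSpaces.EuclideanSpace.norm_complexify]
  exact mul_le_of_le_one_left (norm_nonneg _) (((mFourier (-k)).norm_coe_le_norm x).trans_eq mFourier_norm)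

omit [DecidableEq d] in
/-- `∫ ‖f‖ ≤ C` from `‖f‖_{L²} ≤ C` on the probability space `T^d`. [folklore] -/
private theorem integral_norm_le_of_eLpNorm_two_le₈ {f : UnitAddTorus d → EuclideanSpace ℝ d}
    (hf : MemLp f 2 volume) {C : ℝ≥0} (h : eLpNorm f 2 volume ≤ C) : ∫ x, ‖f x‖ ≤ C := by
  have h1 : ENNReal.ofReal (∫ x, ‖f x‖) = eLpNorm f 1 volume := by
    rw [eLpNorm_one_eq_lintegral_enorm, ← ofReal_integral_norm_eq_lintegral_enorm (hf.integrable one_le_two)]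
  have h2 : ENNReal.ofReal (∫ x, ‖f x‖) ≤ C :=
    h1.le.trans ((eLpNorm_le_eLpNorm_of_exponent_le (by norm_num) hf.1).trans h)
  have := (ENNReal.ofReal_le_iff_le_toReal ENNReal.coe_ne_top).1 h2
  simpa using this

omit [DecidableEq d] in
/-- Parseval in a subspace: for `X ∈ S` and an orthonormal basis `(eᵢ)` of `S`,
`Σᵢ |⟪X, eᵢ⟫|² = ‖X‖²`. [folklore] -/
private theorem sum_sq_norm_inner_onb₈ {ι : Type*} [Fintype ι] {S : Submodule ℂ (EuclideanSpace ℂ d)}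
    (b : OrthonormalBasis ι ℂ S) {X : EuclideanSpace ℂ d} (hX : X ∈ S) :
    ∑ i, ‖⟪X, (b i : EuclideanSpace ℂ d)⟫_ℂ‖ ^ 2 = ‖X‖ ^ 2 := by
  have h1 : ‖(⟨X, hX⟩ : S)‖ ^ 2 = ∑ i, ‖b.repr ⟨X, hX⟩ i‖ ^ 2 := by
    rw [← b.repr.norm_map, EuclideanSpace.norm_sq_eq]
  have h2 : ∀ i, b.repr ⟨X, hX⟩ i = ⟪(b i : EuclideanSpace ℂ d), X⟫_ℂ := fun i => by
    rw [OrthonormalBasis.repr_apply_apply, Submodule.coe_inner]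
  rw [show ‖X‖ = ‖(⟨X, hX⟩ : S)‖ from rfl, h1]
  refine Finset.sum_congr rfl fun i _ => ?_
  rw [h2, norm_inner_symm]

omit [DecidableEq d] in
/-- Expansion in a subspace with conjugated coefficients: `Σᵢ conj⟪X, eᵢ⟫ eᵢ = X` for `X ∈ S`.
[folklore] -/
private theorem sum_conj_inner_smul_onb₈ {ι : Type*} [Fintype ι] {S : Submodule ℂ (EuclideanSpace ℂ d)}
    (b : OrthonormalBasis ι ℂ S) {X : EuclideanSpace ℂ d} (hX : X ∈ S) :
    ∑ i, conj ⟪X, (b i : EuclideanSpace ℂ d)⟫_ℂ • (b i : EuclideanSpace ℂ d) = X := by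
  have h := b.sum_repr' ⟨X, hX⟩
  have h' := congrArg (fun v : S => (v : EuclideanSpace ℂ d)) h
  simp only [Submodule.coe_sum, Submodule.coe_smul, Submodule.coe_inner] at h'
  simp_rw [inner_conj_symm]
  exact h'

end Helpers

namespace IsWeakTensorPassiveVectorForcedOn

variable {A T : ℝ} {𝔸 : Visc4 d} {b g w : ℝ → UnitAddTorus d → EuclideanSpace ℝ d}
  {F : d → ℝ → UnitAddTorus d → EuclideanSpace ℝ d} {w₀ : UnitAddTorus d → EuclideanSpace ℝ d}

/-! ## §1 Testing with `η(t) • G(x)`, `G` smooth and divergence free -/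

/-- Integrability on `(0,T)` of the unforced right-hand side
`Φ_G = ∫⟪w, (b·∇)G + 𝓛_𝔸^* G⟫ + A ∫⟪b, (w·∇)G⟫` of the steady-test identity, for a smooth steady
field `G`. [cite: DiPernaLions1989, §II.1 (12)–(14)] -/
theorem integrableOn_steadyRHS (h : IsWeakTensorPassiveVectorForcedOn A T 𝔸 b g F w₀ w)
    {G : UnitAddTorus d → EuclideanSpace ℝ d} (hG : FunctionSpaces.Torus.IsSmooth G) :
    IntegrableOn (fun τ =>
      (∫ x, ⟪w τ x, FunctionSpaces.Torus.convect (b τ) G x + viscAdj 𝔸 G x⟫_ℝ) +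
        A * ∫ x, ⟪b τ x, FunctionSpaces.Torus.convect (w τ) G x⟫_ℝ) (Ioo 0 T) volume := by
  have hG1 : FunctionSpaces.Torus.IsContDiff 1 G := hG.isContDiff (by simp)
  have hGd : ∀ j, Continuous (uncurry fun (_ : ℝ) (x : UnitAddTorus d) => FunctionSpaces.Torus.partialDeriv j G x) :=
    fun j => (hG.partialDeriv j).continuous.comp continuous_snd
  have hGl : Continuous (uncurry fun (_ : ℝ) (x : UnitAddTorus d) => viscAdj 𝔸 G x) := by
    have hc : Continuous (viscAdj 𝔸 G) := (isSmooth_viscAdj 𝔸 hG).continuous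
    exact hc.comp continuous_snd
  have hIv : Integrable (fun p : ℝ × UnitAddTorus d => ⟪w p.1 p.2, viscAdj 𝔸 G p.2⟫_ℝ)
      (((volume : Measure ℝ).restrict (Ioo 0 T)).prod volume) :=
    h.integrable_inner_of_continuous (Φ := fun _ x => viscAdj 𝔸 G x) hGl
  have hIc : Integrable (fun p : ℝ × UnitAddTorus d =>
      ⟪w p.1 p.2, FunctionSpaces.Torus.convect (b p.1) G p.2⟫_ℝ)
      (((volume : Measure ℝ).restrict (Ioo 0 T)).prod volume) :=
    h.integrable_inner_convect (Φ := fun _ => G) (fun _ => hG1) hGd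
  have hI₂ : Integrable (fun p : ℝ × UnitAddTorus d =>
      ⟪w p.1 p.2, FunctionSpaces.Torus.convect (b p.1) G p.2 + viscAdj 𝔸 G p.2⟫_ℝ)
      (((volume : Measure ℝ).restrict (Ioo 0 T)).prod volume) := by
    refine (hIc.add hIv).congr (Eventually.of_forall fun p => ?_)
    simp only [Pi.add_apply]
    rw [inner_add_right]
  have hI₃ : Integrable (fun p : ℝ × UnitAddTorus d => A * ⟪b p.1 p.2, FunctionSpaces.Torus.convect (w p.1) G p.2⟫_ℝ)
      (((volume : Measure ℝ).restrict (Ioo 0 T)).prod volume) :=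
    (h.integrable_inner_carrier_convect (Φ := fun _ => G) (fun _ => hG1) hGd).const_mul A
  refine (hI₂.integral_prod_left.add hI₃.integral_prod_left).congr (Eventually.of_forall fun t => ?_)
  simp only [Pi.add_apply]
  rw [integral_const_mul]

/-- Integrability on `(0,T)` of the WORK OF THE FORCING on a smooth steady field,
`Γ_G(τ) = ∫⟪g(τ), G⟫ − Σⱼ ∫⟪F j(τ), ∂ⱼG⟫`. [cite: Temam1997, Ch. II §3.1–3.2, (3.2)–(3.5), Thm. 3.1] -/
theorem integrableOn_forceRHS (h : IsWeakTensorPassiveVectorForcedOn A T 𝔸 b g F w₀ w)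
    {G : UnitAddTorus d → EuclideanSpace ℝ d} (hG : FunctionSpaces.Torus.IsSmooth G) :
    IntegrableOn (fun τ =>
      (∫ x, ⟪g τ x, G x⟫_ℝ) - ∑ j, ∫ x, ⟪F j τ x, FunctionSpaces.Torus.partialDeriv j G x⟫_ℝ) (Ioo 0 T) volume := by
  have hGc : Continuous (uncurry fun (_ : ℝ) (x : UnitAddTorus d) => G x) := hG.continuous.comp continuous_snd
  have hGd : ∀ j, Continuous (uncurry fun (_ : ℝ) (x : UnitAddTorus d) => FunctionSpaces.Torus.partialDeriv j G x) :=
    fun j => (hG.partialDeriv j).continuous.comp continuous_snd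
  exact (h.integrable_inner_force_of_continuous hGc).integral_prod_left.sub
    (integrable_finsetSum _ fun j _ => (h.integrable_inner_flux_of_continuous (hGd j) j).integral_prod_left)

/-- **The forced weak formulation tested with `η(t) • G(x)`.** For a smooth compactly supported `η`
with `tsupport η ⊆ (-∞, T)` and a smooth divergence-free field `G : T^d → ℝ^d`,
`∫_{(0,T)} (η'(t) ∫⟪w(t), G⟫ + η(t) (Φ_G(t) + Γ_G(t))) dt + η(0) ∫⟪w₀, G⟫ = 0`,
`Φ_G = ∫⟪w, (b·∇)G + 𝓛_𝔸^*G⟫ + A ∫⟪b, (w·∇)G⟫`, `Γ_G = ∫⟪g, G⟫ − Σⱼ ∫⟪F j, ∂ⱼG⟫`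
(separation of the time and space test functions, Temam 1984, Ch. III §1.1).
[cite: Temam1984, Ch. III §1.1] [cite: Temam1997, Ch. II §3.1–3.2, (3.2)–(3.5), Thm. 3.1] -/
theorem setIntegral_test_smul (h : IsWeakTensorPassiveVectorForcedOn A T 𝔸 b g F w₀ w) {η : ℝ → ℝ}
    (hη : ContDiff ℝ ∞ η) (hηc : HasCompactSupport η) (hηT : tsupport η ⊆ Iio T)
    {G : UnitAddTorus d → EuclideanSpace ℝ d} (hG : FunctionSpaces.Torus.IsSmooth G)
    (hGdiv : FunctionSpaces.Torus.IsDivFree G) :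
    (∫ t in Ioo 0 T, ((deriv η t * ∫ x, ⟪w t x, G x⟫_ℝ) +
      η t * (((∫ x, ⟪w t x, FunctionSpaces.Torus.convect (b t) G x + viscAdj 𝔸 G x⟫_ℝ) +
        A * ∫ x, ⟪b t x, FunctionSpaces.Torus.convect (w t) G x⟫_ℝ) +
        ((∫ x, ⟪g t x, G x⟫_ℝ) - ∑ j, ∫ x, ⟪F j t x, FunctionSpaces.Torus.partialDeriv j G x⟫_ℝ)))) +
      η 0 * ∫ x, ⟪w₀ x, G x⟫_ℝ = 0 := by
  have hΨ := isSpaceTimeTest_smul_const hη hηc hηT hG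
  have hG1 : FunctionSpaces.Torus.IsContDiff 1 G := hG.isContDiff (by simp)
  have hΨdiv : ∀ t, FunctionSpaces.Torus.IsDivFree ((fun t x => η t • G x) t) := fun t => by
    rw [show ((fun t x => η t • G x) t) = η t • G from rfl]
    exact isDivFree_const_smul_field hGdiv (η t)
  have key := h.integral_prod_weak_eq hΨ hΨdiv
  set P : Measure (ℝ × UnitAddTorus d) := ((volume : Measure ℝ).restrict (Ioo 0 T)).prod volume with hP
  -- pointwise form of the unforced integrand
  have hpt : ∀ p : ℝ × UnitAddTorus d,
      ⟪w p.1 p.2, FunctionSpaces.Torus.timeDeriv (fun t x => η t • G x) p.1 p.2 +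
          FunctionSpaces.Torus.convect (b p.1) ((fun t x => η t • G x) p.1) p.2 +
          viscAdj 𝔸 ((fun t x => η t • G x) p.1) p.2⟫_ℝ +
        A * ⟪b p.1 p.2, FunctionSpaces.Torus.convect (w p.1) ((fun t x => η t • G x) p.1) p.2⟫_ℝ =
      deriv η p.1 * ⟪w p.1 p.2, G p.2⟫_ℝ +
        η p.1 * (⟪w p.1 p.2, FunctionSpaces.Torus.convect (b p.1) G p.2 + viscAdj 𝔸 G p.2⟫_ℝ +
          A * ⟪b p.1 p.2, FunctionSpaces.Torus.convect (w p.1) G p.2⟫_ℝ) := by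
    intro p
    show ⟪w p.1 p.2, FunctionSpaces.Torus.timeDeriv (fun t x => η t • G x) p.1 p.2 +
          FunctionSpaces.Torus.convect (b p.1) (η p.1 • G) p.2 + viscAdj 𝔸 (η p.1 • G) p.2⟫_ℝ +
        A * ⟪b p.1 p.2, FunctionSpaces.Torus.convect (w p.1) (η p.1 • G) p.2⟫_ℝ = _
    rw [timeDeriv_smul_const (hη.differentiable (by simp)), viscAdj_const_smul_field 𝔸 hG,
      convect_const_smul_field hG1, convect_const_smul_field hG1]
    simp only [inner_add_right, real_inner_smul_right]
    ring
  -- pointwise form of the forcing integrand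
  have hptF : ∀ p : ℝ × UnitAddTorus d,
      ⟪g p.1 p.2, (fun t x => η t • G x) p.1 p.2⟫_ℝ -
          ∑ j, ⟪F j p.1 p.2, FunctionSpaces.Torus.partialDeriv j ((fun t x => η t • G x) p.1) p.2⟫_ℝ =
        η p.1 * (⟪g p.1 p.2, G p.2⟫_ℝ - ∑ j, ⟪F j p.1 p.2, FunctionSpaces.Torus.partialDeriv j G p.2⟫_ℝ) := by
    intro p
    show ⟪g p.1 p.2, η p.1 • G p.2⟫_ℝ -
        ∑ j, ⟪F j p.1 p.2, FunctionSpaces.Torus.partialDeriv j (η p.1 • G) p.2⟫_ℝ = _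
    simp only [FunctionSpaces.Torus.partialDeriv_const_smul hG1, Pi.smul_apply, real_inner_smul_right]
    rw [mul_sub, Finset.mul_sum]
  obtain ⟨Ca, hCa⟩ := (hη.continuous_deriv (by simp)).bounded_above_of_compact_support hηc.deriv
  obtain ⟨Cb, hCb⟩ := hη.continuous.bounded_above_of_compact_support hηc
  set f₁ : ℝ × UnitAddTorus d → ℝ := fun p => deriv η p.1 * ⟪w p.1 p.2, G p.2⟫_ℝ with hf₁
  set f₂ : ℝ × UnitAddTorus d → ℝ := fun p =>
    η p.1 * (⟪w p.1 p.2, FunctionSpaces.Torus.convect (b p.1) G p.2 + viscAdj 𝔸 G p.2⟫_ℝ +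
      A * ⟪b p.1 p.2, FunctionSpaces.Torus.convect (w p.1) G p.2⟫_ℝ) with hf₂
  set f₃ : ℝ × UnitAddTorus d → ℝ := fun p =>
    η p.1 * (⟪g p.1 p.2, G p.2⟫_ℝ - ∑ j, ⟪F j p.1 p.2, FunctionSpaces.Torus.partialDeriv j G p.2⟫_ℝ) with hf₃
  -- integrability of the pieces
  have hGc : Continuous (uncurry fun (_ : ℝ) (x : UnitAddTorus d) => G x) := hG.continuous.comp continuous_snd
  have hGd : ∀ j, Continuous (uncurry fun (_ : ℝ) (x : UnitAddTorus d) => FunctionSpaces.Torus.partialDeriv j G x) :=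
    fun j => (hG.partialDeriv j).continuous.comp continuous_snd
  have hGl : Continuous (uncurry fun (_ : ℝ) (x : UnitAddTorus d) => viscAdj 𝔸 G x) := by
    have hc : Continuous (viscAdj 𝔸 G) := (isSmooth_viscAdj 𝔸 hG).continuous
    exact hc.comp continuous_snd
  have hI₁ : Integrable (fun p : ℝ × UnitAddTorus d => ⟪w p.1 p.2, G p.2⟫_ℝ) P :=
    h.integrable_inner_of_continuous hGc
  have hIv : Integrable (fun p : ℝ × UnitAddTorus d => ⟪w p.1 p.2, viscAdj 𝔸 G p.2⟫_ℝ) P :=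
    h.integrable_inner_of_continuous (Φ := fun _ x => viscAdj 𝔸 G x) hGl
  have hIc : Integrable (fun p : ℝ × UnitAddTorus d =>
      ⟪w p.1 p.2, FunctionSpaces.Torus.convect (b p.1) G p.2⟫_ℝ) P :=
    h.integrable_inner_convect (Φ := fun _ => G) (fun _ => hG1) hGd
  have hI₂ : Integrable (fun p : ℝ × UnitAddTorus d =>
      ⟪w p.1 p.2, FunctionSpaces.Torus.convect (b p.1) G p.2 + viscAdj 𝔸 G p.2⟫_ℝ +
        A * ⟪b p.1 p.2, FunctionSpaces.Torus.convect (w p.1) G p.2⟫_ℝ) P := by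
    refine ((hIc.add hIv).add
      ((h.integrable_inner_carrier_convect (Φ := fun _ => G) (fun _ => hG1) hGd).const_mul A)).congr
      (Eventually.of_forall fun p => ?_)
    simp only [Pi.add_apply]
    rw [inner_add_right]
  have hI₃ : Integrable (fun p : ℝ × UnitAddTorus d =>
      ⟪g p.1 p.2, G p.2⟫_ℝ - ∑ j, ⟪F j p.1 p.2, FunctionSpaces.Torus.partialDeriv j G p.2⟫_ℝ) P :=
    (h.integrable_inner_force_of_continuous hGc).sub
      (integrable_finsetSum _ fun j _ => h.integrable_inner_flux_of_continuous (hGd j) j)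
  have hf₁i : Integrable f₁ P :=
    hI₁.bdd_mul ((hη.continuous_deriv (by simp)).comp continuous_fst).aestronglyMeasurable
      (Eventually.of_forall fun p => hCa p.1)
  have hf₂i : Integrable f₂ P :=
    hI₂.bdd_mul (hη.continuous.comp continuous_fst).aestronglyMeasurable
      (Eventually.of_forall fun p => hCb p.1)
  have hf₃i : Integrable f₃ P :=
    hI₃.bdd_mul (hη.continuous.comp continuous_fst).aestronglyMeasurable
      (Eventually.of_forall fun p => hCb p.1)
  have esum : (∫ p, (f₁ p + f₂ p) ∂P) + (∫ p, f₃ p ∂P) + η 0 * ∫ x, ⟪w₀ x, G x⟫_ℝ = 0 := by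
    have e1 : ∫ p, (f₁ p + f₂ p) ∂P = ∫ p,
        (⟪w p.1 p.2, FunctionSpaces.Torus.timeDeriv (fun t x => η t • G x) p.1 p.2 +
            FunctionSpaces.Torus.convect (b p.1) ((fun t x => η t • G x) p.1) p.2 +
            viscAdj 𝔸 ((fun t x => η t • G x) p.1) p.2⟫_ℝ +
          A * ⟪b p.1 p.2, FunctionSpaces.Torus.convect (w p.1) ((fun t x => η t • G x) p.1) p.2⟫_ℝ) ∂P := by
      refine integral_congr_ae (Eventually.of_forall fun p => ?_)
      simp only [hf₁, hf₂]
      exact (hpt p).symm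
    have e3 : ∫ p, f₃ p ∂P = ∫ p,
        (⟪g p.1 p.2, (fun t x => η t • G x) p.1 p.2⟫_ℝ -
          ∑ j, ⟪F j p.1 p.2, FunctionSpaces.Torus.partialDeriv j ((fun t x => η t • G x) p.1) p.2⟫_ℝ) ∂P := by
      refine integral_congr_ae (Eventually.of_forall fun p => ?_)
      simp only [hf₃]
      exact (hptF p).symm
    have e2 : η 0 * ∫ x, ⟪w₀ x, G x⟫_ℝ = ∫ x, ⟪w₀ x, (fun t x => η t • G x) 0 x⟫_ℝ := by
      rw [← integral_const_mul]
      refine integral_congr_ae (Eventually.of_forall fun x => ?_)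
      simp only [real_inner_smul_right]
    rw [e1, e2, e3]
    exact key
  have e₁ : ∫ p, f₁ p ∂P = ∫ t in Ioo 0 T, deriv η t * ∫ x, ⟪w t x, G x⟫_ℝ := by
    rw [hP, integral_prod _ hf₁i]
    refine integral_congr_ae (Eventually.of_forall fun t => ?_)
    simp only [hf₁]
    exact integral_const_mul _ _
  have hI₂' : Integrable (fun p : ℝ × UnitAddTorus d =>
      ⟪w p.1 p.2, FunctionSpaces.Torus.convect (b p.1) G p.2 + viscAdj 𝔸 G p.2⟫_ℝ) P := by
    refine (hIc.add hIv).congr (Eventually.of_forall fun p => ?_)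
    simp only [Pi.add_apply]
    rw [inner_add_right]
  have hI₂'' : Integrable (fun p : ℝ × UnitAddTorus d => A * ⟪b p.1 p.2, FunctionSpaces.Torus.convect (w p.1) G p.2⟫_ℝ) P :=
    (h.integrable_inner_carrier_convect (Φ := fun _ => G) (fun _ => hG1) hGd).const_mul A
  have e₂ : ∫ p, f₂ p ∂P = ∫ t in Ioo 0 T, η t * ((∫ x,
      ⟪w t x, FunctionSpaces.Torus.convect (b t) G x + viscAdj 𝔸 G x⟫_ℝ) +
        A * ∫ x, ⟪b t x, FunctionSpaces.Torus.convect (w t) G x⟫_ℝ) := by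
    rw [hP, integral_prod _ hf₂i]
    refine integral_congr_ae ?_
    filter_upwards [hI₂'.prod_right_ae, hI₂''.prod_right_ae] with t h1 h2
    simp only [hf₂]
    rw [integral_const_mul, integral_add h1 h2, integral_const_mul]
  have hIg : Integrable (fun p : ℝ × UnitAddTorus d => ⟪g p.1 p.2, G p.2⟫_ℝ) P :=
    h.integrable_inner_force_of_continuous hGc
  have hIF : ∀ j, Integrable (fun p : ℝ × UnitAddTorus d => ⟪F j p.1 p.2, FunctionSpaces.Torus.partialDeriv j G p.2⟫_ℝ) P :=
    fun j => h.integrable_inner_flux_of_continuous (hGd j) j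
  have e₃ : ∫ p, f₃ p ∂P = ∫ t in Ioo 0 T, η t *
      ((∫ x, ⟪g t x, G x⟫_ℝ) - ∑ j, ∫ x, ⟪F j t x, FunctionSpaces.Torus.partialDeriv j G x⟫_ℝ) := by
    rw [hP, integral_prod _ hf₃i]
    refine integral_congr_ae ?_
    have hall : ∀ᵐ t ∂(volume.restrict (Ioo 0 T)), ∀ j,
        Integrable (fun x => ⟪F j t x, FunctionSpaces.Torus.partialDeriv j G x⟫_ℝ) volume :=
      ae_all_iff.2 fun j => (hIF j).prod_right_ae
    filter_upwards [hIg.prod_right_ae, hall] with t h1 h2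
    simp only [hf₃]
    rw [integral_const_mul, integral_sub h1 (integrable_finsetSum _ fun j _ => h2 j),
      integral_finsetSum _ fun j _ => h2 j]
  have ha : Integrable (fun t => deriv η t * ∫ x, ⟪w t x, G x⟫_ℝ) (volume.restrict (Ioo 0 T)) := by
    have := hf₁i.integral_prod_left
    rw [hP] at e₁
    refine this.congr (Eventually.of_forall fun t => ?_)
    simp only [hf₁]
    exact integral_const_mul _ _
  have hb : Integrable (fun t => η t * ((∫ x,
      ⟪w t x, FunctionSpaces.Torus.convect (b t) G x + viscAdj 𝔸 G x⟫_ℝ) +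
        A * ∫ x, ⟪b t x, FunctionSpaces.Torus.convect (w t) G x⟫_ℝ)) (volume.restrict (Ioo 0 T)) :=
    ((h.integrableOn_steadyRHS hG).bdd_mul (hη.continuous.aestronglyMeasurable.restrict)
      (Eventually.of_forall fun t => hCb t))
  have hc : Integrable (fun t => η t *
      ((∫ x, ⟪g t x, G x⟫_ℝ) - ∑ j, ∫ x, ⟪F j t x, FunctionSpaces.Torus.partialDeriv j G x⟫_ℝ))
      (volume.restrict (Ioo 0 T)) :=
    ((h.integrableOn_forceRHS hG).bdd_mul (hη.continuous.aestronglyMeasurable.restrict)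
      (Eventually.of_forall fun t => hCb t))
  rw [integral_add hf₁i hf₂i, e₁, e₂, e₃] at esum
  have esplit : ∀ t, (deriv η t * ∫ x, ⟪w t x, G x⟫_ℝ) +
      η t * (((∫ x, ⟪w t x, FunctionSpaces.Torus.convect (b t) G x + viscAdj 𝔸 G x⟫_ℝ) +
        A * ∫ x, ⟪b t x, FunctionSpaces.Torus.convect (w t) G x⟫_ℝ) +
        ((∫ x, ⟪g t x, G x⟫_ℝ) - ∑ j, ∫ x, ⟪F j t x, FunctionSpaces.Torus.partialDeriv j G x⟫_ℝ)) =
      ((deriv η t * ∫ x, ⟪w t x, G x⟫_ℝ) +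
        η t * ((∫ x, ⟪w t x, FunctionSpaces.Torus.convect (b t) G x + viscAdj 𝔸 G x⟫_ℝ) +
          A * ∫ x, ⟪b t x, FunctionSpaces.Torus.convect (w t) G x⟫_ℝ)) +
        η t * ((∫ x, ⟪g t x, G x⟫_ℝ) - ∑ j, ∫ x, ⟪F j t x, FunctionSpaces.Torus.partialDeriv j G x⟫_ℝ) :=
    fun t => by ring
  have hab : Integrable (fun t => (deriv η t * ∫ x, ⟪w t x, G x⟫_ℝ) +
      η t * ((∫ x, ⟪w t x, FunctionSpaces.Torus.convect (b t) G x + viscAdj 𝔸 G x⟫_ℝ) +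
        A * ∫ x, ⟪b t x, FunctionSpaces.Torus.convect (w t) G x⟫_ℝ)) (volume.restrict (Ioo 0 T)) := ha.add hb
  simp_rw [esplit]
  rw [integral_add hab hc, integral_add ha hb]
  linarith

/-- **A forced weak solution paired with a steady smooth divergence-free field is absolutely
continuous in time**: for a.e. `t ∈ (0,T)`,
`∫⟪w(t), G⟫ = ∫⟪w₀, G⟫ + ∫_{(0,t]} (Φ_G + Γ_G)`,
`Φ_G(τ) = ∫⟪w(τ), (b(τ)·∇)G + 𝓛_𝔸^*G⟫ + A ∫⟪b(τ), (w(τ)·∇)G⟫`, `Γ_G(τ) = ∫⟪g(τ), G⟫ − Σⱼ ∫⟪F j(τ), ∂ⱼG⟫`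
(`setIntegral_test_smul` and the a.e. du Bois-Reymond lemma with datum).
[cite: Temam1984, Ch. III §1.1] [cite: Temam1997, Ch. II §3.1–3.2, (3.2)–(3.5), Thm. 3.1] -/
theorem ae_integral_inner_eq (h : IsWeakTensorPassiveVectorForcedOn A T 𝔸 b g F w₀ w)
    {G : UnitAddTorus d → EuclideanSpace ℝ d} (hG : FunctionSpaces.Torus.IsSmooth G)
    (hGdiv : FunctionSpaces.Torus.IsDivFree G) :
    ∀ᵐ t ∂(volume.restrict (Ioo 0 T)),
      ∫ x, ⟪w t x, G x⟫_ℝ = (∫ x, ⟪w₀ x, G x⟫_ℝ) +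
        ∫ τ in Ioc 0 t, (((∫ x, ⟪w τ x, FunctionSpaces.Torus.convect (b τ) G x + viscAdj 𝔸 G x⟫_ℝ) +
          A * ∫ x, ⟪b τ x, FunctionSpaces.Torus.convect (w τ) G x⟫_ℝ) +
          ((∫ x, ⟪g τ x, G x⟫_ℝ) - ∑ j, ∫ x, ⟪F j τ x, FunctionSpaces.Torus.partialDeriv j G x⟫_ℝ)) := by
  have hGc : Continuous (uncurry fun (_ : ℝ) (x : UnitAddTorus d) => G x) := hG.continuous.comp continuous_snd
  have hU : IntegrableOn (fun t => ∫ x, ⟪w t x, G x⟫_ℝ) (Ioo 0 T) volume :=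
    (h.integrable_inner_of_continuous hGc).integral_prod_left
  have hF : IntegrableOn (fun τ => (((∫ x, ⟪w τ x, FunctionSpaces.Torus.convect (b τ) G x + viscAdj 𝔸 G x⟫_ℝ) +
          A * ∫ x, ⟪b τ x, FunctionSpaces.Torus.convect (w τ) G x⟫_ℝ) +
          ((∫ x, ⟪g τ x, G x⟫_ℝ) - ∑ j, ∫ x, ⟪F j τ x, FunctionSpaces.Torus.partialDeriv j G x⟫_ℝ)))
      (Ioo 0 T) volume := (h.integrableOn_steadyRHS hG).add (h.integrableOn_forceRHS hG)
  exact FunctionSpaces.ae_eq_add_setIntegral_of_forall_test hU hF fun η hη hηc hηT =>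
    h.setIntegral_test_smul hη hηc hηT hG hGdiv

/-! ## §2 Integrability of the Fourier modes -/

/-- The Fourier modes `t ↦ ŵ(t)(k)` of a forced weak solution are integrable on `(0,T)`.
[cite: DiPernaLions1989, §II.1 (12)–(14)] -/
theorem integrableOn_mFourierCoeff (h : IsWeakTensorPassiveVectorForcedOn A T 𝔸 b g F w₀ w) (k : d → ℤ) :
    Integrable (fun t => mFourierCoeff (FunctionSpaces.EuclideanSpace.complexify ∘ w t) k)
      (volume.restrict (Ioo 0 T)) :=
  integrableOn_mFourierCoeff_of_integrable_uncurry₈ h.integrable_uncurry k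

/-- The Fourier modes `t ↦ ĝ(t)(k)` of the force are integrable on `(0,T)`.
[cite: Temam1997, Ch. II §3.1–3.2, (3.2)–(3.5), Thm. 3.1] -/
theorem integrableOn_mFourierCoeff_force (h : IsWeakTensorPassiveVectorForcedOn A T 𝔸 b g F w₀ w) (k : d → ℤ) :
    Integrable (fun t => mFourierCoeff (FunctionSpaces.EuclideanSpace.complexify ∘ g t) k)
      (volume.restrict (Ioo 0 T)) :=
  integrableOn_mFourierCoeff_of_integrable_uncurry₈ h.integrable_uncurry_force k

/-- The Fourier modes `t ↦ 𝓕(F j(t))(k)` of the flux columns are integrable on `(0,T)`.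
[cite: Temam1997, Ch. II §3.1–3.2, (3.2)–(3.5), Thm. 3.1] -/
theorem integrableOn_mFourierCoeff_flux (h : IsWeakTensorPassiveVectorForcedOn A T 𝔸 b g F w₀ w) (j : d)
    (k : d → ℤ) :
    Integrable (fun t => mFourierCoeff (FunctionSpaces.EuclideanSpace.complexify ∘ F j t) k)
      (volume.restrict (Ioo 0 T)) :=
  integrableOn_mFourierCoeff_of_integrable_uncurry₈ (h.integrable_uncurry_flux j) k

/-- Joint measurability of the products `bⱼ w`. [cite: DiPernaLions1989, §II.1 (12)–(14)] -/
theorem aestronglyMeasurable_carrier_smul (h : IsWeakTensorPassiveVectorForcedOn A T 𝔸 b g F w₀ w) (j : d) :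
    AEStronglyMeasurable (fun p : ℝ × UnitAddTorus d => b p.1 p.2 j • w p.1 p.2)
      (((volume : Measure ℝ).restrict (Ioo 0 T)).prod volume) :=
  ((EuclideanSpace.proj j).continuous.comp_aestronglyMeasurable h.aestronglyMeasurable_uncurry_carrier).smul
    h.aestronglyMeasurable_uncurry

/-- Joint measurability of the products `wⱼ b`. [cite: DiPernaLions1989, §II.1 (12)–(14)] -/
theorem aestronglyMeasurable_smul_carrier (h : IsWeakTensorPassiveVectorForcedOn A T 𝔸 b g F w₀ w) (j : d) :
    AEStronglyMeasurable (fun p : ℝ × UnitAddTorus d => w p.1 p.2 j • b p.1 p.2)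
      (((volume : Measure ℝ).restrict (Ioo 0 T)).prod volume) :=
  ((EuclideanSpace.proj j).continuous.comp_aestronglyMeasurable h.aestronglyMeasurable_uncurry).smul
    h.aestronglyMeasurable_uncurry_carrier

/-- `bⱼ w ∈ L¹((0,T) × T^d)`. [cite: DiPernaLions1989, §II.1 (12)–(14)] -/
theorem integrable_carrier_smul (h : IsWeakTensorPassiveVectorForcedOn A T 𝔸 b g F w₀ w) (j : d) :
    Integrable (fun p : ℝ × UnitAddTorus d => b p.1 p.2 j • w p.1 p.2)
      (((volume : Measure ℝ).restrict (Ioo 0 T)).prod volume) := by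
  refine Integrable.mono' h.integrable_norm_carrier_mul_norm (h.aestronglyMeasurable_carrier_smul j)
    (Eventually.of_forall fun p => ?_)
  rw [norm_smul]
  exact mul_le_mul_of_nonneg_right
    (by simpa [Real.norm_eq_abs] using FunctionSpaces.Torus.abs_apply_le_norm (b p.1 p.2) j) (norm_nonneg _)

/-- `wⱼ b ∈ L¹((0,T) × T^d)`. [cite: DiPernaLions1989, §II.1 (12)–(14)] -/
theorem integrable_smul_carrier (h : IsWeakTensorPassiveVectorForcedOn A T 𝔸 b g F w₀ w) (j : d) :
    Integrable (fun p : ℝ × UnitAddTorus d => w p.1 p.2 j • b p.1 p.2)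
      (((volume : Measure ℝ).restrict (Ioo 0 T)).prod volume) := by
  refine Integrable.mono' h.integrable_norm_carrier_mul_norm (h.aestronglyMeasurable_smul_carrier j)
    (Eventually.of_forall fun p => ?_)
  rw [norm_smul, mul_comm]
  exact mul_le_mul_of_nonneg_left
    (by simpa [Real.norm_eq_abs] using FunctionSpaces.Torus.abs_apply_le_norm (w p.1 p.2) j) (norm_nonneg _)

/-- The modes `t ↦ 𝓕(bⱼ w)(t)(k)` are integrable on `(0,T)`. [cite: DiPernaLions1989, §II.1 (12)–(14)] -/
theorem integrableOn_mFourierCoeff_carrier_smul (h : IsWeakTensorPassiveVectorForcedOn A T 𝔸 b g F w₀ w) (j : d)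
    (k : d → ℤ) :
    Integrable (fun t => mFourierCoeff
        (FunctionSpaces.EuclideanSpace.complexify ∘ fun x => b t x j • w t x) k)
      (volume.restrict (Ioo 0 T)) :=
  integrableOn_mFourierCoeff_of_integrable_uncurry₈ (G := fun t x => b t x j • w t x) (h.integrable_carrier_smul j) k

/-- The modes `t ↦ 𝓕(wⱼ b)(t)(k)` are integrable on `(0,T)`. [cite: DiPernaLions1989, §II.1 (12)–(14)] -/
theorem integrableOn_mFourierCoeff_smul_carrier (h : IsWeakTensorPassiveVectorForcedOn A T 𝔸 b g F w₀ w) (j : d)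
    (k : d → ℤ) :
    Integrable (fun t => mFourierCoeff
        (FunctionSpaces.EuclideanSpace.complexify ∘ fun x => w t x j • b t x) k)
      (volume.restrict (Ioo 0 T)) :=
  integrableOn_mFourierCoeff_of_integrable_uncurry₈ (G := fun t x => w t x j • b t x) (h.integrable_smul_carrier j) k

/-- For a.e. `t ∈ (0,T)`: the slices `w t`, `bⱼ(t) w(t)`, `wⱼ(t) b(t)`, `g t` and `F j t` are
integrable on `T^d`. [cite: DiPernaLions1989, §II.1 (12)–(14)] -/
theorem ae_integrable_slice (h : IsWeakTensorPassiveVectorForcedOn A T 𝔸 b g F w₀ w) :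
    ∀ᵐ t ∂(volume.restrict (Ioo 0 T)),
      Integrable (w t) volume ∧ (∀ j, Integrable (fun x => b t x j • w t x) volume) ∧
        (∀ j, Integrable (fun x => w t x j • b t x) volume) ∧ Integrable (g t) volume ∧
          ∀ j, Integrable (F j t) volume := by
  have h1 : ∀ᵐ t ∂(volume.restrict (Ioo 0 T)), ∀ j, Integrable (fun x => b t x j • w t x) volume :=
    ae_all_iff.2 fun j => (h.integrable_carrier_smul j).prod_right_ae
  have h2 : ∀ᵐ t ∂(volume.restrict (Ioo 0 T)), ∀ j, Integrable (fun x => w t x j • b t x) volume :=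
    ae_all_iff.2 fun j => (h.integrable_smul_carrier j).prod_right_ae
  have h3 : ∀ᵐ t ∂(volume.restrict (Ioo 0 T)), ∀ j, Integrable (F j t) volume :=
    ae_all_iff.2 fun j => (h.integrable_uncurry_flux j).prod_right_ae
  filter_upwards [h.ae_memLp_two, h1, h2, h.integrable_uncurry_force.prod_right_ae, h3] with t ht h1t h2t h4t h5t
  exact ⟨ht.integrable one_le_two, h1t, h2t, h4t, h5t⟩

/-- The Fourier modes of a forced weak solution are essentially bounded: `‖ŵ(τ)(k)‖ ≤ K` for a.e.
`τ` (`‖ŵ(τ)(k)‖ ≤ ‖w(τ)‖_{L¹} ≤ ‖w(τ)‖_{L²}`). [cite: DiPernaLions1989, §II.1 (12)–(14)] -/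
theorem exists_ae_norm_mFourierCoeff_le (h : IsWeakTensorPassiveVectorForcedOn A T 𝔸 b g F w₀ w) (k : d → ℤ) :
    ∃ K : ℝ, 0 ≤ K ∧ ∀ᵐ τ ∂(volume.restrict (Ioo 0 T)),
      ‖mFourierCoeff (FunctionSpaces.EuclideanSpace.complexify ∘ w τ) k‖ ≤ K := by
  obtain ⟨C₁, hC₁⟩ := h.exists_eLpNorm_le
  refine ⟨C₁, C₁.2, ?_⟩
  filter_upwards [hC₁, h.ae_memLp_two] with τ hτ hm
  exact (norm_mFourierCoeff_complexify_le₈ (hm.integrable one_le_two) k).trans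
    (integral_norm_le_of_eLpNorm_two_le₈ hm hτ)

omit [DecidableEq d] in
/-- Integrability on `(0,T)` of the pairing `⟪V(τ), X(τ)⟫` of an integrable mode function `V` with an
essentially bounded measurable one `X` (the shape of every term of the mode energy integrands).
[folklore] -/
private theorem integrableOn_inner_of_bdd₈ {T : ℝ} {V X : ℝ → EuclideanSpace ℂ d} {K : ℝ}
    (hV : Integrable V (volume.restrict (Ioo 0 T)))
    (hXm : AEStronglyMeasurable X (volume.restrict (Ioo 0 T)))
    (hX : ∀ᵐ τ ∂(volume.restrict (Ioo 0 T)), ‖X τ‖ ≤ K) :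
    Integrable (fun τ => ⟪V τ, X τ⟫_ℂ) (volume.restrict (Ioo 0 T)) := by
  refine Integrable.mono' (hV.norm.mul_const K) (hV.aestronglyMeasurable.inner hXm) ?_
  filter_upwards [hX] with s hs
  exact (norm_inner_le_norm _ _).trans (mul_le_mul_of_nonneg_left hs (norm_nonneg _))

/-- Integrability on `(0,T)` of the FORCED modewise right-hand side
`−4π² ⟪ŵ(τ)(k), T_𝔸(k) z⟫ + (∑ⱼ 2πi kⱼ ⟪𝓕(bⱼ w)(τ)(k), z⟫ + A ∑ⱼ 2πi kⱼ ⟪𝓕(wⱼ b)(τ)(k), z⟫)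
  + (⟪ĝ(τ)(k), z⟫ − ∑ⱼ 2πi kⱼ ⟪𝓕(F j)(τ)(k), z⟫)`. [cite: DiPernaLions1989, §II.1 (12)–(14)] -/
theorem integrableOn_modeRHS (h : IsWeakTensorPassiveVectorForcedOn A T 𝔸 b g F w₀ w) (k : d → ℤ)
    (z : EuclideanSpace ℂ d) :
    Integrable (fun τ =>
      ((-(4 * Real.pi ^ 2 : ℝ) : ℂ) *
          ⟪mFourierCoeff (FunctionSpaces.EuclideanSpace.complexify ∘ w τ) k, symbT 𝔸 k z⟫_ℂ +
        ((∑ j, (2 * Real.pi * I * (k j)) *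
            ⟪mFourierCoeff (FunctionSpaces.EuclideanSpace.complexify ∘ fun x => b τ x j • w τ x) k, z⟫_ℂ) +
          (A : ℂ) * ∑ j, (2 * Real.pi * I * (k j)) *
            ⟪mFourierCoeff (FunctionSpaces.EuclideanSpace.complexify ∘ fun x => w τ x j • b τ x) k, z⟫_ℂ)) +
      (⟪mFourierCoeff (FunctionSpaces.EuclideanSpace.complexify ∘ g τ) k, z⟫_ℂ -
        ∑ j, (2 * Real.pi * I * (k j)) *
          ⟪mFourierCoeff (FunctionSpaces.EuclideanSpace.complexify ∘ F j τ) k, z⟫_ℂ))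
      (volume.restrict (Ioo 0 T)) :=
  ((((h.integrableOn_mFourierCoeff k).inner_const (symbT 𝔸 k z)).const_mul _).add
    ((integrable_finsetSum _ fun j _ => ((h.integrableOn_mFourierCoeff_carrier_smul j k).inner_const z).const_mul _).add
      ((integrable_finsetSum _ fun j _ =>
        ((h.integrableOn_mFourierCoeff_smul_carrier j k).inner_const z).const_mul _).const_mul _))).add
    (((h.integrableOn_mFourierCoeff_force k).inner_const z).sub
      (integrable_finsetSum _ fun j _ => ((h.integrableOn_mFourierCoeff_flux j k).inner_const z).const_mul _))

/-! ## §3 The modewise integral identity with forcing -/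

omit [DecidableEq d] in
/-- **The work of a flux column on a single real mode**: for an integrable `v`,
`∫ ⟪v, ∂ⱼ Re (e_k • c)⟫ = Re (2πi kⱼ ⟪𝓕v(k), c k⟫)`. [cite: Grafakos2014, §3.1.1] -/
theorem integral_inner_partialDeriv_realTrigPoly_singleton [DecidableEq d] {v : UnitAddTorus d → EuclideanSpace ℝ d}
    (hv : Integrable v volume) (k : d → ℤ) (c : (d → ℤ) → EuclideanSpace ℂ d) (j : d) :
    ∫ x, ⟪v x, FunctionSpaces.Torus.partialDeriv j (FunctionSpaces.Torus.realTrigPoly {k} c) x⟫_ℝ =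
      ((2 * Real.pi * I * (k j)) * ⟪mFourierCoeff (FunctionSpaces.EuclideanSpace.complexify ∘ v) k, c k⟫_ℂ).re := by
  rw [FunctionSpaces.Torus.partialDeriv_realTrigPoly' {k} c j, FunctionSpaces.Torus.integral_inner_realTrigPoly_singleton hv k]
  simp only [inner_smul_right]

/-- **The modewise integral identity with forcing, tested (real) form.** For every `k ∈ ℤ^d` and every
coefficient family `c` transversal at `k` (`k · c k = 0`), for a.e. `t ∈ (0,T)`,
`Re ⟪ŵ(t)(k), c k⟫ = Re ⟪ŵ₀(k), c k⟫ + ∫_{(0,t]} Re (−4π² ⟪ŵ(τ)(k), T_𝔸(k) c k⟫ + B_τ(c k)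
  + ⟪ĝ(τ)(k), c k⟫ − ∑ⱼ 2πi kⱼ ⟪𝓕(F j)(τ)(k), c k⟫) dτ`
(the forced weak formulation tested with `η(t) Re (e_k(x) • c k)` and the a.e. du Bois-Reymond lemma).
[cite: Temam1984, Ch. III §1.1] [cite: Frisch1995Turbulence, §9.6.3 eq. (9.57) p. 233] -/
theorem ae_re_inner_mFourierCoeff_eq (h : IsWeakTensorPassiveVectorForcedOn A T 𝔸 b g F w₀ w)
    (hw₀ : Integrable w₀ volume) (k : d → ℤ) {c : (d → ℤ) → EuclideanSpace ℂ d}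
    (hz : ∑ j, (k j : ℂ) * c k j = 0) :
    ∀ᵐ t ∂(volume.restrict (Ioo 0 T)),
      (⟪mFourierCoeff (FunctionSpaces.EuclideanSpace.complexify ∘ w t) k, c k⟫_ℂ).re =
        (⟪mFourierCoeff (FunctionSpaces.EuclideanSpace.complexify ∘ w₀) k, c k⟫_ℂ).re +
        ∫ τ in Ioc 0 t,
          (((-(4 * Real.pi ^ 2 : ℝ) : ℂ) *
              ⟪mFourierCoeff (FunctionSpaces.EuclideanSpace.complexify ∘ w τ) k, symbT 𝔸 k (c k)⟫_ℂ +
            ((∑ j, (2 * Real.pi * I * (k j)) *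
                ⟪mFourierCoeff (FunctionSpaces.EuclideanSpace.complexify ∘ fun x => b τ x j • w τ x) k, c k⟫_ℂ) +
              (A : ℂ) * ∑ j, (2 * Real.pi * I * (k j)) *
                ⟪mFourierCoeff (FunctionSpaces.EuclideanSpace.complexify ∘ fun x => w τ x j • b τ x) k, c k⟫_ℂ)) +
          (⟪mFourierCoeff (FunctionSpaces.EuclideanSpace.complexify ∘ g τ) k, c k⟫_ℂ -
            ∑ j, (2 * Real.pi * I * (k j)) *
              ⟪mFourierCoeff (FunctionSpaces.EuclideanSpace.complexify ∘ F j τ) k, c k⟫_ℂ)).re := by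
  have hAi : Integrable (fun t => ⟪mFourierCoeff (FunctionSpaces.EuclideanSpace.complexify ∘ w t) k, c k⟫_ℂ)
      (volume.restrict (Ioo 0 T)) := (h.integrableOn_mFourierCoeff k).inner_const (c k)
  have hBi := h.integrableOn_modeRHS k (c k)
  refine FunctionSpaces.ae_eq_add_setIntegral_of_forall_test hAi.re hBi.re fun η hη hηc hηT => ?_
  have key := h.setIntegral_test_smul hη hηc hηT (FunctionSpaces.Torus.isSmooth_realTrigPoly {k} c)
    (FunctionSpaces.Torus.isDivFree_realTrigPoly_singleton hz)
  rw [FunctionSpaces.Torus.integral_inner_realTrigPoly_singleton hw₀ k c] at key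
  have hae : ∀ᵐ τ ∂(volume.restrict (Ioo 0 T)),
      (deriv η τ * ∫ x, ⟪w τ x, FunctionSpaces.Torus.realTrigPoly {k} c x⟫_ℝ) +
        η τ * (((∫ x, ⟪w τ x, FunctionSpaces.Torus.convect (b τ) (FunctionSpaces.Torus.realTrigPoly {k} c) x +
            viscAdj 𝔸 (FunctionSpaces.Torus.realTrigPoly {k} c) x⟫_ℝ) +
          A * ∫ x, ⟪b τ x, FunctionSpaces.Torus.convect (w τ) (FunctionSpaces.Torus.realTrigPoly {k} c) x⟫_ℝ) +
          ((∫ x, ⟪g τ x, FunctionSpaces.Torus.realTrigPoly {k} c x⟫_ℝ) -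
            ∑ j, ∫ x, ⟪F j τ x, FunctionSpaces.Torus.partialDeriv j (FunctionSpaces.Torus.realTrigPoly {k} c) x⟫_ℝ)) =
      deriv η τ * (⟪mFourierCoeff (FunctionSpaces.EuclideanSpace.complexify ∘ w τ) k, c k⟫_ℂ).re +
        η τ * (((-(4 * Real.pi ^ 2 : ℝ) : ℂ) *
              ⟪mFourierCoeff (FunctionSpaces.EuclideanSpace.complexify ∘ w τ) k, symbT 𝔸 k (c k)⟫_ℂ +
            ((∑ j, (2 * Real.pi * I * (k j)) *
                ⟪mFourierCoeff (FunctionSpaces.EuclideanSpace.complexify ∘ fun x => b τ x j • w τ x) k, c k⟫_ℂ) +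
              (A : ℂ) * ∑ j, (2 * Real.pi * I * (k j)) *
                ⟪mFourierCoeff (FunctionSpaces.EuclideanSpace.complexify ∘ fun x => w τ x j • b τ x) k, c k⟫_ℂ)) +
          (⟪mFourierCoeff (FunctionSpaces.EuclideanSpace.complexify ∘ g τ) k, c k⟫_ℂ -
            ∑ j, (2 * Real.pi * I * (k j)) *
              ⟪mFourierCoeff (FunctionSpaces.EuclideanSpace.complexify ∘ F j τ) k, c k⟫_ℂ)).re := by
    filter_upwards [h.ae_integrable_slice] with τ hτ
    rw [FunctionSpaces.Torus.integral_inner_realTrigPoly_singleton hτ.1 k c,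
      integral_inner_convect_add_viscAdj_realTrigPoly_singleton hτ.1 hτ.2.1 𝔸 k c,
      integral_inner_convect_realTrigPoly_singleton hτ.2.2.1 k c,
      FunctionSpaces.Torus.integral_inner_realTrigPoly_singleton hτ.2.2.2.1 k c]
    simp_rw [integral_inner_partialDeriv_realTrigPoly_singleton (hτ.2.2.2.2 _) k c]
    simp only [Complex.add_re, Complex.sub_re, Complex.re_sum, Complex.re_ofReal_mul]
    ring
  rw [integral_congr_ae hae] at key
  exact key

/-- **The Fourier modes of a forced weak tensor-viscosity passive-vector solution solve the
(Leray-projected) mode equations with forcing, in integrated form.** For a datum `w₀ ∈ L¹`, every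
`k ∈ ℤ^d` and every transversal `z ∈ ℂ^d` (`k · z = 0`): for a.e. `t ∈ (0,T)`,
`⟪ŵ(t)(k), z⟫ = ⟪ŵ₀(k), z⟫ + ∫_{(0,t]} (−4π² ⟪ŵ(τ)(k), T_𝔸(k) z⟫ + ∑ⱼ 2πi kⱼ ⟪𝓕(bⱼ w)(τ)(k), z⟫
  + A ∑ⱼ 2πi kⱼ ⟪𝓕(wⱼ b)(τ)(k), z⟫ + ⟪ĝ(τ)(k), z⟫ − ∑ⱼ 2πi kⱼ ⟪𝓕(F j)(τ)(k), z⟫) dτ`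
(real and imaginary parts from `ae_re_inner_mFourierCoeff_eq` with `z` and `i z`).
[cite: DiPernaLions1989, §II.1 (13)–(14)] [cite: Frisch1995Turbulence, §9.6.3 eq. (9.57) p. 233] -/
theorem ae_inner_mFourierCoeff_eq (h : IsWeakTensorPassiveVectorForcedOn A T 𝔸 b g F w₀ w)
    (hw₀ : Integrable w₀ volume) (k : d → ℤ) {z : EuclideanSpace ℂ d}
    (hz : ∑ j, (k j : ℂ) * z j = 0) :
    ∀ᵐ t ∂(volume.restrict (Ioo 0 T)),
      ⟪mFourierCoeff (FunctionSpaces.EuclideanSpace.complexify ∘ w t) k, z⟫_ℂ =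
        ⟪mFourierCoeff (FunctionSpaces.EuclideanSpace.complexify ∘ w₀) k, z⟫_ℂ +
        ∫ τ in Ioc 0 t,
          (((-(4 * Real.pi ^ 2 : ℝ) : ℂ) *
              ⟪mFourierCoeff (FunctionSpaces.EuclideanSpace.complexify ∘ w τ) k, symbT 𝔸 k z⟫_ℂ +
            ((∑ j, (2 * Real.pi * I * (k j)) *
                ⟪mFourierCoeff (FunctionSpaces.EuclideanSpace.complexify ∘ fun x => b τ x j • w τ x) k, z⟫_ℂ) +
              (A : ℂ) * ∑ j, (2 * Real.pi * I * (k j)) *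
                ⟪mFourierCoeff (FunctionSpaces.EuclideanSpace.complexify ∘ fun x => w τ x j • b τ x) k, z⟫_ℂ)) +
          (⟪mFourierCoeff (FunctionSpaces.EuclideanSpace.complexify ∘ g τ) k, z⟫_ℂ -
            ∑ j, (2 * Real.pi * I * (k j)) *
              ⟪mFourierCoeff (FunctionSpaces.EuclideanSpace.complexify ∘ F j τ) k, z⟫_ℂ)) := by
  have hBi := h.integrableOn_modeRHS k z
  -- the transversal families `z` and `i z`
  have hz' : ∑ j, (k j : ℂ) * (fun _ : d → ℤ => I • z) k j = 0 := by
    simp only [PiLp.smul_apply, smul_eq_mul]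
    calc ∑ j, (k j : ℂ) * (I * z j) = I * ∑ j, (k j : ℂ) * z j := by
          rw [Finset.mul_sum]; exact Finset.sum_congr rfl fun j _ => by ring
      _ = 0 := by rw [hz, mul_zero]
  have h1 := h.ae_re_inner_mFourierCoeff_eq hw₀ k (c := fun _ => z) hz
  have hI := h.ae_re_inner_mFourierCoeff_eq hw₀ k (c := fun _ => I • z) hz'
  filter_upwards [h1, hI, ae_restrict_mem measurableSet_Ioo] with t h1 hI ht
  have hBt := (show IntegrableOn _ (Ioo 0 T) volume from hBi).mono_set (Ioc_subset_Ioo_right ht.2)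
  -- pull the factor `i` out of every pairing
  have pull : ∀ (X P : ℂ) (F' G' Q : d → ℂ),
      ((-(4 * Real.pi ^ 2 : ℝ) : ℂ) * (I * X) +
        ((∑ j, (2 * Real.pi * I * (k j)) * (I * F' j)) + (A : ℂ) * ∑ j, (2 * Real.pi * I * (k j)) * (I * G' j))) +
        (I * P - ∑ j, (2 * Real.pi * I * (k j)) * (I * Q j)) =
      I * (((-(4 * Real.pi ^ 2 : ℝ) : ℂ) * X +
        ((∑ j, (2 * Real.pi * I * (k j)) * F' j) + (A : ℂ) * ∑ j, (2 * Real.pi * I * (k j)) * G' j)) +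
        (P - ∑ j, (2 * Real.pi * I * (k j)) * Q j)) := by
    intro X P F' G' Q
    have e1 : ∑ j, (2 * Real.pi * I * (k j)) * (I * F' j) = I * ∑ j, (2 * Real.pi * I * (k j)) * F' j := by
      rw [Finset.mul_sum]; exact Finset.sum_congr rfl fun j _ => by ring
    have e2 : ∑ j, (2 * Real.pi * I * (k j)) * (I * G' j) = I * ∑ j, (2 * Real.pi * I * (k j)) * G' j := by
      rw [Finset.mul_sum]; exact Finset.sum_congr rfl fun j _ => by ring
    have e3 : ∑ j, (2 * Real.pi * I * (k j)) * (I * Q j) = I * ∑ j, (2 * Real.pi * I * (k j)) * Q j := by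
      rw [Finset.mul_sum]; exact Finset.sum_congr rfl fun j _ => by ring
    rw [e1, e2, e3]
    ring
  simp only [symbT_smul, inner_smul_right] at hI
  simp only [pull, I_mul_re] at hI
  rw [integral_neg, ← neg_add, neg_inj] at hI
  apply Complex.ext
  · rw [h1, Complex.add_re, re_integral_eq hBt]
  · rw [hI, Complex.add_im, im_integral_eq hBt]

/-! ## §4 The energy identity of one Fourier mode -/

omit [Fintype d] [DecidableEq d] in
/-- Pulling a scalar out of a transport sum. [folklore] -/
private theorem modeRHS_sumpull₈ (k : d → ℤ) (μ : ℂ) (f : d → ℂ) [Fintype d] :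
    ∑ j, (2 * Real.pi * I * (k j)) * (μ * f j) = μ * ∑ j, (2 * Real.pi * I * (k j)) * f j := by
  rw [Finset.mul_sum]; exact Finset.sum_congr rfl fun j _ => by ring

omit [DecidableEq d] in
/-- **The forced mode right-hand side is `ℂ`-linear in `z`**: `H(Σᵢ μᵢ eᵢ) = Σᵢ μᵢ H(eᵢ)` for
`H(z) = −4π² ⟪X, T_𝔸(k) z⟫ + B(z) + ⟪P, z⟫ − Σⱼ 2πi kⱼ ⟪Qⱼ, z⟫`. [folklore] -/
private theorem modeRHS_sum_smul₈ {ι : Type*} (s : Finset ι) (𝔸 : Visc4 d) (k : d → ℤ) (A : ℝ)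
    (X P : EuclideanSpace ℂ d) (F' G' Q : d → EuclideanSpace ℂ d) (μ : ι → ℂ) (e : ι → EuclideanSpace ℂ d) :
    ((-(4 * Real.pi ^ 2 : ℝ) : ℂ) * ⟪X, symbT 𝔸 k (∑ i ∈ s, μ i • e i)⟫_ℂ +
        ((∑ j, (2 * Real.pi * I * (k j)) * ⟪F' j, ∑ i ∈ s, μ i • e i⟫_ℂ) +
          (A : ℂ) * ∑ j, (2 * Real.pi * I * (k j)) * ⟪G' j, ∑ i ∈ s, μ i • e i⟫_ℂ)) +
      (⟪P, ∑ i ∈ s, μ i • e i⟫_ℂ - ∑ j, (2 * Real.pi * I * (k j)) * ⟪Q j, ∑ i ∈ s, μ i • e i⟫_ℂ) =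
      ∑ i ∈ s, μ i * (((-(4 * Real.pi ^ 2 : ℝ) : ℂ) * ⟪X, symbT 𝔸 k (e i)⟫_ℂ +
        ((∑ j, (2 * Real.pi * I * (k j)) * ⟪F' j, e i⟫_ℂ) + (A : ℂ) * ∑ j, (2 * Real.pi * I * (k j)) * ⟪G' j, e i⟫_ℂ)) +
        (⟪P, e i⟫_ℂ - ∑ j, (2 * Real.pi * I * (k j)) * ⟪Q j, e i⟫_ℂ)) := by
  classical
  induction s using Finset.induction_on with
  | empty => simp
  | insert a s ha ih =>
    rw [Finset.sum_insert ha, Finset.sum_insert ha, ← ih]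
    simp only [symbT_add, symbT_smul, inner_add_right, inner_smul_right, mul_add, mul_sub, Finset.sum_add_distrib,
      modeRHS_sumpull₈]
    ring

/-- The mode pairings are essentially bounded: `|⟪ŵ(τ)(k), z⟫| ≤ K` for a.e. `τ ∈ (0,T)`.
[cite: DiPernaLions1989, §II.1 (12)–(14)] -/
theorem exists_ae_norm_inner_mFourierCoeff_le (h : IsWeakTensorPassiveVectorForcedOn A T 𝔸 b g F w₀ w) (k : d → ℤ)
    (z : EuclideanSpace ℂ d) :
    ∃ K : ℝ, ∀ᵐ τ ∂(volume.restrict (Ioo 0 T)),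
      ‖⟪mFourierCoeff (FunctionSpaces.EuclideanSpace.complexify ∘ w τ) k, z⟫_ℂ‖ ≤ K := by
  obtain ⟨C₁, _, hC₁⟩ := h.exists_ae_norm_mFourierCoeff_le k
  refine ⟨C₁ * ‖z‖, ?_⟩
  filter_upwards [hC₁] with τ hτ
  exact (norm_inner_le_norm _ _).trans (mul_le_mul_of_nonneg_right hτ (norm_nonneg _))

/-- Integrability on `(0,T)` of `conj α · H` for the mode pairing `α(τ) = ⟪ŵ(τ)(k), z⟫` (essentially
bounded) and any `H ∈ L¹(0,T)`. [cite: DiPernaLions1989, §II.1 (12)–(14)] -/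
theorem integrableOn_conj_inner_mul (h : IsWeakTensorPassiveVectorForcedOn A T 𝔸 b g F w₀ w) (k : d → ℤ)
    (z : EuclideanSpace ℂ d) {H : ℝ → ℂ} (hH : IntegrableOn H (Ioo 0 T) volume) :
    IntegrableOn (fun τ => conj ⟪mFourierCoeff (FunctionSpaces.EuclideanSpace.complexify ∘ w τ) k, z⟫_ℂ * H τ)
      (Ioo 0 T) volume := by
  obtain ⟨K, hK⟩ := h.exists_ae_norm_inner_mFourierCoeff_le k z
  have hαm : AEStronglyMeasurable
      (fun τ => conj ⟪mFourierCoeff (FunctionSpaces.EuclideanSpace.complexify ∘ w τ) k, z⟫_ℂ)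
      (volume.restrict (Ioo 0 T)) :=
    (continuous_conj.comp_aestronglyMeasurable ((h.integrableOn_mFourierCoeff k).inner_const z).aestronglyMeasurable)
  refine Integrable.bdd_mul (c := K) hH hαm ?_
  filter_upwards [hK] with τ hτ
  rwa [Complex.norm_conj]

/-- The Fourier modes of a forced weak solution are transversal for a.e. `t`: `Σⱼ kⱼ ŵ(t)(k)ⱼ = 0`
(`w(t)` is weakly divergence free and square integrable). [cite: DiPernaLions1989, §II.1 (12)–(14)] -/
theorem ae_sum_mul_mFourierCoeff_eq_zero (h : IsWeakTensorPassiveVectorForcedOn A T 𝔸 b g F w₀ w) (k : d → ℤ) :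
    ∀ᵐ t ∂(volume.restrict (Ioo 0 T)),
      ∑ j, (k j : ℂ) * mFourierCoeff (FunctionSpaces.EuclideanSpace.complexify ∘ w t) k j = 0 := by
  filter_upwards [h.ae_memLp_two, h.ae_isWeaklyDivFree] with t h1 h2
  exact h2.sum_mul_mFourierCoeff_eq_zero h1 k

/-- **Per-mode energy identity in Fourier variables (tested form, with forcing).** For a frequency `k`,
a transversal `z ∈ ℂ^d` (`k · z = 0`) and a.e. `t ∈ (0,T)`, with `α(t) = ⟪ŵ(t)(k), z⟫_ℂ` and the
forced mode right-hand side `H_τ(z)`: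
`|α(t)|² = |⟪ŵ₀(k), z⟫|² + 2 ∫_{(0,t]} Re (conj α(τ) · H_τ(z)) dτ`.
[cite: RobinsonRodrigoSadowski2016, §4.2 (Galerkin energy estimate)] -/
theorem ae_sq_norm_inner_mFourierCoeff_eq (h : IsWeakTensorPassiveVectorForcedOn A T 𝔸 b g F w₀ w)
    (hw₀ : Integrable w₀ volume) (k : d → ℤ) {z : EuclideanSpace ℂ d}
    (hz : ∑ j, (k j : ℂ) * z j = 0) :
    ∀ᵐ t ∂(volume.restrict (Ioo 0 T)),
      ‖⟪mFourierCoeff (FunctionSpaces.EuclideanSpace.complexify ∘ w t) k, z⟫_ℂ‖ ^ 2 =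
        ‖⟪mFourierCoeff (FunctionSpaces.EuclideanSpace.complexify ∘ w₀) k, z⟫_ℂ‖ ^ 2 +
        2 * ∫ τ in Ioc 0 t,
          (conj ⟪mFourierCoeff (FunctionSpaces.EuclideanSpace.complexify ∘ w τ) k, z⟫_ℂ *
            (((-(4 * Real.pi ^ 2 : ℝ) : ℂ) *
                ⟪mFourierCoeff (FunctionSpaces.EuclideanSpace.complexify ∘ w τ) k, symbT 𝔸 k z⟫_ℂ +
              ((∑ j, (2 * Real.pi * I * (k j)) *
                  ⟪mFourierCoeff (FunctionSpaces.EuclideanSpace.complexify ∘ fun x => b τ x j • w τ x) k, z⟫_ℂ) +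
                (A : ℂ) * ∑ j, (2 * Real.pi * I * (k j)) *
                  ⟪mFourierCoeff (FunctionSpaces.EuclideanSpace.complexify ∘ fun x => w τ x j • b τ x) k, z⟫_ℂ)) +
            (⟪mFourierCoeff (FunctionSpaces.EuclideanSpace.complexify ∘ g τ) k, z⟫_ℂ -
              ∑ j, (2 * Real.pi * I * (k j)) *
                ⟪mFourierCoeff (FunctionSpaces.EuclideanSpace.complexify ∘ F j τ) k, z⟫_ℂ))).re := by
  -- names
  set α : ℝ → ℂ := fun t => ⟪mFourierCoeff (FunctionSpaces.EuclideanSpace.complexify ∘ w t) k, z⟫_ℂ with hα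
  set α₀ : ℂ := ⟪mFourierCoeff (FunctionSpaces.EuclideanSpace.complexify ∘ w₀) k, z⟫_ℂ with hα₀
  set H : ℝ → ℂ := fun τ => ((-(4 * Real.pi ^ 2 : ℝ) : ℂ) *
      ⟪mFourierCoeff (FunctionSpaces.EuclideanSpace.complexify ∘ w τ) k, symbT 𝔸 k z⟫_ℂ +
    ((∑ j, (2 * Real.pi * I * (k j)) *
        ⟪mFourierCoeff (FunctionSpaces.EuclideanSpace.complexify ∘ fun x => b τ x j • w τ x) k, z⟫_ℂ) +
      (A : ℂ) * ∑ j, (2 * Real.pi * I * (k j)) *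
        ⟪mFourierCoeff (FunctionSpaces.EuclideanSpace.complexify ∘ fun x => w τ x j • b τ x) k, z⟫_ℂ)) +
    (⟪mFourierCoeff (FunctionSpaces.EuclideanSpace.complexify ∘ g τ) k, z⟫_ℂ -
      ∑ j, (2 * Real.pi * I * (k j)) *
        ⟪mFourierCoeff (FunctionSpaces.EuclideanSpace.complexify ∘ F j τ) k, z⟫_ℂ) with hH
  have hHi : IntegrableOn H (Ioo 0 T) volume := h.integrableOn_modeRHS k z
  -- the modewise identity and its real and imaginary parts
  have hid : ∀ᵐ t ∂(volume.restrict (Ioo 0 T)), α t = α₀ + ∫ τ in Ioc 0 t, H τ :=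
    h.ae_inner_mFourierCoeff_eq hw₀ k hz
  have hre : ∀ᵐ t ∂(volume.restrict (Ioo 0 T)), (α t).re = α₀.re + ∫ τ in Ioc 0 t, (H τ).re := by
    filter_upwards [hid, ae_restrict_mem measurableSet_Ioo] with t ht htT
    rw [ht, Complex.add_re, re_integral_eq (hHi.mono_set (Ioc_subset_Ioo_right htT.2))]
  have him : ∀ᵐ t ∂(volume.restrict (Ioo 0 T)), (α t).im = α₀.im + ∫ τ in Ioc 0 t, (H τ).im := by
    filter_upwards [hid, ae_restrict_mem measurableSet_Ioo] with t ht htT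
    rw [ht, Complex.add_im, im_integral_eq (hHi.mono_set (Ioc_subset_Ioo_right htT.2))]
  have h1 := ae_sq_eq_of_ae_eq_add_setIntegral₈ hHi.re hre
  have h2 := ae_sq_eq_of_ae_eq_add_setIntegral₈ hHi.im him
  -- integrability of the products on `(0,T)`
  have hαi : IntegrableOn α (Ioo 0 T) volume := (h.integrableOn_mFourierCoeff k).inner_const z
  obtain ⟨K, hK⟩ := h.exists_ae_norm_inner_mFourierCoeff_le k z
  have hP1 : IntegrableOn (fun τ => (H τ).re * (α τ).re) (Ioo 0 T) volume := by
    have hαm : AEStronglyMeasurable (fun τ => (α τ).re) (volume.restrict (Ioo 0 T)) :=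
      Complex.continuous_re.comp_aestronglyMeasurable hαi.aestronglyMeasurable
    refine Integrable.mul_bdd (c := K) hHi.re hαm ?_
    filter_upwards [hK] with τ hτ
    rw [Real.norm_eq_abs]
    exact (Complex.abs_re_le_norm _).trans hτ
  have hP2 : IntegrableOn (fun τ => (H τ).im * (α τ).im) (Ioo 0 T) volume := by
    have hαm : AEStronglyMeasurable (fun τ => (α τ).im) (volume.restrict (Ioo 0 T)) :=
      Complex.continuous_im.comp_aestronglyMeasurable hαi.aestronglyMeasurable
    refine Integrable.mul_bdd (c := K) hHi.im hαm ?_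
    filter_upwards [hK] with τ hτ
    rw [Real.norm_eq_abs]
    exact (Complex.abs_im_le_norm _).trans hτ
  filter_upwards [h1, h2, ae_restrict_mem measurableSet_Ioo] with t ht1 ht2 htT
  simp only [RCLike.re_to_complex, RCLike.im_to_complex] at ht1 ht2
  have hsub : Ioc 0 t ⊆ Ioo 0 T := Ioc_subset_Ioo_right htT.2
  -- assemble `|α|² = re² + im²`
  rw [norm_sq_eq_re_sq_add_im_sq₈, norm_sq_eq_re_sq_add_im_sq₈ α₀]
  rw [show (⟪mFourierCoeff (FunctionSpaces.EuclideanSpace.complexify ∘ w t) k, z⟫_ℂ) = α t from rfl, ht1, ht2,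
    add_add_add_comm, ← mul_add, ← integral_add (hP1.mono_set hsub) (hP2.mono_set hsub)]
  congr 2
  refine integral_congr_ae (ae_of_all _ fun τ => ?_)
  have e1 : (H τ).re * (α τ).re + (H τ).im * (α τ).im = (conj (α τ) * H τ).re := by
    rw [← re_mul_re_add_im_mul_im₈]
    ring
  exact e1

/-- **The energy identity of one Fourier mode, vector form (tensor viscosity, with forcing).** For a
forced weak solution with datum `w₀ ∈ L²` weakly divergence free, every frequency `k` and a.e.
`t ∈ (0,T)`:
`‖ŵ(t)(k)‖² = ‖ŵ₀(k)‖² + 2 ∫_{(0,t]} Re (−4π² ⟪ŵ, T_𝔸(k) ŵ⟫ + B_τ(ŵ) + ⟪ĝ(k), ŵ⟫ − Σⱼ 2πikⱼ ⟪𝓕(F j)(k), ŵ⟫) dτ`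
(`ŵ = ŵ(τ)(k)`; the tested identities summed over an orthonormal basis of `k^⊥ ⊂ ℂ^d`, in which
`ŵ(τ)(k)` lies for a.e. `τ`). [cite: RobinsonRodrigoSadowski2016, §4.2 (Galerkin energy estimate)]
[cite: Frisch1995Turbulence, §9.6.3 eq. (9.57) p. 233] -/
theorem ae_sq_norm_mFourierCoeff_eq (h : IsWeakTensorPassiveVectorForcedOn A T 𝔸 b g F w₀ w) (hw₀ : MemLp w₀ 2 volume)
    (hdiv₀ : FunctionSpaces.Torus.IsWeaklyDivFree w₀) (k : d → ℤ) :
    ∀ᵐ t ∂(volume.restrict (Ioo 0 T)),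
      ‖mFourierCoeff (FunctionSpaces.EuclideanSpace.complexify ∘ w t) k‖ ^ 2 =
        ‖mFourierCoeff (FunctionSpaces.EuclideanSpace.complexify ∘ w₀) k‖ ^ 2 +
        2 * ∫ τ in Ioc 0 t,
          (((-(4 * Real.pi ^ 2 : ℝ) : ℂ) *
              ⟪mFourierCoeff (FunctionSpaces.EuclideanSpace.complexify ∘ w τ) k,
                symbT 𝔸 k (mFourierCoeff (FunctionSpaces.EuclideanSpace.complexify ∘ w τ) k)⟫_ℂ +
            ((∑ j, (2 * Real.pi * I * (k j)) *
                ⟪mFourierCoeff (FunctionSpaces.EuclideanSpace.complexify ∘ fun x => b τ x j • w τ x) k,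
                  mFourierCoeff (FunctionSpaces.EuclideanSpace.complexify ∘ w τ) k⟫_ℂ) +
              (A : ℂ) * ∑ j, (2 * Real.pi * I * (k j)) *
                ⟪mFourierCoeff (FunctionSpaces.EuclideanSpace.complexify ∘ fun x => w τ x j • b τ x) k,
                  mFourierCoeff (FunctionSpaces.EuclideanSpace.complexify ∘ w τ) k⟫_ℂ)) +
          (⟪mFourierCoeff (FunctionSpaces.EuclideanSpace.complexify ∘ g τ) k,
              mFourierCoeff (FunctionSpaces.EuclideanSpace.complexify ∘ w τ) k⟫_ℂ -
            ∑ j, (2 * Real.pi * I * (k j)) *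
              ⟪mFourierCoeff (FunctionSpaces.EuclideanSpace.complexify ∘ F j τ) k,
                mFourierCoeff (FunctionSpaces.EuclideanSpace.complexify ∘ w τ) k⟫_ℂ)).re := by
  have hw₀i : Integrable w₀ volume := hw₀.integrable one_le_two
  -- names
  set X : ℝ → EuclideanSpace ℂ d := fun t => mFourierCoeff (FunctionSpaces.EuclideanSpace.complexify ∘ w t) k with hX
  set X₀ : EuclideanSpace ℂ d := mFourierCoeff (FunctionSpaces.EuclideanSpace.complexify ∘ w₀) k with hX₀
  set F' : d → ℝ → EuclideanSpace ℂ d := fun j τ =>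
    mFourierCoeff (FunctionSpaces.EuclideanSpace.complexify ∘ fun x => b τ x j • w τ x) k with hF'
  set G' : d → ℝ → EuclideanSpace ℂ d := fun j τ =>
    mFourierCoeff (FunctionSpaces.EuclideanSpace.complexify ∘ fun x => w τ x j • b τ x) k with hG'
  set P : ℝ → EuclideanSpace ℂ d := fun τ => mFourierCoeff (FunctionSpaces.EuclideanSpace.complexify ∘ g τ) k with hP
  set Q : d → ℝ → EuclideanSpace ℂ d := fun j τ =>
    mFourierCoeff (FunctionSpaces.EuclideanSpace.complexify ∘ F j τ) k with hQ
  -- sum the tested identities over an orthonormal basis of `k^⊥`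
  set S : Submodule ℂ (EuclideanSpace ℂ d) :=
    (ℂ ∙ (WithLp.toLp 2 (fun j => ((k j : ℤ) : ℂ)) : EuclideanSpace ℂ d))ᗮ with hS
  let bS := stdOrthonormalBasis ℂ S
  set e : Fin (Module.finrank ℂ S) → EuclideanSpace ℂ d := fun i => (bS i : EuclideanSpace ℂ d) with he
  have he_tr : ∀ i, ∑ j, (k j : ℂ) * e i j = 0 := fun i => (mem_orthogonal_waveVec_iff k _).1 (bS i).2
  have hX₀S : X₀ ∈ S := (mem_orthogonal_waveVec_iff k X₀).2 (hdiv₀.sum_mul_mFourierCoeff_eq_zero hw₀ k)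
  have hXt := h.ae_sum_mul_mFourierCoeff_eq_zero k
  -- the mode right-hand side at `z`
  set H : EuclideanSpace ℂ d → ℝ → ℂ := fun z τ =>
    ((-(4 * Real.pi ^ 2 : ℝ) : ℂ) * ⟪X τ, symbT 𝔸 k z⟫_ℂ +
      ((∑ j, (2 * Real.pi * I * (k j)) * ⟪F' j τ, z⟫_ℂ) + (A : ℂ) * ∑ j, (2 * Real.pi * I * (k j)) * ⟪G' j τ, z⟫_ℂ)) +
      (⟪P τ, z⟫_ℂ - ∑ j, (2 * Real.pi * I * (k j)) * ⟪Q j τ, z⟫_ℂ)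
    with hH
  have hHi : ∀ z, IntegrableOn (H z) (Ioo 0 T) volume := fun z => h.integrableOn_modeRHS k z
  have hall := ae_all_iff.2 fun i => h.ae_sq_norm_inner_mFourierCoeff_eq hw₀i k (z := e i) (he_tr i)
  -- integrability of the summands on `(0,T)`
  have hIi : ∀ i, IntegrableOn (fun τ => (conj ⟪X τ, e i⟫_ℂ * H (e i) τ).re) (Ioo 0 T) volume :=
    fun i => (h.integrableOn_conj_inner_mul k (e i) (hHi (e i))).re
  -- the pointwise basis identity for a transversal `X τ`
  have hframe : ∀ᵐ τ ∂(volume.restrict (Ioo 0 T)),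
      ∑ i, (conj ⟪X τ, e i⟫_ℂ * H (e i) τ).re = (H (X τ) τ).re := by
    filter_upwards [hXt] with τ hτ
    have hXS : X τ ∈ S := (mem_orthogonal_waveVec_iff k (X τ)).2 hτ
    rw [← Complex.re_sum]
    congr 1
    have hlin := modeRHS_sum_smul₈ Finset.univ 𝔸 k A (X τ) (P τ) (fun j => F' j τ) (fun j => G' j τ) (fun j => Q j τ)
      (fun i => conj ⟪X τ, e i⟫_ℂ) e
    rw [sum_conj_inner_smul_onb₈ bS hXS] at hlin
    rw [hH]
    exact hlin.symm
  filter_upwards [hall, hXt, ae_restrict_mem measurableSet_Ioo] with t ht hXtt htT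
  have hsub : Ioc 0 t ⊆ Ioo 0 T := Ioc_subset_Ioo_right htT.2
  have hXS : X t ∈ S := (mem_orthogonal_waveVec_iff k (X t)).2 hXtt
  -- sum the basis identities
  have hsum : ∑ i, ‖⟪X t, e i⟫_ℂ‖ ^ 2 = ∑ i, (‖⟪X₀, e i⟫_ℂ‖ ^ 2 +
      2 * ∫ τ in Ioc 0 t, (conj ⟪X τ, e i⟫_ℂ * H (e i) τ).re) :=
    Finset.sum_congr rfl fun i _ => ht i
  rw [sum_sq_norm_inner_onb₈ bS hXS, Finset.sum_add_distrib, sum_sq_norm_inner_onb₈ bS hX₀S, ← Finset.mul_sum,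
    ← integral_finsetSum _ (fun i _ => (hIi i).mono_set hsub),
    integral_congr_ae (ae_restrict_of_ae_restrict_of_subset hsub hframe)] at hsum
  rw [hX] at hsum
  exact hsum

/-! ## §5 The truncated energy identity with the work of the forcing -/

omit [DecidableEq d] in
/-- `P_N u = ∑_{|k|≤N} Re (e_k • û(k))` as a sum of single real modes. [folklore] -/
private theorem fourierTruncate_eq_sum_singleton₈ [DecidableEq d] (N : ℕ) (u : UnitAddTorus d → EuclideanSpace ℝ d) :
    FunctionSpaces.Torus.fourierTruncate N u = fun y => ∑ k ∈ FunctionSpaces.Torus.freqBall N,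
      (1 : ℝ) • FunctionSpaces.Torus.realTrigPoly {k}
        (fun k' => mFourierCoeff (FunctionSpaces.EuclideanSpace.complexify ∘ u) k') y := by
  funext y
  rw [FunctionSpaces.Torus.fourierTruncate_eq, FunctionSpaces.Torus.realTrigPoly_apply_eq_sum]
  refine Finset.sum_congr rfl fun k _ => ?_
  rw [one_smul, FunctionSpaces.Torus.realTrigPoly_apply_eq_sum, Finset.sum_singleton]

/-- **The transport flux against the own truncation in Fourier variables** (forced class): for a.e.
`s ∈ (0,T)` and every `N`,
`∫⟪w(s),(b(s)·∇)P_N w(s)⟫ + A∫⟪b(s),(w(s)·∇)P_N w(s)⟫ = ∑_{|k|≤N} Re B_k(ŵ(s)(k))(s)`.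
[cite: RobinsonRodrigoSadowski2016, §4.1 (Galerkin truncations)] -/
theorem ae_galerkinFlux_eq_sum (h : IsWeakTensorPassiveVectorForcedOn A T 𝔸 b g F w₀ w) :
    ∀ᵐ s ∂(volume.restrict (Ioo 0 T)), ∀ N : ℕ,
      (∫ x, ⟪w s x, FunctionSpaces.Torus.convect (b s) (FunctionSpaces.Torus.fourierTruncate N (w s)) x⟫_ℝ) +
          A * ∫ x, ⟪b s x, FunctionSpaces.Torus.convect (w s) (FunctionSpaces.Torus.fourierTruncate N (w s)) x⟫_ℝ =
        ∑ k ∈ FunctionSpaces.Torus.freqBall N,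
          ((∑ j, (2 * Real.pi * I * (k j)) *
              ⟪mFourierCoeff (FunctionSpaces.EuclideanSpace.complexify ∘ fun x => b s x j • w s x) k,
                mFourierCoeff (FunctionSpaces.EuclideanSpace.complexify ∘ w s) k⟫_ℂ) +
            (A : ℂ) * ∑ j, (2 * Real.pi * I * (k j)) *
              ⟪mFourierCoeff (FunctionSpaces.EuclideanSpace.complexify ∘ fun x => w s x j • b s x) k,
                mFourierCoeff (FunctionSpaces.EuclideanSpace.complexify ∘ w s) k⟫_ℂ).re := by
  filter_upwards [h.ae_integrable_slice] with s hs
  intro N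
  set c : (d → ℤ) → EuclideanSpace ℂ d := fun k' => mFourierCoeff (FunctionSpaces.EuclideanSpace.complexify ∘ w s) k'
    with hc
  have ha : ∀ k : d → ℤ, FunctionSpaces.Torus.IsSmooth (FunctionSpaces.Torus.realTrigPoly {k} c) :=
    fun k => FunctionSpaces.Torus.isSmooth_realTrigPoly _ _
  have e1 : ∫ x, ⟪w s x, FunctionSpaces.Torus.convect (b s) (FunctionSpaces.Torus.fourierTruncate N (w s)) x⟫_ℝ =
      ∑ k ∈ FunctionSpaces.Torus.freqBall N, (∑ j, (2 * Real.pi * I * (k j)) *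
        ⟪mFourierCoeff (FunctionSpaces.EuclideanSpace.complexify ∘ fun x => b s x j • w s x) k, c k⟫_ℂ).re := by
    rw [fourierTruncate_eq_sum_singleton₈ N (w s),
      ← sum_mul_integral_inner_convect_eq (FunctionSpaces.Torus.freqBall N) (fun _ => (1 : ℝ)) ha hs.2.1]
    refine Finset.sum_congr rfl fun k _ => ?_
    rw [one_mul, integral_inner_convect_realTrigPoly_singleton hs.2.1 k c]
  have e2 : ∫ x, ⟪b s x, FunctionSpaces.Torus.convect (w s) (FunctionSpaces.Torus.fourierTruncate N (w s)) x⟫_ℝ =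
      ∑ k ∈ FunctionSpaces.Torus.freqBall N, (∑ j, (2 * Real.pi * I * (k j)) *
        ⟪mFourierCoeff (FunctionSpaces.EuclideanSpace.complexify ∘ fun x => w s x j • b s x) k, c k⟫_ℂ).re := by
    rw [fourierTruncate_eq_sum_singleton₈ N (w s),
      ← sum_mul_integral_inner_convect_eq (FunctionSpaces.Torus.freqBall N) (fun _ => (1 : ℝ)) ha hs.2.2.1]
    refine Finset.sum_congr rfl fun k _ => ?_
    rw [one_mul, integral_inner_convect_realTrigPoly_singleton hs.2.2.1 k c]
  rw [e1, e2, Finset.mul_sum, ← Finset.sum_add_distrib]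
  refine Finset.sum_congr rfl fun k _ => ?_
  rw [Complex.add_re, Complex.re_ofReal_mul]

/-- **The work of the forcing on the own truncation in Fourier variables**: for a.e. `s ∈ (0,T)` and
every `N`,
`∫⟪g(s), P_N w(s)⟫ − Σⱼ ∫⟪F j(s), ∂ⱼ P_N w(s)⟫ = ∑_{|k|≤N} Re (⟪ĝ(s)(k), ŵ(s)(k)⟫ − Σⱼ 2πikⱼ ⟪𝓕(F j(s))(k), ŵ(s)(k)⟫)`
(the general pairing formula for real trigonometric polynomials). [cite: Grafakos2014, §3.1.1] -/
theorem ae_galerkinForce_eq_sum (h : IsWeakTensorPassiveVectorForcedOn A T 𝔸 b g F w₀ w) :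
    ∀ᵐ s ∂(volume.restrict (Ioo 0 T)), ∀ N : ℕ,
      (∫ x, ⟪g s x, FunctionSpaces.Torus.fourierTruncate N (w s) x⟫_ℝ) -
          ∑ j, ∫ x, ⟪F j s x, FunctionSpaces.Torus.partialDeriv j (FunctionSpaces.Torus.fourierTruncate N (w s)) x⟫_ℝ =
        ∑ k ∈ FunctionSpaces.Torus.freqBall N,
          (⟪mFourierCoeff (FunctionSpaces.EuclideanSpace.complexify ∘ g s) k,
              mFourierCoeff (FunctionSpaces.EuclideanSpace.complexify ∘ w s) k⟫_ℂ -
            ∑ j, (2 * Real.pi * I * (k j)) *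
              ⟪mFourierCoeff (FunctionSpaces.EuclideanSpace.complexify ∘ F j s) k,
                mFourierCoeff (FunctionSpaces.EuclideanSpace.complexify ∘ w s) k⟫_ℂ).re := by
  filter_upwards [h.ae_integrable_slice] with s hs
  intro N
  set c : (d → ℤ) → EuclideanSpace ℂ d := fun k' => mFourierCoeff (FunctionSpaces.EuclideanSpace.complexify ∘ w s) k'
    with hc
  have e1 : ∫ x, ⟪g s x, FunctionSpaces.Torus.fourierTruncate N (w s) x⟫_ℝ =
      ∑ k ∈ FunctionSpaces.Torus.freqBall N,
        (⟪mFourierCoeff (FunctionSpaces.EuclideanSpace.complexify ∘ g s) k, c k⟫_ℂ).re := by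
    rw [FunctionSpaces.Torus.fourierTruncate_eq]
    exact FunctionSpaces.Torus.integral_inner_realTrigPoly_of_integrable _ c hs.2.2.2.1
  have e2 : ∀ j, ∫ x, ⟪F j s x, FunctionSpaces.Torus.partialDeriv j (FunctionSpaces.Torus.fourierTruncate N (w s)) x⟫_ℝ =
      ∑ k ∈ FunctionSpaces.Torus.freqBall N,
        ((2 * Real.pi * I * (k j)) * ⟪mFourierCoeff (FunctionSpaces.EuclideanSpace.complexify ∘ F j s) k, c k⟫_ℂ).re := by
    intro j
    rw [FunctionSpaces.Torus.fourierTruncate_eq, FunctionSpaces.Torus.partialDeriv_realTrigPoly',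
      FunctionSpaces.Torus.integral_inner_realTrigPoly_of_integrable _ _ (hs.2.2.2.2 j)]
    refine Finset.sum_congr rfl fun k _ => ?_
    rw [inner_smul_right]
  rw [e1]
  simp_rw [e2]
  rw [Finset.sum_comm, ← Finset.sum_sub_distrib]
  refine Finset.sum_congr rfl fun k _ => ?_
  rw [Complex.sub_re, Complex.re_sum]

/-- The transport part of the mode energy integrand, `s ↦ B_k(ŵ(s)(k))(s)`, is integrable on `(0,T)`.
[cite: RobinsonRodrigoSadowski2016, §4.2 (Galerkin energy estimate)] -/
theorem integrableOn_modeRHS_self (h : IsWeakTensorPassiveVectorForcedOn A T 𝔸 b g F w₀ w) (k : d → ℤ) :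
    IntegrableOn (fun s =>
      (∑ j, (2 * Real.pi * I * (k j)) *
          ⟪mFourierCoeff (FunctionSpaces.EuclideanSpace.complexify ∘ fun x => b s x j • w s x) k,
            mFourierCoeff (FunctionSpaces.EuclideanSpace.complexify ∘ w s) k⟫_ℂ) +
        (A : ℂ) * ∑ j, (2 * Real.pi * I * (k j)) *
          ⟪mFourierCoeff (FunctionSpaces.EuclideanSpace.complexify ∘ fun x => w s x j • b s x) k,
            mFourierCoeff (FunctionSpaces.EuclideanSpace.complexify ∘ w s) k⟫_ℂ) (Ioo 0 T) volume := by
  obtain ⟨C₁, _, hXb⟩ := h.exists_ae_norm_mFourierCoeff_le k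
  have hXm : AEStronglyMeasurable (fun s => mFourierCoeff (FunctionSpaces.EuclideanSpace.complexify ∘ w s) k)
      (volume.restrict (Ioo 0 T)) := (h.integrableOn_mFourierCoeff k).aestronglyMeasurable
  exact (integrable_finsetSum _ fun j _ =>
      (integrableOn_inner_of_bdd₈ (h.integrableOn_mFourierCoeff_carrier_smul j k) hXm hXb).const_mul _).add
    ((integrable_finsetSum _ fun j _ =>
      (integrableOn_inner_of_bdd₈ (h.integrableOn_mFourierCoeff_smul_carrier j k) hXm hXb).const_mul _).const_mul _)

/-- The forcing part of the mode energy integrand, `s ↦ ⟪ĝ(s)(k), ŵ(s)(k)⟫ − Σⱼ 2πikⱼ ⟪𝓕(F j(s))(k), ŵ(s)(k)⟫`,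
is integrable on `(0,T)`. [cite: Temam1997, Ch. II §3.1–3.2, (3.2)–(3.5), Thm. 3.1] -/
theorem integrableOn_modeForce_self (h : IsWeakTensorPassiveVectorForcedOn A T 𝔸 b g F w₀ w) (k : d → ℤ) :
    IntegrableOn (fun s =>
      ⟪mFourierCoeff (FunctionSpaces.EuclideanSpace.complexify ∘ g s) k,
          mFourierCoeff (FunctionSpaces.EuclideanSpace.complexify ∘ w s) k⟫_ℂ -
        ∑ j, (2 * Real.pi * I * (k j)) *
          ⟪mFourierCoeff (FunctionSpaces.EuclideanSpace.complexify ∘ F j s) k,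
            mFourierCoeff (FunctionSpaces.EuclideanSpace.complexify ∘ w s) k⟫_ℂ) (Ioo 0 T) volume := by
  obtain ⟨C₁, _, hXb⟩ := h.exists_ae_norm_mFourierCoeff_le k
  have hXm : AEStronglyMeasurable (fun s => mFourierCoeff (FunctionSpaces.EuclideanSpace.complexify ∘ w s) k)
      (volume.restrict (Ioo 0 T)) := (h.integrableOn_mFourierCoeff k).aestronglyMeasurable
  exact (integrableOn_inner_of_bdd₈ (h.integrableOn_mFourierCoeff_force k) hXm hXb).sub
    (integrable_finsetSum _ fun j _ =>
      (integrableOn_inner_of_bdd₈ (h.integrableOn_mFourierCoeff_flux j k) hXm hXb).const_mul _)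

/-- The viscous mode pairing `τ ↦ ⟪ŵ(τ)(k), T_𝔸(k) ŵ(τ)(k)⟫` is integrable on `(0,T)` (essentially
bounded, `T_𝔸(k)` bounded). [cite: Frisch1995Turbulence, §9.6.3 eq. (9.57) p. 233] -/
theorem integrableOn_inner_symbT (h : IsWeakTensorPassiveVectorForcedOn A T 𝔸 b g F w₀ w) (k : d → ℤ) :
    IntegrableOn (fun τ => ⟪mFourierCoeff (FunctionSpaces.EuclideanSpace.complexify ∘ w τ) k,
      symbT 𝔸 k (mFourierCoeff (FunctionSpaces.EuclideanSpace.complexify ∘ w τ) k)⟫_ℂ) (Ioo 0 T) volume := by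
  obtain ⟨K, hK0, hK⟩ := h.exists_ae_norm_mFourierCoeff_le k
  obtain ⟨C, hC0, hC⟩ := exists_norm_symbT_le 𝔸 k
  have hXm : AEStronglyMeasurable (fun τ => mFourierCoeff (FunctionSpaces.EuclideanSpace.complexify ∘ w τ) k)
      (volume.restrict (Ioo 0 T)) := (h.integrableOn_mFourierCoeff k).aestronglyMeasurable
  have hm : AEStronglyMeasurable (fun τ => ⟪mFourierCoeff (FunctionSpaces.EuclideanSpace.complexify ∘ w τ) k,
      symbT 𝔸 k (mFourierCoeff (FunctionSpaces.EuclideanSpace.complexify ∘ w τ) k)⟫_ℂ)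
      (volume.restrict (Ioo 0 T)) :=
    hXm.inner ((continuous_symbT 𝔸 k).comp_aestronglyMeasurable hXm)
  refine IntegrableOn.of_bound measure_Ioo_lt_top hm (K * (C * K)) ?_
  filter_upwards [hK] with τ hτ
  exact (norm_inner_le_norm _ _).trans (mul_le_mul hτ ((hC _).trans (mul_le_mul_of_nonneg_left hτ hC0))
    (norm_nonneg _) hK0)

/-- The transport flux against the own truncation is integrable on `(0,T)`.
[cite: RobinsonRodrigoSadowski2016, §4.2 (Galerkin energy estimate)] -/
theorem integrableOn_galerkinFlux (h : IsWeakTensorPassiveVectorForcedOn A T 𝔸 b g F w₀ w) (N : ℕ) :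
    IntegrableOn (fun s =>
      (∫ x, ⟪w s x, FunctionSpaces.Torus.convect (b s) (FunctionSpaces.Torus.fourierTruncate N (w s)) x⟫_ℝ) +
        A * ∫ x, ⟪b s x, FunctionSpaces.Torus.convect (w s) (FunctionSpaces.Torus.fourierTruncate N (w s)) x⟫_ℝ)
      (Ioo 0 T) volume := by
  have hsum : IntegrableOn (fun s => ∑ k ∈ FunctionSpaces.Torus.freqBall N,
      ((∑ j, (2 * Real.pi * I * (k j)) *
          ⟪mFourierCoeff (FunctionSpaces.EuclideanSpace.complexify ∘ fun x => b s x j • w s x) k,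
            mFourierCoeff (FunctionSpaces.EuclideanSpace.complexify ∘ w s) k⟫_ℂ) +
        (A : ℂ) * ∑ j, (2 * Real.pi * I * (k j)) *
          ⟪mFourierCoeff (FunctionSpaces.EuclideanSpace.complexify ∘ fun x => w s x j • b s x) k,
            mFourierCoeff (FunctionSpaces.EuclideanSpace.complexify ∘ w s) k⟫_ℂ).re) (Ioo 0 T) volume :=
    integrable_finsetSum _ fun k _ => (h.integrableOn_modeRHS_self k).re
  refine hsum.congr ?_
  filter_upwards [h.ae_galerkinFlux_eq_sum] with s hs
  exact (hs N).symm

/-- The work of the forcing on the own truncation is integrable on `(0,T)`.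
[cite: Temam1997, Ch. II §3.1–3.2, (3.2)–(3.5), Thm. 3.1] -/
theorem integrableOn_galerkinForce (h : IsWeakTensorPassiveVectorForcedOn A T 𝔸 b g F w₀ w) (N : ℕ) :
    IntegrableOn (fun s =>
      (∫ x, ⟪g s x, FunctionSpaces.Torus.fourierTruncate N (w s) x⟫_ℝ) -
        ∑ j, ∫ x, ⟪F j s x, FunctionSpaces.Torus.partialDeriv j (FunctionSpaces.Torus.fourierTruncate N (w s)) x⟫_ℝ)
      (Ioo 0 T) volume := by
  have hsum : IntegrableOn (fun s => ∑ k ∈ FunctionSpaces.Torus.freqBall N,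
      (⟪mFourierCoeff (FunctionSpaces.EuclideanSpace.complexify ∘ g s) k,
          mFourierCoeff (FunctionSpaces.EuclideanSpace.complexify ∘ w s) k⟫_ℂ -
        ∑ j, (2 * Real.pi * I * (k j)) *
          ⟪mFourierCoeff (FunctionSpaces.EuclideanSpace.complexify ∘ F j s) k,
            mFourierCoeff (FunctionSpaces.EuclideanSpace.complexify ∘ w s) k⟫_ℂ).re) (Ioo 0 T) volume :=
    integrable_finsetSum _ fun k _ => (h.integrableOn_modeForce_self k).re
  refine hsum.congr ?_
  filter_upwards [h.ae_galerkinForce_eq_sum] with s hs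
  exact (hs N).symm

/-- The truncated symbol form `Q_N(s) = 4π² Σ_{|k|≤N} Re ⟪ŵ(s)(k), T_𝔸(k) ŵ(s)(k)⟫` is integrable on
`(0,T)`. [cite: Frisch1995Turbulence, §9.6.3 eq. (9.57) p. 233] -/
theorem integrableOn_symbForm (h : IsWeakTensorPassiveVectorForcedOn A T 𝔸 b g F w₀ w) (N : ℕ) :
    IntegrableOn (fun s => 4 * Real.pi ^ 2 * ∑ k ∈ FunctionSpaces.Torus.freqBall N,
      (⟪mFourierCoeff (FunctionSpaces.EuclideanSpace.complexify ∘ w s) k,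
        symbT 𝔸 k (mFourierCoeff (FunctionSpaces.EuclideanSpace.complexify ∘ w s) k)⟫_ℂ).re) (Ioo 0 T) volume :=
  (integrable_finsetSum _ fun k _ => (h.integrableOn_inner_symbT k).re).const_mul _

/-- **The truncated energy identity of a forced weak tensor-viscosity passive-vector solution.** For a
datum `w₀ ∈ L²` weakly divergence free, a.e. `t ∈ (0,T)` and every `N`:
`∑_{|k|≤N} ‖ŵ(t)(k)‖² + 2 ∫_{(0,t]} Q_N(s) ds
   = ∑_{|k|≤N} ‖ŵ₀(k)‖² + 2 ∫_{(0,t]} (Flux_N(s) + ∫⟪g(s), P_N w(s)⟫ − Σⱼ ∫⟪F j(s), ∂ⱼ P_N w(s)⟫) ds`,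
`Q_N(s) = 4π² ∑_{|k|≤N} Re ⟪ŵ(s)(k), T_𝔸(k) ŵ(s)(k)⟫`,
`Flux_N(s) = ∫⟪w(s),(b(s)·∇)P_N w(s)⟫ + A ∫⟪b(s),(w(s)·∇)P_N w(s)⟫` — the Galerkin system tested against
its own solution, with the work of the forcing (Robinson–Rodrigo–Sadowski 2016, (4.20) with a right-hand
side). [cite: RobinsonRodrigoSadowski2016, §4.2 (4.20)] [cite: Temam1997, Ch. II §3.1–3.2, (3.2)–(3.5), Thm. 3.1] -/
theorem ae_sum_sq_norm_mFourierCoeff_eq (h : IsWeakTensorPassiveVectorForcedOn A T 𝔸 b g F w₀ w) (hw₀ : MemLp w₀ 2 volume)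
    (hdiv₀ : FunctionSpaces.Torus.IsWeaklyDivFree w₀) :
    ∀ᵐ t ∂(volume.restrict (Ioo 0 T)), ∀ N : ℕ,
      (∑ k ∈ FunctionSpaces.Torus.freqBall N, ‖mFourierCoeff (FunctionSpaces.EuclideanSpace.complexify ∘ w t) k‖ ^ 2) +
          2 * ∫ s in Ioc 0 t, 4 * Real.pi ^ 2 * ∑ k ∈ FunctionSpaces.Torus.freqBall N,
            (⟪mFourierCoeff (FunctionSpaces.EuclideanSpace.complexify ∘ w s) k,
              symbT 𝔸 k (mFourierCoeff (FunctionSpaces.EuclideanSpace.complexify ∘ w s) k)⟫_ℂ).re =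
        (∑ k ∈ FunctionSpaces.Torus.freqBall N, ‖mFourierCoeff (FunctionSpaces.EuclideanSpace.complexify ∘ w₀) k‖ ^ 2) +
          2 * ∫ s in Ioc 0 t,
            (((∫ x, ⟪w s x, FunctionSpaces.Torus.convect (b s) (FunctionSpaces.Torus.fourierTruncate N (w s)) x⟫_ℝ) +
              A * ∫ x, ⟪b s x, FunctionSpaces.Torus.convect (w s) (FunctionSpaces.Torus.fourierTruncate N (w s)) x⟫_ℝ) +
            ((∫ x, ⟪g s x, FunctionSpaces.Torus.fourierTruncate N (w s) x⟫_ℝ) -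
              ∑ j, ∫ x, ⟪F j s x,
                FunctionSpaces.Torus.partialDeriv j (FunctionSpaces.Torus.fourierTruncate N (w s)) x⟫_ℝ)) := by
  -- names
  set X : (d → ℤ) → ℝ → EuclideanSpace ℂ d := fun k t =>
    mFourierCoeff (FunctionSpaces.EuclideanSpace.complexify ∘ w t) k with hX
  set X₀ : (d → ℤ) → EuclideanSpace ℂ d := fun k =>
    mFourierCoeff (FunctionSpaces.EuclideanSpace.complexify ∘ w₀) k with hX₀
  set Bf : (d → ℤ) → ℝ → ℂ := fun k s =>
    (∑ j, (2 * Real.pi * I * (k j)) *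
        ⟪mFourierCoeff (FunctionSpaces.EuclideanSpace.complexify ∘ fun x => b s x j • w s x) k, X k s⟫_ℂ) +
      (A : ℂ) * ∑ j, (2 * Real.pi * I * (k j)) *
        ⟪mFourierCoeff (FunctionSpaces.EuclideanSpace.complexify ∘ fun x => w s x j • b s x) k, X k s⟫_ℂ with hBf
  set Gf : (d → ℤ) → ℝ → ℂ := fun k s =>
    ⟪mFourierCoeff (FunctionSpaces.EuclideanSpace.complexify ∘ g s) k, X k s⟫_ℂ -
      ∑ j, (2 * Real.pi * I * (k j)) *
        ⟪mFourierCoeff (FunctionSpaces.EuclideanSpace.complexify ∘ F j s) k, X k s⟫_ℂ with hGf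
  set Vf : (d → ℤ) → ℝ → ℂ := fun k s => ⟪X k s, symbT 𝔸 k (X k s)⟫_ℂ with hVf
  set Fl : ℕ → ℝ → ℝ := fun N s =>
    (∫ x, ⟪w s x, FunctionSpaces.Torus.convect (b s) (FunctionSpaces.Torus.fourierTruncate N (w s)) x⟫_ℝ) +
      A * ∫ x, ⟪b s x, FunctionSpaces.Torus.convect (w s) (FunctionSpaces.Torus.fourierTruncate N (w s)) x⟫_ℝ with hFl
  set Wk : ℕ → ℝ → ℝ := fun N s =>
    (∫ x, ⟪g s x, FunctionSpaces.Torus.fourierTruncate N (w s) x⟫_ℝ) -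
      ∑ j, ∫ x, ⟪F j s x, FunctionSpaces.Torus.partialDeriv j (FunctionSpaces.Torus.fourierTruncate N (w s)) x⟫_ℝ
    with hWk
  have hHi : ∀ k, IntegrableOn (fun s => ((((-(4 * Real.pi ^ 2 : ℝ) : ℂ) * Vf k s + Bf k s) + Gf k s)).re) (Ioo 0 T) volume :=
    fun k => ((((h.integrableOn_inner_symbT k).const_mul _).add (h.integrableOn_modeRHS_self k)).add
      (h.integrableOn_modeForce_self k)).re
  -- all one-mode identities at once, and the flux / work identifications
  have hmodes := ae_all_iff.2 fun k => h.ae_sq_norm_mFourierCoeff_eq hw₀ hdiv₀ k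
  have hflux' : ∀ᵐ s ∂(volume : Measure ℝ), s ∈ Ioo 0 T → ∀ N : ℕ,
      Fl N s = ∑ k ∈ FunctionSpaces.Torus.freqBall N, (Bf k s).re :=
    (ae_restrict_iff' measurableSet_Ioo).1 h.ae_galerkinFlux_eq_sum
  have hwork' : ∀ᵐ s ∂(volume : Measure ℝ), s ∈ Ioo 0 T → ∀ N : ℕ,
      Wk N s = ∑ k ∈ FunctionSpaces.Torus.freqBall N, (Gf k s).re :=
    (ae_restrict_iff' measurableSet_Ioo).1 h.ae_galerkinForce_eq_sum
  filter_upwards [hmodes, ae_restrict_mem measurableSet_Ioo] with t ht htT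
  intro N
  have hsub : Ioc 0 t ⊆ Ioo 0 T := Ioc_subset_Ioo_right htT.2
  -- sum the one-mode identities over the ball
  have hsum : ∑ k ∈ FunctionSpaces.Torus.freqBall N, ‖X k t‖ ^ 2 =
      ∑ k ∈ FunctionSpaces.Torus.freqBall N, (‖X₀ k‖ ^ 2 +
        2 * ∫ s in Ioc 0 t, ((((-(4 * Real.pi ^ 2 : ℝ) : ℂ) * Vf k s + Bf k s) + Gf k s)).re) :=
    Finset.sum_congr rfl fun k _ => ht k
  rw [Finset.sum_add_distrib, ← Finset.mul_sum,
    ← integral_finsetSum _ (fun k _ => (hHi k).mono_set hsub)] at hsum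
  -- split the summed integrand
  have hsplit : ∫ s in Ioc 0 t, ∑ k ∈ FunctionSpaces.Torus.freqBall N,
      ((((-(4 * Real.pi ^ 2 : ℝ) : ℂ) * Vf k s + Bf k s) + Gf k s)).re =
      (∫ s in Ioc 0 t, (Fl N s + Wk N s)) -
        ∫ s in Ioc 0 t, 4 * Real.pi ^ 2 * ∑ k ∈ FunctionSpaces.Torus.freqBall N, (Vf k s).re := by
    have hQi : IntegrableOn (fun s => 4 * Real.pi ^ 2 * ∑ k ∈ FunctionSpaces.Torus.freqBall N, (Vf k s).re)
        (Ioc 0 t) volume := (h.integrableOn_symbForm N).mono_set hsub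
    have hFli : IntegrableOn (fun s => Fl N s + Wk N s) (Ioc 0 t) volume :=
      ((h.integrableOn_galerkinFlux N).add (h.integrableOn_galerkinForce N)).mono_set hsub
    rw [← integral_sub hFli hQi]
    refine setIntegral_congr_ae measurableSet_Ioc ?_
    filter_upwards [hflux', hwork'] with s hs hs' hsI
    rw [hs (hsub hsI) N, hs' (hsub hsI) N, Finset.mul_sum, ← Finset.sum_add_distrib, ← Finset.sum_sub_distrib]
    refine Finset.sum_congr rfl fun k _ => ?_
    rw [Complex.add_re, Complex.add_re, neg_mul, Complex.neg_re, Complex.re_ofReal_mul]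
    ring
  rw [hsplit] at hsum
  rw [hX] at hsum
  simp only at hsum
  linarith

/-! ## §6 Coercivity, the flux remainder, the work bounds, the tails -/

/-- **Coercivity of the truncated symbol form against the truncated dissipation.** In a window
`NearIso 𝔸 lo hi`, for a.e. `s ∈ (0,T)` and every `N`: `lo ‖∇P_N w(s)‖₂² ≤ Q_N(s)`.
[cite: Giaquinta1983MultipleIntegrals, Ch. III §2 eq. (2.2)] [cite: Frisch1995Turbulence, §9.6.3 eq. (9.57) p. 233] -/
theorem ae_lo_mul_le_symbForm (h : IsWeakTensorPassiveVectorForcedOn A T 𝔸 b g F w₀ w) {lo hi : ℝ}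
    (h𝔸 : NearIso 𝔸 lo hi) :
    ∀ᵐ s ∂(volume.restrict (Ioo 0 T)), ∀ N : ℕ,
      lo * (FunctionSpaces.Torus.eGradNormSq (FunctionSpaces.Torus.fourierTruncate N (w s))).toReal ≤
        4 * Real.pi ^ 2 * ∑ k ∈ FunctionSpaces.Torus.freqBall N,
          (⟪mFourierCoeff (FunctionSpaces.EuclideanSpace.complexify ∘ w s) k,
            symbT 𝔸 k (mFourierCoeff (FunctionSpaces.EuclideanSpace.complexify ∘ w s) k)⟫_ℂ).re := by
  have htr := ae_all_iff.2 fun k => h.ae_sum_mul_mFourierCoeff_eq_zero k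
  filter_upwards [htr, h.ae_integrable_slice] with s hs hsi
  intro N
  rw [FunctionSpaces.Torus.fourierTruncate_eq,
    FunctionSpaces.Torus.toReal_eGradNormSq_realTrigPoly FunctionSpaces.Torus.neg_mem_freqBall_of_mem
      (FunctionSpaces.Torus.isConjSymm_mFourierCoeff hsi.1),
    ← mul_assoc, mul_comm lo, mul_assoc, Finset.mul_sum]
  refine mul_le_mul_of_nonneg_left (Finset.sum_le_sum fun k _ => ?_) (by positivity)
  exact lo_mul_le_re_inner_symbT h𝔸 (hs k)

/-- The truncated dissipation in coordinates: for a.e. `s`, every `N`,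
`‖∇P_N w(s)‖₂² = 4π² Σ_{|k|≤N} |k|² ‖ŵ(s)(k)‖²`. [cite: RobinsonRodrigoSadowski2016, §4.1 (Galerkin truncations)] -/
theorem ae_toReal_eGradNormSq_fourierTruncate_eq (h : IsWeakTensorPassiveVectorForcedOn A T 𝔸 b g F w₀ w) :
    ∀ᵐ s ∂(volume.restrict (Ioo 0 T)), ∀ N : ℕ,
      (FunctionSpaces.Torus.eGradNormSq (FunctionSpaces.Torus.fourierTruncate N (w s))).toReal =
        4 * Real.pi ^ 2 * ∑ k ∈ FunctionSpaces.Torus.freqBall N,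
          FunctionSpaces.Torus.freqNormSq k * ‖mFourierCoeff (FunctionSpaces.EuclideanSpace.complexify ∘ w s) k‖ ^ 2 := by
  filter_upwards [h.ae_integrable_slice] with s hsi
  intro N
  rw [FunctionSpaces.Torus.fourierTruncate_eq,
    FunctionSpaces.Torus.toReal_eGradNormSq_realTrigPoly FunctionSpaces.Torus.neg_mem_freqBall_of_mem
      (FunctionSpaces.Torus.isConjSymm_mFourierCoeff hsi.1)]

/-- Time-measurability of the truncated dissipation `s ↦ ‖∇P_N w(s)‖₂²` of a forced weak solution.
[cite: RobinsonRodrigoSadowski2016, §4.1 (Galerkin truncations)] -/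
theorem aemeasurable_eGradNormSq_fourierTruncate (h : IsWeakTensorPassiveVectorForcedOn A T 𝔸 b g F w₀ w) (N : ℕ) :
    AEMeasurable (fun s => FunctionSpaces.Torus.eGradNormSq (FunctionSpaces.Torus.fourierTruncate N (w s)))
      (volume.restrict (Ioo 0 T)) := by
  classical
  refine Torus.aemeasurable_eGradNormSq_of_coeff fun k => ?_
  have hc := Torus.aestronglyMeasurable_mFourierCoeff_complexify_slice h.aestronglyMeasurable_uncurry k
  by_cases hk : k ∈ FunctionSpaces.Torus.freqBall N
  · refine hc.congr ?_
    filter_upwards [h.ae_integrable_slice] with s hs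
    rw [FunctionSpaces.Torus.mFourierCoeff_fourierTruncate hs.1, if_pos hk]
  · refine (aestronglyMeasurable_const (b := (0 : EuclideanSpace ℂ d))).congr ?_
    filter_upwards [h.ae_integrable_slice] with s hs
    rw [FunctionSpaces.Torus.mFourierCoeff_fourierTruncate hs.1, if_neg hk]

/-- Time-measurability of the dissipation `s ↦ ‖∇w(s)‖₂²` (spectral) of a forced weak solution.
[cite: RobinsonRodrigoSadowski2016, §4.1 (Galerkin truncations)] -/
theorem aemeasurable_eGradNormSq (h : IsWeakTensorPassiveVectorForcedOn A T 𝔸 b g F w₀ w) :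
    AEMeasurable (fun s => FunctionSpaces.Torus.eGradNormSq (w s)) (volume.restrict (Ioo 0 T)) :=
  Torus.aemeasurable_eGradNormSq_of_coeff fun k =>
    Torus.aestronglyMeasurable_mFourierCoeff_complexify_slice h.aestronglyMeasurable_uncurry k

/-- The truncated dissipation is dominated by the dissipation: `‖∇P_N w(s)‖₂² ≤ ‖∇w(s)‖₂²` for a.e. `s`.
[cite: RobinsonRodrigoSadowski2016, §4.1 (Lemma 4.1)] -/
theorem ae_eGradNormSq_fourierTruncate_le (h : IsWeakTensorPassiveVectorForcedOn A T 𝔸 b g F w₀ w) (N : ℕ) :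
    ∀ᵐ s ∂(volume.restrict (Ioo 0 T)),
      FunctionSpaces.Torus.eGradNormSq (FunctionSpaces.Torus.fourierTruncate N (w s)) ≤
        FunctionSpaces.Torus.eGradNormSq (w s) := by
  filter_upwards [h.ae_integrable_slice] with s hs
  exact Torus.eGradNormSq_fourierTruncate_le hs.1 N

/-- The truncated dissipation is essentially bounded on `(0,T)` (bounded modes), hence integrable, for
every fixed `N`. [cite: RobinsonRodrigoSadowski2016, §4.1 (Galerkin truncations)] -/
theorem integrableOn_toReal_eGradNormSq_fourierTruncate (h : IsWeakTensorPassiveVectorForcedOn A T 𝔸 b g F w₀ w)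
    (N : ℕ) :
    IntegrableOn (fun s => (FunctionSpaces.Torus.eGradNormSq (FunctionSpaces.Torus.fourierTruncate N (w s))).toReal)
      (Ioo 0 T) := by
  -- a uniform bound on all the modes
  obtain ⟨C₁, hC₁⟩ := h.exists_eLpNorm_le
  have hXb : ∀ᵐ s ∂(volume.restrict (Ioo 0 T)), ∀ k,
      ‖mFourierCoeff (FunctionSpaces.EuclideanSpace.complexify ∘ w s) k‖ ≤ C₁ := by
    filter_upwards [hC₁, h.ae_memLp_two] with τ hτ hm
    intro k
    exact (norm_mFourierCoeff_complexify_le₈ (hm.integrable one_le_two) k).trans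
      (integral_norm_le_of_eLpNorm_two_le₈ hm hτ)
  refine IntegrableOn.of_bound measure_Ioo_lt_top (h.aemeasurable_eGradNormSq_fourierTruncate N).ennreal_toReal.aestronglyMeasurable
    (4 * Real.pi ^ 2 * ∑ k ∈ FunctionSpaces.Torus.freqBall (d := d) N, FunctionSpaces.Torus.freqNormSq k * (C₁ : ℝ) ^ 2) ?_
  filter_upwards [h.ae_toReal_eGradNormSq_fourierTruncate_eq, hXb] with s hs hb
  rw [hs N, Real.norm_eq_abs, abs_of_nonneg (mul_nonneg (by positivity)
    (Finset.sum_nonneg fun k _ => mul_nonneg (FunctionSpaces.Torus.freqNormSq_nonneg k) (sq_nonneg _)))]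
  refine mul_le_mul_of_nonneg_left (Finset.sum_le_sum fun k _ =>
    mul_le_mul_of_nonneg_left (pow_le_pow_left₀ (norm_nonneg _) (hb k) 2) (FunctionSpaces.Torus.freqNormSq_nonneg k))
    (by positivity)

/-- **The transport flux of the truncated identity, for `A = 0`, is a remainder** controlled by the
Parseval tail and the truncated dissipation: for a carrier bounded by `M` a.e., for a.e. `s ∈ (0,T)`,
`Flux_N(s) = ∫⟪w(s) − P_N w(s), (b(s)·∇)P_N w(s)⟫` and
`|Flux_N(s)| ≤ d M (∫‖w(s) − P_N w(s)‖²)^{1/2} (‖∇P_N w(s)‖₂²)^{1/2}`.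
[cite: RobinsonRodrigoSadowski2016, §4.2 (4.20)] -/
theorem ae_galerkinFlux_eq_remainder (h : IsWeakTensorPassiveVectorForcedOn 0 T 𝔸 b g F w₀ w) {M : ℝ} (hM : 0 ≤ M)
    (hbM : ∀ᵐ s ∂(volume.restrict (Ioo 0 T)), ∀ᵐ x ∂volume, ‖b s x‖ ≤ M) (N : ℕ) :
    ∀ᵐ s ∂(volume.restrict (Ioo 0 T)),
      ((∫ x, ⟪w s x, FunctionSpaces.Torus.convect (b s) (FunctionSpaces.Torus.fourierTruncate N (w s)) x⟫_ℝ) +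
          (0 : ℝ) * ∫ x, ⟪b s x, FunctionSpaces.Torus.convect (w s) (FunctionSpaces.Torus.fourierTruncate N (w s)) x⟫_ℝ =
        ∫ x, ⟪w s x - FunctionSpaces.Torus.fourierTruncate N (w s) x,
            FunctionSpaces.Torus.convect (b s) (FunctionSpaces.Torus.fourierTruncate N (w s)) x⟫_ℝ) ∧
      |∫ x, ⟪w s x - FunctionSpaces.Torus.fourierTruncate N (w s) x,
          FunctionSpaces.Torus.convect (b s) (FunctionSpaces.Torus.fourierTruncate N (w s)) x⟫_ℝ| ≤
        Fintype.card d * M * Real.sqrt (∫ x, ‖w s x - FunctionSpaces.Torus.fourierTruncate N (w s) x‖ ^ 2) *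
          Real.sqrt ((FunctionSpaces.Torus.eGradNormSq (FunctionSpaces.Torus.fourierTruncate N (w s))).toReal) := by
  filter_upwards [h.ae_integrable_slice, h.ae_memLp_two, h.ae_isWeaklyDivFree_carrier, h.ae_aestronglyMeasurable_slice, hbM]
    with s hs hs2 hbdiv hsm hbs
  have hbint : Integrable (b s) volume := Integrable.of_bound hsm.2.1 M hbs
  refine ⟨?_, ?_⟩
  · rw [zero_mul, add_zero, integral_inner_convect_fourierTruncate_eq_remainder hbint hbdiv hs.2.1 N]
  · have hv : MemLp (fun x => w s x - FunctionSpaces.Torus.fourierTruncate N (w s) x) 2 volume :=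
      hs2.sub (FunctionSpaces.Torus.memLp_fourierTruncate N _ 2)
    have hb := abs_integral_inner_convect_le_of_norm_le (u := b s) hv hM hbs
      (FunctionSpaces.Torus.isSmooth_fourierTruncate N (w s))
    rwa [gradNormSq_fourierTruncate] at hb

omit [Fintype d] [DecidableEq d] in
/-- Cauchy–Schwarz for pairings of `L²` fields: `|∫ ⟪a, z⟫| ≤ √(∫ ‖a‖²) · √(∫ ‖z‖²)`. [folklore] -/
private theorem abs_integral_inner_le_sqrt_mul_sqrt₈ {α : Type*} [MeasurableSpace α] {μ : Measure α}
    {E : Type*} [NormedAddCommGroup E] [InnerProductSpace ℝ E] {a z : α → E} (ha : MemLp a 2 μ) (hz : MemLp z 2 μ) :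
    |∫ x, ⟪a x, z x⟫_ℝ ∂μ| ≤ Real.sqrt (∫ x, ‖a x‖ ^ 2 ∂μ) * Real.sqrt (∫ x, ‖z x‖ ^ 2 ∂μ) := by
  have h1 : |∫ x, ⟪a x, z x⟫_ℝ ∂μ| ≤ ∫ x, ‖a x‖ * ‖z x‖ ∂μ := by
    rw [← Real.norm_eq_abs]
    refine (norm_integral_le_integral_norm _).trans (integral_mono_of_nonneg
      (ae_of_all _ fun x => norm_nonneg _) (ha.norm.integrable_mul hz.norm)
      (ae_of_all _ fun x => norm_inner_le_norm _ _))
  have h2 := integral_mul_le_Lp_mul_Lq_of_nonneg Real.HolderConjugate.two_two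
    (ae_of_all _ fun x => norm_nonneg (a x)) (ae_of_all _ fun x => norm_nonneg (z x))
    (by simpa using ha.norm) (by simpa using hz.norm)
  refine h1.trans (h2.trans_eq ?_)
  simp only [Real.rpow_two, Real.sqrt_eq_rpow]

omit [Fintype d] [DecidableEq d] in
/-- `∫ ‖v‖² = (∫⁻ ‖v‖ₑ²).toReal` for `v ∈ L²`; in particular an `ℝ≥0∞` bound `∫⁻‖v‖ₑ² ≤ C` gives
`∫‖v‖² ≤ C`. [folklore] -/
private theorem integral_norm_sq_le_of_lintegral_le₈ {α : Type*} [MeasurableSpace α] {μ : Measure α}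
    {E : Type*} [NormedAddCommGroup E] {v : α → E} (hv : MemLp v 2 μ) {C : ℝ≥0}
    (h : ∫⁻ x, ‖v x‖ₑ ^ 2 ∂μ ≤ C) : ∫ x, ‖v x‖ ^ 2 ∂μ ≤ C := by
  have e : ∫⁻ x, ‖v x‖ₑ ^ 2 ∂μ = ENNReal.ofReal (∫ x, ‖v x‖ ^ 2 ∂μ) := by
    rw [ofReal_integral_eq_lintegral_ofReal (hv.integrable_norm_pow two_ne_zero) (ae_of_all _ fun x => by positivity)]
    refine lintegral_congr_ae (ae_of_all _ fun x => ?_)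
    dsimp only
    rw [ENNReal.ofReal_pow (norm_nonneg _), ofReal_norm]
  rw [e] at h
  exact (ENNReal.ofReal_le_iff_le_toReal ENNReal.coe_ne_top).1 h |>.trans_eq (ENNReal.coe_toReal C)

/-- For a smooth field, `Σⱼ ∫ ‖∂ⱼΨ‖² = ‖∇Ψ‖₂²` (`gradNormSq`, Fubini for a finite sum). [folklore] -/
private theorem sum_integral_norm_sq_partialDeriv_eq₈ {Ψ : UnitAddTorus d → EuclideanSpace ℝ d}
    (hΨ : FunctionSpaces.Torus.IsSmooth Ψ) :
    ∑ j, ∫ x, ‖FunctionSpaces.Torus.partialDeriv j Ψ x‖ ^ 2 = FunctionSpaces.Torus.gradNormSq Ψ := by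
  unfold FunctionSpaces.Torus.gradNormSq
  rw [integral_finsetSum _ fun j _ => ?_]
  exact ((hΨ.partialDeriv j).continuous.norm.pow 2).integrable_of_hasCompactSupport
    (HasCompactSupport.of_compactSpace _)

/-- **The work of the flux on the truncation is controlled by the truncated dissipation**: for a.e. `s`
and every `N`, `|Σⱼ ∫⟪F j(s), ∂ⱼ P_N w(s)⟫| ≤ (Σⱼ ∫‖F j(s)‖²)^{1/2} (‖∇P_N w(s)‖₂²)^{1/2}` (Cauchy–Schwarz in
`L²` and in `j`). [cite: Temam1997, Ch. II §3.1–3.2, (3.2)–(3.5), Thm. 3.1] -/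
theorem ae_abs_fluxWork_le (h : IsWeakTensorPassiveVectorForcedOn A T 𝔸 b g F w₀ w) :
    ∀ᵐ s ∂(volume.restrict (Ioo 0 T)), ∀ N : ℕ,
      |∑ j, ∫ x, ⟪F j s x, FunctionSpaces.Torus.partialDeriv j (FunctionSpaces.Torus.fourierTruncate N (w s)) x⟫_ℝ| ≤
        Real.sqrt (∑ j, ∫ x, ‖F j s x‖ ^ 2) *
          Real.sqrt ((FunctionSpaces.Torus.eGradNormSq (FunctionSpaces.Torus.fourierTruncate N (w s))).toReal) := by
  filter_upwards [h.ae_memLp_two_force_flux] with s hs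
  intro N
  set Ψ := FunctionSpaces.Torus.fourierTruncate N (w s) with hΨdef
  have hΨ : FunctionSpaces.Torus.IsSmooth Ψ := FunctionSpaces.Torus.isSmooth_fourierTruncate N (w s)
  have hd : ∀ j, MemLp (FunctionSpaces.Torus.partialDeriv j Ψ) 2 volume := fun j =>
    (hΨ.partialDeriv j).continuous.memLp_of_hasCompactSupport (HasCompactSupport.of_compactSpace _)
  have h1 : |∑ j, ∫ x, ⟪F j s x, FunctionSpaces.Torus.partialDeriv j Ψ x⟫_ℝ| ≤
      ∑ j, Real.sqrt (∫ x, ‖F j s x‖ ^ 2) * Real.sqrt (∫ x, ‖FunctionSpaces.Torus.partialDeriv j Ψ x‖ ^ 2) :=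
    (Finset.abs_sum_le_sum_abs _ _).trans (Finset.sum_le_sum fun j _ =>
      abs_integral_inner_le_sqrt_mul_sqrt₈ (hs.2 j) (hd j))
  refine h1.trans ?_
  have h2 := Real.sum_sqrt_mul_sqrt_le Finset.univ (f := fun j => ∫ x, ‖F j s x‖ ^ 2)
    (g := fun j => ∫ x, ‖FunctionSpaces.Torus.partialDeriv j Ψ x‖ ^ 2)
    (fun j => integral_nonneg fun x => sq_nonneg _) (fun j => integral_nonneg fun x => sq_nonneg _)
  refine h2.trans_eq ?_
  rw [sum_integral_norm_sq_partialDeriv_eq₈ hΨ, gradNormSq_fourierTruncate]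

/-- **The work of the force on the truncation is controlled by the energies**: for a.e. `s` and every
`N`, `|∫⟪g(s), P_N w(s)⟫| ≤ (∫‖g(s)‖²)^{1/2} (∫‖w(s)‖²)^{1/2}`. [cite: Temam1997, Ch. II §3.1–3.2, (3.2)–(3.5), Thm. 3.1] -/
theorem ae_abs_forceWork_le (h : IsWeakTensorPassiveVectorForcedOn A T 𝔸 b g F w₀ w) :
    ∀ᵐ s ∂(volume.restrict (Ioo 0 T)), ∀ N : ℕ,
      |∫ x, ⟪g s x, FunctionSpaces.Torus.fourierTruncate N (w s) x⟫_ℝ| ≤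
        Real.sqrt (∫ x, ‖g s x‖ ^ 2) * Real.sqrt (∫ x, ‖w s x‖ ^ 2) := by
  filter_upwards [h.ae_memLp_two_force_flux, h.ae_memLp_two] with s hs hw
  intro N
  refine (abs_integral_inner_le_sqrt_mul_sqrt₈ hs.1 (FunctionSpaces.Torus.memLp_fourierTruncate N _ 2)).trans ?_
  exact mul_le_mul_of_nonneg_left (Real.sqrt_le_sqrt (FunctionSpaces.Torus.integral_norm_sq_fourierTruncate_le hw N))
    (Real.sqrt_nonneg _)

/-- **The work of the force on the truncation converges to the work on the solution**: for a.e. `s`,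
`∫⟪g(s), P_N w(s)⟫ → ∫⟪g(s), w(s)⟫` (Parseval tail). [cite: RobinsonRodrigoSadowski2016, §4.1 (Lemma 4.1)] -/
theorem ae_tendsto_forceWork (h : IsWeakTensorPassiveVectorForcedOn A T 𝔸 b g F w₀ w) :
    ∀ᵐ s ∂(volume.restrict (Ioo 0 T)),
      Tendsto (fun N => ∫ x, ⟪g s x, FunctionSpaces.Torus.fourierTruncate N (w s) x⟫_ℝ) atTop
        (𝓝 (∫ x, ⟪g s x, w s x⟫_ℝ)) := by
  filter_upwards [h.ae_memLp_two_force_flux, h.ae_memLp_two] with s hs hw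
  -- the Parseval tail in real form
  have ht := FunctionSpaces.Torus.tendsto_lintegral_enorm_sq_fourierTruncate_sub hw
  have hfinN : ∀ N, ∫⁻ x, ‖FunctionSpaces.Torus.fourierTruncate N (w s) x - w s x‖ₑ ^ 2 ≠ ⊤ := by
    intro N
    have hsub : MemLp (fun x => FunctionSpaces.Torus.fourierTruncate N (w s) x - w s x) 2 volume :=
      (FunctionSpaces.Torus.memLp_fourierTruncate N _ 2).sub hw
    have h2 := lintegral_rpow_enorm_lt_top_of_eLpNorm_lt_top two_ne_zero ENNReal.ofNat_ne_top hsub.eLpNorm_lt_top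
    simp only [ENNReal.toReal_ofNat, ENNReal.rpow_two] at h2
    exact h2.ne
  have hreal := (ENNReal.tendsto_toReal ENNReal.zero_ne_top).comp ht
  rw [ENNReal.toReal_zero] at hreal
  have htail : Tendsto (fun N => ∫ x, ‖FunctionSpaces.Torus.fourierTruncate N (w s) x - w s x‖ ^ 2) atTop (𝓝 0) := by
    refine hreal.congr fun N => ?_
    rw [Function.comp_apply, ← integral_toReal]
    · refine integral_congr_ae (ae_of_all _ fun x => ?_)
      dsimp only
      rw [ENNReal.toReal_pow, toReal_enorm]
    · exact (((FunctionSpaces.Torus.continuous_fourierTruncate N (w s)).aestronglyMeasurable.sub hw.1).enorm.pow_const 2)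
    · exact ae_of_all _ fun x => ENNReal.pow_lt_top enorm_lt_top
  have hsq : Tendsto (fun N => Real.sqrt (∫ x, ‖g s x‖ ^ 2) *
      Real.sqrt (∫ x, ‖FunctionSpaces.Torus.fourierTruncate N (w s) x - w s x‖ ^ 2)) atTop (𝓝 0) := by
    have := ((Real.continuous_sqrt.tendsto 0).comp htail).const_mul (Real.sqrt (∫ x, ‖g s x‖ ^ 2))
    rwa [Real.sqrt_zero, mul_zero] at this
  rw [tendsto_iff_norm_sub_tendsto_zero]
  refine squeeze_zero (fun N => norm_nonneg _) (fun N => ?_) hsq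
  have hP : MemLp (FunctionSpaces.Torus.fourierTruncate N (w s)) 2 volume := FunctionSpaces.Torus.memLp_fourierTruncate N _ 2
  have hsub : MemLp (fun x => FunctionSpaces.Torus.fourierTruncate N (w s) x - w s x) 2 volume := hP.sub hw
  have i1 : Integrable (fun x => ⟪g s x, FunctionSpaces.Torus.fourierTruncate N (w s) x⟫_ℝ) volume :=
    Integrable.mono' (hs.1.norm.integrable_mul hP.norm) (hs.1.1.inner hP.1) (ae_of_all _ fun _ => norm_inner_le_norm _ _)
  have i2 : Integrable (fun x => ⟪g s x, w s x⟫_ℝ) volume :=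
    Integrable.mono' (hs.1.norm.integrable_mul hw.norm) (hs.1.1.inner hw.1) (ae_of_all _ fun _ => norm_inner_le_norm _ _)
  rw [Real.norm_eq_abs, ← integral_sub i1 i2]
  simp_rw [← inner_sub_right]
  exact abs_integral_inner_le_sqrt_mul_sqrt₈ hs.1 hsub

/-- **The Parseval tails** `s ↦ ∫ ‖w(s) − P_N w(s)‖²` are bounded by `4∫‖w(s)‖²` and tend to `0` for a.e.
`s` as `N → ∞`. [cite: RobinsonRodrigoSadowski2016, §4.1 (Lemma 4.1)] -/
theorem ae_galerkin_tail (h : IsWeakTensorPassiveVectorForcedOn A T 𝔸 b g F w₀ w) :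
    (∀ N, ∀ᵐ s ∂(volume.restrict (Ioo 0 T)),
      ∫ x, ‖w s x - FunctionSpaces.Torus.fourierTruncate N (w s) x‖ ^ 2 ≤ 4 * ∫ x, ‖w s x‖ ^ 2) ∧
    ∀ᵐ s ∂(volume.restrict (Ioo 0 T)),
      Tendsto (fun N => ∫ x, ‖w s x - FunctionSpaces.Torus.fourierTruncate N (w s) x‖ ^ 2) atTop (𝓝 0) := by
  have hgood : ∀ᵐ s ∂(volume.restrict (Ioo 0 T)), MemLp (w s) 2 volume := h.ae_memLp_two
  refine ⟨fun N => ?_, ?_⟩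
  · filter_upwards [hgood] with s hs
    have hP : MemLp (FunctionSpaces.Torus.fourierTruncate N (w s)) 2 volume := FunctionSpaces.Torus.memLp_fourierTruncate N _ 2
    have hpt : ∀ x, ‖w s x - FunctionSpaces.Torus.fourierTruncate N (w s) x‖ ^ 2 ≤
        2 * ‖w s x‖ ^ 2 + 2 * ‖FunctionSpaces.Torus.fourierTruncate N (w s) x‖ ^ 2 := fun x => by
      have h1 : ‖w s x - FunctionSpaces.Torus.fourierTruncate N (w s) x‖ ^ 2 ≤
          (‖w s x‖ + ‖FunctionSpaces.Torus.fourierTruncate N (w s) x‖) ^ 2 :=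
        pow_le_pow_left₀ (norm_nonneg _) (norm_sub_le _ _) 2
      nlinarith [h1, sq_nonneg (‖w s x‖ - ‖FunctionSpaces.Torus.fourierTruncate N (w s) x‖)]
    have i1 := hs.integrable_norm_pow two_ne_zero
    have i2 := hP.integrable_norm_pow two_ne_zero
    calc ∫ x, ‖w s x - FunctionSpaces.Torus.fourierTruncate N (w s) x‖ ^ 2
        ≤ ∫ x, (2 * ‖w s x‖ ^ 2 + 2 * ‖FunctionSpaces.Torus.fourierTruncate N (w s) x‖ ^ 2) :=
          integral_mono_of_nonneg (ae_of_all _ fun x => sq_nonneg _) ((i1.const_mul 2).add (i2.const_mul 2))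
            (ae_of_all _ hpt)
      _ = 2 * (∫ x, ‖w s x‖ ^ 2) + 2 * (∫ x, ‖FunctionSpaces.Torus.fourierTruncate N (w s) x‖ ^ 2) := by
          rw [integral_add (i1.const_mul 2) (i2.const_mul 2), integral_const_mul, integral_const_mul]
      _ ≤ 2 * (∫ x, ‖w s x‖ ^ 2) + 2 * (∫ x, ‖w s x‖ ^ 2) :=
          add_le_add le_rfl (mul_le_mul_of_nonneg_left
            (FunctionSpaces.Torus.integral_norm_sq_fourierTruncate_le hs N) (by norm_num))
      _ = 4 * ∫ x, ‖w s x‖ ^ 2 := by ring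
  · filter_upwards [hgood] with s hs
    have ht := FunctionSpaces.Torus.tendsto_lintegral_enorm_sq_fourierTruncate_sub hs
    have hfinN : ∀ N, ∫⁻ x, ‖FunctionSpaces.Torus.fourierTruncate N (w s) x - w s x‖ₑ ^ 2 ≠ ⊤ := by
      intro N
      have hsub : MemLp (fun x => FunctionSpaces.Torus.fourierTruncate N (w s) x - w s x) 2 volume :=
        (FunctionSpaces.Torus.memLp_fourierTruncate N _ 2).sub hs
      have h2 := lintegral_rpow_enorm_lt_top_of_eLpNorm_lt_top two_ne_zero ENNReal.ofNat_ne_top hsub.eLpNorm_lt_top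
      simp only [ENNReal.toReal_ofNat, ENNReal.rpow_two] at h2
      exact h2.ne
    have hreal := (ENNReal.tendsto_toReal ENNReal.zero_ne_top).comp ht
    rw [ENNReal.toReal_zero] at hreal
    refine hreal.congr fun N => ?_
    rw [Function.comp_apply, ← integral_toReal]
    · refine integral_congr_ae (ae_of_all _ fun x => ?_)
      dsimp only
      rw [ENNReal.toReal_pow, toReal_enorm, norm_sub_rev]
    · exact (((FunctionSpaces.Torus.continuous_fourierTruncate N (w s)).aestronglyMeasurable.sub hs.1).enorm.pow_const 2)
    · exact ae_of_all _ fun x => ENNReal.pow_lt_top enorm_lt_top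

/-- The slice energy `s ↦ ∫ ‖w(s)‖²` is integrable on `(0,T)` and bounded a.e. by the `L^∞_t L²_x`
constant. [cite: RobinsonRodrigoSadowski2016, §4.2 (Galerkin energy estimate)] -/
theorem integrableOn_integral_norm_sq (h : IsWeakTensorPassiveVectorForcedOn A T 𝔸 b g F w₀ w) :
    ∃ C : ℝ, 0 ≤ C ∧ (∀ᵐ s ∂(volume.restrict (Ioo 0 T)), ∫ x, ‖w s x‖ ^ 2 ≤ C) ∧
      IntegrableOn (fun s => ∫ x, ‖w s x‖ ^ 2) (Ioo 0 T) := by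
  obtain ⟨C, hC⟩ := h.ae_lintegral_sq_le
  have hm : AEStronglyMeasurable (fun s => ∫ x, ‖w s x‖ ^ 2) (volume.restrict (Ioo 0 T)) :=
    (h.aestronglyMeasurable_uncurry.norm.pow 2).integral_prod_right'
  have hb : ∀ᵐ s ∂(volume.restrict (Ioo 0 T)), ∫ x, ‖w s x‖ ^ 2 ≤ C := by
    filter_upwards [hC, h.ae_memLp_two] with s hs hm2
    exact integral_norm_sq_le_of_lintegral_le₈ hm2 hs
  refine ⟨C, C.2, hb, IntegrableOn.of_bound measure_Ioo_lt_top hm (C : ℝ) ?_⟩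
  filter_upwards [hb] with s hs
  rw [Real.norm_eq_abs, abs_of_nonneg (integral_nonneg fun x => sq_nonneg _)]
  exact hs

/-- The slice energies of the forcing, `s ↦ ∫‖g(s)‖²` and `s ↦ Σⱼ ∫‖F j(s)‖²`, are integrable on
`(0,T)`. [cite: Temam1997, Ch. II §3.1–3.2, (3.2)–(3.5), Thm. 3.1] -/
theorem integrableOn_integral_norm_sq_force_flux (h : IsWeakTensorPassiveVectorForcedOn A T 𝔸 b g F w₀ w) :
    IntegrableOn (fun s => ∫ x, ‖g s x‖ ^ 2) (Ioo 0 T) ∧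
      IntegrableOn (fun s => ∑ j, ∫ x, ‖F j s x‖ ^ 2) (Ioo 0 T) := by
  refine ⟨?_, ?_⟩
  · exact (h.memLp_two_uncurry_force.integrable_norm_pow two_ne_zero).integral_prod_left
  · refine integrable_finsetSum _ fun j _ => ?_
    exact ((h.memLp_two_uncurry_flux j).integrable_norm_pow two_ne_zero).integral_prod_left

/-- The work of the force on the solution, `s ↦ ∫⟪g(s), w(s)⟫`, is integrable on `(0,T)`, and so is the
product of the slice norms `s ↦ ‖g(s)‖₂ ‖w(s)‖₂`. [cite: Temam1997, Ch. II §3.1–3.2, (3.2)–(3.5), Thm. 3.1] -/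
theorem integrableOn_forceWork (h : IsWeakTensorPassiveVectorForcedOn A T 𝔸 b g F w₀ w) :
    IntegrableOn (fun s => ∫ x, ⟪g s x, w s x⟫_ℝ) (Ioo 0 T) ∧
      IntegrableOn (fun s => Real.sqrt (∫ x, ‖g s x‖ ^ 2) * Real.sqrt (∫ x, ‖w s x‖ ^ 2)) (Ioo 0 T) := by
  obtain ⟨C, hC0, hCb, hEi⟩ := h.integrableOn_integral_norm_sq
  obtain ⟨hgi, -⟩ := h.integrableOn_integral_norm_sq_force_flux
  -- the product of the slice norms: `√a √b ≤ (a + b)/2`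
  have hm1 : AEStronglyMeasurable (fun s => Real.sqrt (∫ x, ‖g s x‖ ^ 2) * Real.sqrt (∫ x, ‖w s x‖ ^ 2))
      (volume.restrict (Ioo 0 T)) :=
    (Real.continuous_sqrt.comp_aestronglyMeasurable hgi.aestronglyMeasurable).mul
      (Real.continuous_sqrt.comp_aestronglyMeasurable hEi.aestronglyMeasurable)
  have hprod : IntegrableOn (fun s => Real.sqrt (∫ x, ‖g s x‖ ^ 2) * Real.sqrt (∫ x, ‖w s x‖ ^ 2)) (Ioo 0 T) := by
    have hdom : IntegrableOn (fun s => ((∫ x, ‖g s x‖ ^ 2) + ∫ x, ‖w s x‖ ^ 2) / 2) (Ioo 0 T) :=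
      (hgi.add hEi).div_const 2
    refine Integrable.mono' hdom hm1 (ae_of_all _ fun s => ?_)
    rw [Real.norm_eq_abs, abs_of_nonneg (mul_nonneg (Real.sqrt_nonneg _) (Real.sqrt_nonneg _))]
    have ha : Real.sqrt (∫ x, ‖g s x‖ ^ 2) ^ 2 = ∫ x, ‖g s x‖ ^ 2 :=
      Real.sq_sqrt (integral_nonneg fun x => sq_nonneg _)
    have hb : Real.sqrt (∫ x, ‖w s x‖ ^ 2) ^ 2 = ∫ x, ‖w s x‖ ^ 2 :=
      Real.sq_sqrt (integral_nonneg fun x => sq_nonneg _)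
    nlinarith [sq_nonneg (Real.sqrt (∫ x, ‖g s x‖ ^ 2) - Real.sqrt (∫ x, ‖w s x‖ ^ 2)), ha, hb]
  refine ⟨?_, hprod⟩
  have hm2 : AEStronglyMeasurable (fun s => ∫ x, ⟪g s x, w s x⟫_ℝ) (volume.restrict (Ioo 0 T)) := by
    have h' := (h.aestronglyMeasurable_uncurry_force.inner (𝕜 := ℝ) h.aestronglyMeasurable_uncurry).integral_prod_right'
    exact h'
  refine Integrable.mono' hprod hm2 ?_
  filter_upwards [h.ae_memLp_two_force_flux, h.ae_memLp_two] with s hs hw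
  rw [Real.norm_eq_abs]
  exact abs_integral_inner_le_sqrt_mul_sqrt₈ hs.1 hw

/-! ## §7 `A = 0`, coercive tensor, bounded carrier: finiteness of the dissipation -/

/-- The truncated energy at the datum is at most the datum's energy (Bessel). [folklore] -/
private theorem sum_sq_norm_mFourierCoeff_le₈ {v : UnitAddTorus d → EuclideanSpace ℝ d} (hv : MemLp v 2 volume) (N : ℕ) :
    ∑ k ∈ FunctionSpaces.Torus.freqBall (d := d) N, ‖mFourierCoeff (FunctionSpaces.EuclideanSpace.complexify ∘ v) k‖ ^ 2 ≤
      ∫ x, ‖v x‖ ^ 2 :=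
  sum_le_hasSum _ (fun _ _ => sq_nonneg _) (FunctionSpaces.Torus.hasSum_sq_norm_mFourierCoeff_complexify hv)

omit [Fintype d] [DecidableEq d] in
/-- The absorption arithmetic of the energy estimate (Young's inequality three times): with
`x = √D`, the transport flux `≤ K √tail x`, `tail ≤ 4 En`, the work `≤ √ng √En + √nF x` and the
coercivity `lo D ≤ Q` give `2(Fl + Wk) − 2Q ≤ −lo D + (8K²/lo + 1) En + ng + (2/lo) nF`. [folklore] -/
private theorem absorb₈ {lo K D En ng nF Fl Wk Q tail : ℝ} (hlo : 0 < lo) (hK : 0 ≤ K) (hD : 0 ≤ D)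
    (hEn : 0 ≤ En) (hng : 0 ≤ ng) (hnF : 0 ≤ nF) (htail : tail ≤ 4 * En)
    (h1 : Fl ≤ K * Real.sqrt tail * Real.sqrt D)
    (h2 : Wk ≤ Real.sqrt ng * Real.sqrt En + Real.sqrt nF * Real.sqrt D) (h4 : lo * D ≤ Q) :
    2 * (Fl + Wk) - 2 * Q ≤ -(lo * D) + ((8 * K ^ 2 / lo + 1) * En + ng + (2 / lo) * nF) := by
  have hx2 : Real.sqrt D ^ 2 = D := Real.sq_sqrt hD
  have hy2 : Real.sqrt En ^ 2 = En := Real.sq_sqrt hEn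
  have hz2 : Real.sqrt nF ^ 2 = nF := Real.sq_sqrt hnF
  have hu2 : Real.sqrt ng ^ 2 = ng := Real.sq_sqrt hng
  have hx0 : 0 ≤ Real.sqrt D := Real.sqrt_nonneg _
  have hy0 : 0 ≤ Real.sqrt En := Real.sqrt_nonneg _
  -- the tail is at most `2 √En`
  have htl2 : Real.sqrt tail ≤ 2 * Real.sqrt En := by
    rw [show (2 : ℝ) * Real.sqrt En = Real.sqrt (4 * En) by
      rw [Real.sqrt_mul (by norm_num : (0:ℝ) ≤ 4), show Real.sqrt (4 : ℝ) = 2 by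
        rw [show (4 : ℝ) = 2 ^ 2 by norm_num, Real.sqrt_sq (by norm_num)]]]
    exact Real.sqrt_le_sqrt htail
  have h1' : Fl ≤ 2 * K * Real.sqrt En * Real.sqrt D :=
    h1.trans (by nlinarith [mul_le_mul_of_nonneg_left htl2 hK, hx0])
  -- Young
  have y1 : 4 * K * Real.sqrt En * Real.sqrt D ≤ (lo / 2) * D + (8 * K ^ 2 / lo) * En := by
    have e : (lo / 2) * Real.sqrt D ^ 2 + (8 * K ^ 2 / lo) * Real.sqrt En ^ 2 - 4 * K * Real.sqrt En * Real.sqrt D =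
        (lo * Real.sqrt D - 4 * K * Real.sqrt En) ^ 2 / (2 * lo) := by
      field_simp
      ring
    have hnn := div_nonneg (sq_nonneg (lo * Real.sqrt D - 4 * K * Real.sqrt En)) (by positivity : (0:ℝ) ≤ 2 * lo)
    rw [← e, hx2, hy2] at hnn
    linarith
  have y2 : 2 * Real.sqrt nF * Real.sqrt D ≤ (lo / 2) * D + (2 / lo) * nF := by
    have e : (lo / 2) * Real.sqrt D ^ 2 + (2 / lo) * Real.sqrt nF ^ 2 - 2 * Real.sqrt nF * Real.sqrt D =
        (lo * Real.sqrt D - 2 * Real.sqrt nF) ^ 2 / (2 * lo) := by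
      field_simp
      ring
    have hnn := div_nonneg (sq_nonneg (lo * Real.sqrt D - 2 * Real.sqrt nF)) (by positivity : (0:ℝ) ≤ 2 * lo)
    rw [← e, hx2, hz2] at hnn
    linarith
  have y3 : 2 * Real.sqrt ng * Real.sqrt En ≤ ng + En := by
    nlinarith [sq_nonneg (Real.sqrt ng - Real.sqrt En), hu2, hy2]
  nlinarith [h1', h2, h4, y1, y2, y3]

/-- **EVERY forced weak solution with a coercive tensor and a bounded carrier has finite dissipation.**
For `A = 0`, `NearIso 𝔸 lo hi` with `0 < lo`, `stLift b ∈ L^∞((0,T) × T^d)` and a datum `w₀ ∈ L²` weakly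
divergence free: `∫₀ᵀ ‖∇w(s)‖₂² ds < ∞` (spectral `Torus.eGradNormSq`). Proof: in the truncated energy
identity the transport flux, the force work and the flux work are absorbed by Young's inequality into half
the truncated dissipation plus `N`-independent integrable terms (`‖w‖²_{L²}`, `‖g‖²_{L²}`, `Σⱼ‖F j‖²_{L²}`),
so `∫₀ᵗ ‖∇P_N w‖² ≤ B/lo` for a.e. `t`, hence for `t = T` by continuity, and monotone convergence in `N`
concludes (Robinson–Rodrigo–Sadowski 2016, (4.20); Temam 1997, Ch. II §3 Thm. 3.1: `u ∈ L²(0,T; V)`).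
[cite: RobinsonRodrigoSadowski2016, §4.2 (4.20)] [cite: Temam1997, Ch. II §3.1–3.2, (3.2)–(3.5), Thm. 3.1] -/
theorem lintegral_eGradNormSq_lt_top (h : IsWeakTensorPassiveVectorForcedOn 0 T 𝔸 b g F w₀ w)
    {lo hi : ℝ} (h𝔸 : NearIso 𝔸 lo hi) (hlo : 0 < lo)
    (hw₀ : MemLp w₀ 2 volume) (hdiv₀ : FunctionSpaces.Torus.IsWeaklyDivFree w₀)
    (hb : MemLp (FunctionSpaces.Torus.stLift b) ⊤ (volume.restrict (Ioo 0 T ×ˢ univ))) :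
    ∫⁻ s in Ioo 0 T, FunctionSpaces.Torus.eGradNormSq (w s) < ⊤ := by
  classical
  rcases le_or_gt T 0 with hT | hT
  · rw [Ioo_eq_empty_of_le hT, Measure.restrict_empty, lintegral_zero_measure]
    exact ENNReal.zero_lt_top
  obtain ⟨M, hM, hbM⟩ := ae_ae_norm_le_of_memLp_top_stLift hb
  obtain ⟨C, hC0, hCb, hEi⟩ := h.integrableOn_integral_norm_sq
  obtain ⟨hgi, hFi⟩ := h.integrableOn_integral_norm_sq_force_flux
  -- notation
  set P : ℕ → (UnitAddTorus d → EuclideanSpace ℝ d) → UnitAddTorus d → EuclideanSpace ℝ d :=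
    fun N v => FunctionSpaces.Torus.fourierTruncate N v with hP
  set D : ℕ → ℝ → ℝ := fun N s => (FunctionSpaces.Torus.eGradNormSq (P N (w s))).toReal with hD
  set Q : ℕ → ℝ → ℝ := fun N s => 4 * Real.pi ^ 2 * ∑ k ∈ FunctionSpaces.Torus.freqBall N,
    (⟪mFourierCoeff (FunctionSpaces.EuclideanSpace.complexify ∘ w s) k,
      symbT 𝔸 k (mFourierCoeff (FunctionSpaces.EuclideanSpace.complexify ∘ w s) k)⟫_ℂ).re with hQ
  set Fl : ℕ → ℝ → ℝ := fun N s =>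
    (∫ x, ⟪w s x, FunctionSpaces.Torus.convect (b s) (P N (w s)) x⟫_ℝ) +
      (0 : ℝ) * ∫ x, ⟪b s x, FunctionSpaces.Torus.convect (w s) (P N (w s)) x⟫_ℝ with hFl
  set Wk : ℕ → ℝ → ℝ := fun N s =>
    (∫ x, ⟪g s x, P N (w s) x⟫_ℝ) -
      ∑ j, ∫ x, ⟪F j s x, FunctionSpaces.Torus.partialDeriv j (P N (w s)) x⟫_ℝ with hWk
  set En : ℝ → ℝ := fun s => ∫ x, ‖w s x‖ ^ 2 with hEn
  set ng : ℝ → ℝ := fun s => ∫ x, ‖g s x‖ ^ 2 with hng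
  set nF : ℝ → ℝ := fun s => ∑ j, ∫ x, ‖F j s x‖ ^ 2 with hnF
  set K : ℝ := Fintype.card d * M with hK
  have hK0 : 0 ≤ K := mul_nonneg (Nat.cast_nonneg _) hM
  have hRi : IntegrableOn (fun s => (8 * K ^ 2 / lo + 1) * En s + ng s + (2 / lo) * nF s) (Ioo 0 T) :=
    ((hEi.const_mul (8 * K ^ 2 / lo + 1)).add hgi).add (hFi.const_mul (2 / lo))
  set R : ℝ → ℝ := fun s => (8 * K ^ 2 / lo + 1) * En s + ng s + (2 / lo) * nF s with hR
  have hR0 : ∀ s, 0 ≤ R s := fun s => by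
    have h1 : 0 ≤ En s := integral_nonneg fun x => sq_nonneg _
    have h2 : 0 ≤ ng s := integral_nonneg fun x => sq_nonneg _
    have h3 : 0 ≤ nF s := Finset.sum_nonneg fun j _ => integral_nonneg fun x => sq_nonneg _
    have h4 : 0 ≤ 8 * K ^ 2 / lo + 1 := by positivity
    have h5 : 0 ≤ 2 / lo := by positivity
    show 0 ≤ (8 * K ^ 2 / lo + 1) * En s + ng s + (2 / lo) * nF s
    exact add_nonneg (add_nonneg (mul_nonneg h4 h1) h2) (mul_nonneg h5 h3)
  set B : ℝ := (∫ x, ‖w₀ x‖ ^ 2) + ∫ s in Ioo 0 T, R s with hB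
  -- ### the pointwise (in `s`) absorption inequality, for every `N`
  have hpt : ∀ᵐ s ∂(volume.restrict (Ioo 0 T)), ∀ N : ℕ,
      2 * (Fl N s + Wk N s) - 2 * Q N s ≤ -(lo * D N s) + R s := by
    have hflux' := ae_all_iff.2 fun N => h.ae_galerkinFlux_eq_remainder hM hbM N
    have htail' := ae_all_iff.2 h.ae_galerkin_tail.1
    filter_upwards [hflux', htail', h.ae_lo_mul_le_symbForm h𝔸, h.ae_abs_fluxWork_le, h.ae_abs_forceWork_le]
      with s hfl htl hco hΦ hG
    intro N
    obtain ⟨hfl_eq, hfl_le⟩ := hfl N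
    have hD0 : 0 ≤ D N s := ENNReal.toReal_nonneg
    have hEn0 : 0 ≤ En s := integral_nonneg fun x => sq_nonneg _
    have hng0 : 0 ≤ ng s := integral_nonneg fun x => sq_nonneg _
    have hnF0 : 0 ≤ nF s := Finset.sum_nonneg fun j _ => integral_nonneg fun x => sq_nonneg _
    -- the three bounds
    have h1 : Fl N s ≤ K * Real.sqrt (∫ x, ‖w s x - P N (w s) x‖ ^ 2) * Real.sqrt (D N s) := by
      have e : Fl N s = ∫ x, ⟪w s x - P N (w s) x, FunctionSpaces.Torus.convect (b s) (P N (w s)) x⟫_ℝ := hfl_eq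
      rw [e, hK]
      exact (le_abs_self _).trans hfl_le
    have h2 : Wk N s ≤ Real.sqrt (ng s) * Real.sqrt (En s) + Real.sqrt (nF s) * Real.sqrt (D N s) := by
      have e : Wk N s = (∫ x, ⟪g s x, P N (w s) x⟫_ℝ) -
          ∑ j, ∫ x, ⟪F j s x, FunctionSpaces.Torus.partialDeriv j (P N (w s)) x⟫_ℝ := rfl
      rw [e]
      have h2a := (le_abs_self (∫ x, ⟪g s x, P N (w s) x⟫_ℝ)).trans (hG N)
      have h2b := (neg_abs_le (∑ j, ∫ x, ⟪F j s x, FunctionSpaces.Torus.partialDeriv j (P N (w s)) x⟫_ℝ))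
      have h2c := hΦ N
      linarith
    have eR : R s = (8 * K ^ 2 / lo + 1) * En s + ng s + (2 / lo) * nF s := rfl
    rw [eR]
    exact absorb₈ hlo hK0 hD0 hEn0 hng0 hnF0 (htl N) h1 h2 (hco N)
  -- ### integrate: `∫_{(0,t]} D_N ≤ B / lo` for a.e. `t`, every `N`
  have hE := h.ae_sum_sq_norm_mFourierCoeff_eq hw₀ hdiv₀
  have hpt' : ∀ᵐ s ∂(volume : Measure ℝ), s ∈ Ioo 0 T → ∀ N : ℕ,
      2 * (Fl N s + Wk N s) - 2 * Q N s ≤ -(lo * D N s) + R s := (ae_restrict_iff' measurableSet_Ioo).1 hpt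
  have hDi : ∀ N, IntegrableOn (D N) (Ioo 0 T) := fun N => h.integrableOn_toReal_eGradNormSq_fourierTruncate N
  have hbound : ∀ N, ∀ᵐ t ∂(volume.restrict (Ioo 0 T)), ∫ s in Ioc 0 t, D N s ≤ B / lo := by
    intro N
    filter_upwards [hE, ae_restrict_mem measurableSet_Ioo] with t ht htT
    have hsub : Ioc 0 t ⊆ Ioo 0 T := Ioc_subset_Ioo_right htT.2
    have e1 : ∑ k ∈ FunctionSpaces.Torus.freqBall N, ‖mFourierCoeff (FunctionSpaces.EuclideanSpace.complexify ∘ w t) k‖ ^ 2 +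
        2 * ∫ s in Ioc 0 t, Q N s =
        ∑ k ∈ FunctionSpaces.Torus.freqBall N, ‖mFourierCoeff (FunctionSpaces.EuclideanSpace.complexify ∘ w₀) k‖ ^ 2 +
          2 * ∫ s in Ioc 0 t, (Fl N s + Wk N s) := ht N
    have hFWi : IntegrableOn (fun s => Fl N s + Wk N s) (Ioc 0 t) :=
      ((h.integrableOn_galerkinFlux N).add (h.integrableOn_galerkinForce N)).mono_set hsub
    have hQi : IntegrableOn (Q N) (Ioc 0 t) := (h.integrableOn_symbForm N).mono_set hsub
    have hDt : IntegrableOn (D N) (Ioc 0 t) := (hDi N).mono_set hsub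
    have hRt : IntegrableOn R (Ioc 0 t) := hRi.mono_set hsub
    have hDt' : IntegrableOn (fun s => -(lo * D N s)) (Ioc 0 t) := (hDt.const_mul lo).neg
    have hint : ∫ s in Ioc 0 t, (2 * (Fl N s + Wk N s) - 2 * Q N s) ≤ ∫ s in Ioc 0 t, (-(lo * D N s) + R s) :=
      integral_mono_ae ((hFWi.const_mul 2).sub (hQi.const_mul 2)) (hDt'.add hRt)
        ((ae_restrict_iff' measurableSet_Ioc).2 (hpt'.mono fun s hs hsI => hs (hsub hsI) N))
    rw [integral_sub (hFWi.const_mul 2) (hQi.const_mul 2), integral_const_mul 2 (fun s => Fl N s + Wk N s),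
      integral_const_mul 2 (Q N), integral_add hDt' hRt, integral_neg, integral_const_mul lo (D N)] at hint
    have hRle : ∫ s in Ioc 0 t, R s ≤ ∫ s in Ioo 0 T, R s :=
      setIntegral_mono_set hRi (ae_of_all _ hR0) (ae_of_all _ hsub)
    have hS0 : ∑ k ∈ FunctionSpaces.Torus.freqBall N, ‖mFourierCoeff (FunctionSpaces.EuclideanSpace.complexify ∘ w₀) k‖ ^ 2 ≤
        ∫ x, ‖w₀ x‖ ^ 2 := sum_sq_norm_mFourierCoeff_le₈ hw₀ N
    have hSt : 0 ≤ ∑ k ∈ FunctionSpaces.Torus.freqBall N, ‖mFourierCoeff (FunctionSpaces.EuclideanSpace.complexify ∘ w t) k‖ ^ 2 :=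
      Finset.sum_nonneg fun k _ => sq_nonneg _
    rw [le_div_iff₀ hlo, hB]
    linarith [e1, hint, hRle, hS0, hSt]
  -- ### extend to `t = T` by continuity of the primitive
  have hallT : ∀ N, ∫ s in Ioo 0 T, D N s ≤ B / lo := by
    intro N
    have hDI : IntegrableOn (D N) (Icc 0 T) := (integrableOn_Icc_iff_integrableOn_Ioo (f := D N)).2 (hDi N)
    have hcont : ContinuousOn (fun t => ∫ s in Ioc 0 t, D N s) (Icc 0 T) := intervalIntegral.continuousOn_primitive hDI
    have hae : ∀ᵐ t ∂(volume.restrict (Ioo 0 T)), |∫ s in Ioc 0 t, D N s| ≤ B / lo := by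
      filter_upwards [hbound N] with t ht
      rwa [abs_of_nonneg (setIntegral_nonneg measurableSet_Ioc fun s _ => ENNReal.toReal_nonneg)]
    have hT' := abs_le_of_ae_abs_le_of_continuousOn hT hcont hae T ⟨hT.le, le_rfl⟩
    rw [setIntegral_congr_set Ioo_ae_eq_Ioc]
    exact (le_abs_self _).trans hT'
  -- ### monotone convergence in `N`
  have hgood : ∀ᵐ s ∂(volume.restrict (Ioo 0 T)), Integrable (w s) volume := h.ae_integrable_slice.mono fun s hs => hs.1
  have hG_m : ∀ N, AEMeasurable (fun s => FunctionSpaces.Torus.eGradNormSq (P N (w s))) (volume.restrict (Ioo 0 T)) :=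
    fun N => h.aemeasurable_eGradNormSq_fourierTruncate N
  have hL : Tendsto (fun N => ∫⁻ s in Ioo 0 T, FunctionSpaces.Torus.eGradNormSq (P N (w s))) atTop
      (𝓝 (∫⁻ s in Ioo 0 T, FunctionSpaces.Torus.eGradNormSq (w s))) := by
    refine lintegral_tendsto_of_tendsto_of_monotone hG_m ?_ ?_
    · filter_upwards [hgood] with s hs
      intro N N' hNN'
      show FunctionSpaces.Torus.eGradNormSq (P N (w s)) ≤ FunctionSpaces.Torus.eGradNormSq (P N' (w s))
      rw [hP, Torus.eGradNormSq_fourierTruncate_eq_sum hs N, Torus.eGradNormSq_fourierTruncate_eq_sum hs N']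
      exact mul_le_mul' le_rfl (Finset.sum_le_sum_of_subset (FunctionSpaces.Torus.freqBall_mono hNN'))
    · filter_upwards [hgood] with s hs
      have hsum := (ENNReal.summable (f := fun k : d → ℤ =>
        ENNReal.ofReal (FunctionSpaces.Torus.freqNormSq k) *
          ‖UnitAddTorus.mFourierCoeff (FunctionSpaces.EuclideanSpace.complexify ∘ w s) k‖ₑ ^ 2)).hasSum
      have h' := ENNReal.Tendsto.const_mul (hsum.comp FunctionSpaces.Torus.tendsto_freqBall_atTop)
        (Or.inr (ENNReal.ofReal_ne_top (r := 4 * Real.pi ^ 2)))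
      rw [← FunctionSpaces.Torus.eGradNormSq_eq_tsum] at h'
      exact h'.congr fun N => (Torus.eGradNormSq_fourierTruncate_eq_sum hs N).symm
  have hle : ∀ N, ∫⁻ s in Ioo 0 T, FunctionSpaces.Torus.eGradNormSq (P N (w s)) ≤ ENNReal.ofReal (B / lo) := by
    intro N
    have e : ∫⁻ s in Ioo 0 T, FunctionSpaces.Torus.eGradNormSq (P N (w s)) = ENNReal.ofReal (∫ s in Ioo 0 T, D N s) := by
      rw [ofReal_integral_eq_lintegral_ofReal (hDi N) (ae_of_all _ fun s => ENNReal.toReal_nonneg)]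
      refine lintegral_congr fun s => ?_
      rw [hD]
      exact (ENNReal.ofReal_toReal (FunctionSpaces.Torus.eGradNormSq_lt_top
        (FunctionSpaces.Torus.isSmooth_fourierTruncate N _)).ne).symm
    rw [e]
    exact ENNReal.ofReal_le_ofReal (hallT N)
  exact lt_of_le_of_lt (le_of_tendsto' hL hle) ENNReal.ofReal_lt_top

/-- The dissipation in the `eVectorDissipation` currency: `lo ∫₀ᵀ ‖∇w‖₂² < ∞`.
[cite: RobinsonRodrigoSadowski2016, §4.2 (4.20)] -/
theorem eVectorDissipation_lt_top (h : IsWeakTensorPassiveVectorForcedOn 0 T 𝔸 b g F w₀ w)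
    {lo hi : ℝ} (h𝔸 : NearIso 𝔸 lo hi) (hlo : 0 < lo)
    (hw₀ : MemLp w₀ 2 volume) (hdiv₀ : FunctionSpaces.Torus.IsWeaklyDivFree w₀)
    (hb : MemLp (FunctionSpaces.Torus.stLift b) ⊤ (volume.restrict (Ioo 0 T ×ˢ univ))) :
    eVectorDissipation lo w 0 T < ⊤ := by
  unfold eVectorDissipation
  exact ENNReal.mul_lt_top ENNReal.ofReal_lt_top (h.lintegral_eGradNormSq_lt_top h𝔸 hlo hw₀ hdiv₀ hb)

/-! ## §8 `A = 0`, coercive tensor, bounded carrier: the energy inequality with the work term -/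

/-- The work of the force on a fixed truncation, `s ↦ ∫⟪g(s), P_N w(s)⟫`, is integrable on `(0,T)`.
[cite: Temam1997, Ch. II §3.1–3.2, (3.2)–(3.5), Thm. 3.1] -/
theorem integrableOn_forceWork_fourierTruncate (h : IsWeakTensorPassiveVectorForcedOn A T 𝔸 b g F w₀ w) (N : ℕ) :
    IntegrableOn (fun s => ∫ x, ⟪g s x, FunctionSpaces.Torus.fourierTruncate N (w s) x⟫_ℝ) (Ioo 0 T) := by
  have hm : AEStronglyMeasurable (fun s => ∫ x, ⟪g s x, FunctionSpaces.Torus.fourierTruncate N (w s) x⟫_ℝ)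
      (volume.restrict (Ioo 0 T)) := by
    have h' := (h.aestronglyMeasurable_uncurry_force.inner (𝕜 := ℝ)
      (Torus.aestronglyMeasurable_uncurry_fourierTruncate h.aestronglyMeasurable_uncurry N)).integral_prod_right'
    exact h'
  refine Integrable.mono' h.integrableOn_forceWork.2 hm ?_
  filter_upwards [h.ae_abs_forceWork_le] with s hs
  rw [Real.norm_eq_abs]
  exact hs N

/-- **The energy inequality with the work term, for EVERY forced weak solution** (`A = 0`, coercive
constant tensor `NearIso 𝔸 lo hi`, `0 < lo`, bounded carrier, `L²` weakly divergence-free datum): for a.e.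
`t ∈ (0,T)`,
`‖w(t)‖₂² + lo ∫₀ᵗ ‖∇w‖₂² ≤ ‖w₀‖₂² + (1/lo) ∫₀ᵗ Σⱼ ‖F j‖₂² + 2 ∫₀ᵗ ∫ ⟪g, w⟫`.
(The flux work `Σⱼ⟪F j, ∂ⱼw⟫` is absorbed by Young into half of the dissipation `2 lo ‖∇w‖²`; the work
of the `L²` force is kept as is.) Proof: truncated energy identity (`ae_sum_sq_norm_mFourierCoeff_eq`),
coercivity mode by mode, Young on the flux work at the Galerkin level, and `N → ∞`: the transport flux is a
remainder `→ 0` in `L¹(0,t)` (dominated by `‖∇w‖₂² ∈ L¹`, §7), the force work converges by dominated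
convergence, the truncated dissipation by monotone convergence.
[cite: Temam1997, Ch. II §3.1–3.2, (3.2)–(3.5), Thm. 3.1] [cite: RobinsonRodrigoSadowski2016, §4.2 (4.20)] -/
theorem ae_energy_ineq (h : IsWeakTensorPassiveVectorForcedOn 0 T 𝔸 b g F w₀ w)
    {lo hi : ℝ} (h𝔸 : NearIso 𝔸 lo hi) (hlo : 0 < lo)
    (hw₀ : MemLp w₀ 2 volume) (hdiv₀ : FunctionSpaces.Torus.IsWeaklyDivFree w₀)
    (hb : MemLp (FunctionSpaces.Torus.stLift b) ⊤ (volume.restrict (Ioo 0 T ×ˢ univ))) :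
    ∀ᵐ t ∂(volume.restrict (Ioo 0 T)),
      (∫ x, ‖w t x‖ ^ 2) + lo * (∫⁻ s in Ioo 0 t, FunctionSpaces.Torus.eGradNormSq (w s)).toReal ≤
        (∫ x, ‖w₀ x‖ ^ 2) + (1 / lo) * (∫ s in Ioo 0 t, ∑ j, ∫ x, ‖F j s x‖ ^ 2) +
          2 * ∫ s in Ioo 0 t, ∫ x, ⟪g s x, w s x⟫_ℝ := by
  classical
  obtain ⟨M, hM, hbM⟩ := ae_ae_norm_le_of_memLp_top_stLift hb
  obtain ⟨C, hC0, hCb, hEi⟩ := h.integrableOn_integral_norm_sq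
  obtain ⟨hgi, hFi⟩ := h.integrableOn_integral_norm_sq_force_flux
  obtain ⟨hGwi, hprod⟩ := h.integrableOn_forceWork
  have hfin : ∫⁻ s in Ioo 0 T, FunctionSpaces.Torus.eGradNormSq (w s) < ⊤ :=
    h.lintegral_eGradNormSq_lt_top h𝔸 hlo hw₀ hdiv₀ hb
  -- notation
  set P : ℕ → (UnitAddTorus d → EuclideanSpace ℝ d) → UnitAddTorus d → EuclideanSpace ℝ d :=
    fun N v => FunctionSpaces.Torus.fourierTruncate N v with hP
  set D : ℕ → ℝ → ℝ := fun N s => (FunctionSpaces.Torus.eGradNormSq (P N (w s))).toReal with hD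
  set Df : ℝ → ℝ := fun s => (FunctionSpaces.Torus.eGradNormSq (w s)).toReal with hDf
  set Q : ℕ → ℝ → ℝ := fun N s => 4 * Real.pi ^ 2 * ∑ k ∈ FunctionSpaces.Torus.freqBall N,
    (⟪mFourierCoeff (FunctionSpaces.EuclideanSpace.complexify ∘ w s) k,
      symbT 𝔸 k (mFourierCoeff (FunctionSpaces.EuclideanSpace.complexify ∘ w s) k)⟫_ℂ).re with hQ
  set Fl : ℕ → ℝ → ℝ := fun N s =>
    (∫ x, ⟪w s x, FunctionSpaces.Torus.convect (b s) (P N (w s)) x⟫_ℝ) +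
      (0 : ℝ) * ∫ x, ⟪b s x, FunctionSpaces.Torus.convect (w s) (P N (w s)) x⟫_ℝ with hFl
  set Gg : ℕ → ℝ → ℝ := fun N s => ∫ x, ⟪g s x, P N (w s) x⟫_ℝ with hGg
  set Φ : ℕ → ℝ → ℝ := fun N s =>
    ∑ j, ∫ x, ⟪F j s x, FunctionSpaces.Torus.partialDeriv j (P N (w s)) x⟫_ℝ with hΦ
  set Gw : ℝ → ℝ := fun s => ∫ x, ⟪g s x, w s x⟫_ℝ with hGw
  set En : ℝ → ℝ := fun s => ∫ x, ‖w s x‖ ^ 2 with hEn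
  set ng : ℝ → ℝ := fun s => ∫ x, ‖g s x‖ ^ 2 with hng
  set nF : ℝ → ℝ := fun s => ∑ j, ∫ x, ‖F j s x‖ ^ 2 with hnF
  set K : ℝ := Fintype.card d * M with hK
  have hK0 : 0 ≤ K := mul_nonneg (Nat.cast_nonneg _) hM
  have hDi : ∀ N, IntegrableOn (D N) (Ioo 0 T) := fun N => h.integrableOn_toReal_eGradNormSq_fourierTruncate N
  have hDfi : IntegrableOn Df (Ioo 0 T) := integrable_toReal_of_lintegral_ne_top h.aemeasurable_eGradNormSq hfin.ne
  have hFli : ∀ N, IntegrableOn (Fl N) (Ioo 0 T) := fun N => h.integrableOn_galerkinFlux N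
  have hGgi : ∀ N, IntegrableOn (Gg N) (Ioo 0 T) := fun N => h.integrableOn_forceWork_fourierTruncate N
  have hWki : ∀ N, IntegrableOn (fun s => Gg N s - Φ N s) (Ioo 0 T) := fun N => h.integrableOn_galerkinForce N
  have hQi : ∀ N, IntegrableOn (Q N) (Ioo 0 T) := fun N => h.integrableOn_symbForm N
  -- ### pointwise (in `s`) facts, for every `N`
  -- (a) coercivity + Young on the flux work: `2(Fl + (Gg - Φ)) - 2Q ≤ 2Fl + 2Gg - lo D + nF/lo`
  have hptY : ∀ᵐ s ∂(volume.restrict (Ioo 0 T)), ∀ N : ℕ,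
      2 * (Fl N s + (Gg N s - Φ N s)) - 2 * Q N s ≤ 2 * Fl N s + 2 * Gg N s + (-(lo * D N s) + (1 / lo) * nF s) := by
    filter_upwards [h.ae_lo_mul_le_symbForm h𝔸, h.ae_abs_fluxWork_le] with s hco hΦs
    intro N
    have hD0 : 0 ≤ D N s := ENNReal.toReal_nonneg
    have hnF0 : 0 ≤ nF s := Finset.sum_nonneg fun j _ => integral_nonneg fun x => sq_nonneg _
    have h4 : lo * D N s ≤ Q N s := hco N
    have hΦ1 : -Φ N s ≤ Real.sqrt (nF s) * Real.sqrt (D N s) := by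
      have h1 : |Φ N s| ≤ Real.sqrt (nF s) * Real.sqrt (D N s) := hΦs N
      have h2 := neg_abs_le (Φ N s)
      linarith
    -- Young: `2 √nF √D ≤ lo D + nF / lo`
    have y2 : 2 * Real.sqrt (nF s) * Real.sqrt (D N s) ≤ lo * D N s + (1 / lo) * nF s := by
      have hx2 : Real.sqrt (D N s) ^ 2 = D N s := Real.sq_sqrt hD0
      have hz2 : Real.sqrt (nF s) ^ 2 = nF s := Real.sq_sqrt hnF0
      have e : lo * Real.sqrt (D N s) ^ 2 + (1 / lo) * Real.sqrt (nF s) ^ 2 - 2 * Real.sqrt (nF s) * Real.sqrt (D N s) =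
          (lo * Real.sqrt (D N s) - Real.sqrt (nF s)) ^ 2 / lo := by
        field_simp
        ring
      have hnn := div_nonneg (sq_nonneg (lo * Real.sqrt (D N s) - Real.sqrt (nF s))) hlo.le
      rw [← e, hx2, hz2] at hnn
      linarith
    linarith
  -- (b) the transport flux is a remainder: `|Fl| ≤ 2 K √C (1 + ‖∇w‖²)` and `Fl_N(s) → 0`
  have hDle' := ae_all_iff.2 fun N => h.ae_eGradNormSq_fourierTruncate_le N
  have hflux' := ae_all_iff.2 fun N => h.ae_galerkinFlux_eq_remainder hM hbM N
  have hFl_bd : ∀ᵐ s ∂(volume.restrict (Ioo 0 T)), ∀ N : ℕ, |Fl N s| ≤ 2 * K * Real.sqrt C * (1 + Df s) := by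
    have htail' := ae_all_iff.2 h.ae_galerkin_tail.1
    filter_upwards [hflux', htail', hDle', hCb, ae_lt_top' h.aemeasurable_eGradNormSq hfin.ne]
      with s hfl htl hDle hCs hfs
    intro N
    obtain ⟨hfl_eq, hfl_le⟩ := hfl N
    have e : Fl N s = ∫ x, ⟪w s x - P N (w s) x, FunctionSpaces.Torus.convect (b s) (P N (w s)) x⟫_ℝ := hfl_eq
    rw [e]
    refine hfl_le.trans ?_
    have hDN : D N s ≤ Df s := (ENNReal.toReal_le_toReal
      (FunctionSpaces.Torus.eGradNormSq_lt_top (FunctionSpaces.Torus.isSmooth_fourierTruncate N _)).ne hfs.ne).2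
        (hDle N)
    have hDf0 : 0 ≤ Df s := ENNReal.toReal_nonneg
    have h1 : Real.sqrt (∫ x, ‖w s x - P N (w s) x‖ ^ 2) ≤ 2 * Real.sqrt C := by
      have h4C : Real.sqrt (4 * C) = 2 * Real.sqrt C := by
        rw [Real.sqrt_mul (by norm_num : (0:ℝ) ≤ 4), show Real.sqrt (4 : ℝ) = 2 by
          rw [show (4 : ℝ) = 2 ^ 2 by norm_num, Real.sqrt_sq (by norm_num)]]
      rw [← h4C]
      exact Real.sqrt_le_sqrt ((htl N).trans (by linarith))
    have h2 : Real.sqrt (D N s) ≤ 1 + Df s := by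
      refine (Real.sqrt_le_sqrt hDN).trans ?_
      nlinarith [Real.sq_sqrt hDf0, Real.sqrt_nonneg (Df s), sq_nonneg (Real.sqrt (Df s) - 1)]
    calc (Fintype.card d : ℝ) * M * Real.sqrt (∫ x, ‖w s x - P N (w s) x‖ ^ 2) * Real.sqrt (D N s)
        ≤ (Fintype.card d : ℝ) * M * (2 * Real.sqrt C) * (1 + Df s) :=
          mul_le_mul (mul_le_mul_of_nonneg_left h1 hK0) h2 (Real.sqrt_nonneg _)
            (mul_nonneg hK0 (mul_nonneg (by norm_num) (Real.sqrt_nonneg _)))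
      _ = 2 * K * Real.sqrt C * (1 + Df s) := by rw [hK]; ring
  have hFl_lim : ∀ᵐ s ∂(volume.restrict (Ioo 0 T)), Tendsto (fun N => Fl N s) atTop (𝓝 0) := by
    filter_upwards [hflux', h.ae_galerkin_tail.2, hDle', ae_lt_top' h.aemeasurable_eGradNormSq hfin.ne]
      with s hfl htl hDle hfs
    have hDf0 : 0 ≤ Df s := ENNReal.toReal_nonneg
    have hbdN : ∀ N, |Fl N s| ≤ K * Real.sqrt (Df s) * Real.sqrt (∫ x, ‖w s x - P N (w s) x‖ ^ 2) := by
      intro N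
      obtain ⟨hfl_eq, hfl_le⟩ := hfl N
      have e : Fl N s = ∫ x, ⟪w s x - P N (w s) x, FunctionSpaces.Torus.convect (b s) (P N (w s)) x⟫_ℝ := hfl_eq
      rw [e]
      refine hfl_le.trans ?_
      have hDN : D N s ≤ Df s := (ENNReal.toReal_le_toReal
        (FunctionSpaces.Torus.eGradNormSq_lt_top (FunctionSpaces.Torus.isSmooth_fourierTruncate N _)).ne hfs.ne).2
          (hDle N)
      calc (Fintype.card d : ℝ) * M * Real.sqrt (∫ x, ‖w s x - P N (w s) x‖ ^ 2) * Real.sqrt (D N s)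
          ≤ (Fintype.card d : ℝ) * M * Real.sqrt (∫ x, ‖w s x - P N (w s) x‖ ^ 2) * Real.sqrt (Df s) :=
            mul_le_mul_of_nonneg_left (Real.sqrt_le_sqrt hDN) (mul_nonneg hK0 (Real.sqrt_nonneg _))
        _ = K * Real.sqrt (Df s) * Real.sqrt (∫ x, ‖w s x - P N (w s) x‖ ^ 2) := by rw [hK]; ring
    have hsq : Tendsto (fun N => K * Real.sqrt (Df s) * Real.sqrt (∫ x, ‖w s x - P N (w s) x‖ ^ 2)) atTop (𝓝 0) := by
      have := ((Real.continuous_sqrt.tendsto 0).comp htl).const_mul (K * Real.sqrt (Df s))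
      rwa [Real.sqrt_zero, mul_zero] at this
    exact squeeze_zero_norm (fun N => by rw [Real.norm_eq_abs]; exact hbdN N) hsq
  -- (c) the work of the force: `|Gg_N| ≤ √ng √En`, `Gg_N(s) → Gw(s)`
  have hGg_bd : ∀ᵐ s ∂(volume.restrict (Ioo 0 T)), ∀ N : ℕ, |Gg N s| ≤ Real.sqrt (ng s) * Real.sqrt (En s) :=
    h.ae_abs_forceWork_le
  have hGg_lim : ∀ᵐ s ∂(volume.restrict (Ioo 0 T)), Tendsto (fun N => Gg N s) atTop (𝓝 (Gw s)) :=
    h.ae_tendsto_forceWork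
  -- ### the truncated identity and the limit, at a.e. `t`
  have hE := h.ae_sum_sq_norm_mFourierCoeff_eq hw₀ hdiv₀
  have hptY' : ∀ᵐ s ∂(volume : Measure ℝ), s ∈ Ioo 0 T → ∀ N : ℕ,
      2 * (Fl N s + (Gg N s - Φ N s)) - 2 * Q N s ≤ 2 * Fl N s + 2 * Gg N s + (-(lo * D N s) + (1 / lo) * nF s) :=
    (ae_restrict_iff' measurableSet_Ioo).1 hptY
  have hFl_bd' : ∀ᵐ s ∂(volume : Measure ℝ), s ∈ Ioo 0 T → ∀ N : ℕ, |Fl N s| ≤ 2 * K * Real.sqrt C * (1 + Df s) :=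
    (ae_restrict_iff' measurableSet_Ioo).1 hFl_bd
  have hFl_lim' : ∀ᵐ s ∂(volume : Measure ℝ), s ∈ Ioo 0 T → Tendsto (fun N => Fl N s) atTop (𝓝 0) :=
    (ae_restrict_iff' measurableSet_Ioo).1 hFl_lim
  have hGg_bd' : ∀ᵐ s ∂(volume : Measure ℝ), s ∈ Ioo 0 T → ∀ N : ℕ, |Gg N s| ≤ Real.sqrt (ng s) * Real.sqrt (En s) :=
    (ae_restrict_iff' measurableSet_Ioo).1 hGg_bd
  have hGg_lim' : ∀ᵐ s ∂(volume : Measure ℝ), s ∈ Ioo 0 T → Tendsto (fun N => Gg N s) atTop (𝓝 (Gw s)) :=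
    (ae_restrict_iff' measurableSet_Ioo).1 hGg_lim
  filter_upwards [hE, h.ae_memLp_two, ae_restrict_mem measurableSet_Ioo] with t ht hwt htT
  have hsub : Ioc 0 t ⊆ Ioo 0 T := Ioc_subset_Ioo_right htT.2
  have hsub' : Ioo 0 t ⊆ Ioo 0 T := Ioo_subset_Ioo le_rfl htT.2.le
  -- (★)_N : `S_N(t) + lo ∫ D_N ≤ S_N(0) + 2∫ Fl_N + 2∫ Gg_N + (1/lo) ∫ nF`
  have hstar : ∀ N,
      ∑ k ∈ FunctionSpaces.Torus.freqBall N, ‖mFourierCoeff (FunctionSpaces.EuclideanSpace.complexify ∘ w t) k‖ ^ 2 +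
          lo * ∫ s in Ioc 0 t, D N s ≤
        ∑ k ∈ FunctionSpaces.Torus.freqBall N, ‖mFourierCoeff (FunctionSpaces.EuclideanSpace.complexify ∘ w₀) k‖ ^ 2 +
          2 * (∫ s in Ioc 0 t, Fl N s) + 2 * (∫ s in Ioc 0 t, Gg N s) + (1 / lo) * ∫ s in Ioc 0 t, nF s := by
    intro N
    have e1 : ∑ k ∈ FunctionSpaces.Torus.freqBall N, ‖mFourierCoeff (FunctionSpaces.EuclideanSpace.complexify ∘ w t) k‖ ^ 2 +
        2 * ∫ s in Ioc 0 t, Q N s =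
        ∑ k ∈ FunctionSpaces.Torus.freqBall N, ‖mFourierCoeff (FunctionSpaces.EuclideanSpace.complexify ∘ w₀) k‖ ^ 2 +
          2 * ∫ s in Ioc 0 t, (Fl N s + (Gg N s - Φ N s)) := ht N
    have hFWi : IntegrableOn (fun s => Fl N s + (Gg N s - Φ N s)) (Ioc 0 t) := ((hFli N).add (hWki N)).mono_set hsub
    have hQt : IntegrableOn (Q N) (Ioc 0 t) := (hQi N).mono_set hsub
    have hFlt : IntegrableOn (Fl N) (Ioc 0 t) := (hFli N).mono_set hsub
    have hGgt : IntegrableOn (Gg N) (Ioc 0 t) := (hGgi N).mono_set hsub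
    have hDt' : IntegrableOn (fun s => -(lo * D N s)) (Ioc 0 t) := (((hDi N).mono_set hsub).const_mul lo).neg
    have hnFt : IntegrableOn nF (Ioc 0 t) := hFi.mono_set hsub
    have hA : IntegrableOn (fun s => 2 * Fl N s + 2 * Gg N s) (Ioc 0 t) := (hFlt.const_mul 2).add (hGgt.const_mul 2)
    have hB : IntegrableOn (fun s => -(lo * D N s) + (1 / lo) * nF s) (Ioc 0 t) := hDt'.add (hnFt.const_mul (1 / lo))
    have hint : ∫ s in Ioc 0 t, (2 * (Fl N s + (Gg N s - Φ N s)) - 2 * Q N s) ≤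
        ∫ s in Ioc 0 t, (2 * Fl N s + 2 * Gg N s + (-(lo * D N s) + (1 / lo) * nF s)) :=
      integral_mono_ae ((hFWi.const_mul 2).sub (hQt.const_mul 2)) (hA.add hB)
        ((ae_restrict_iff' measurableSet_Ioc).2 (hptY'.mono fun s hs hsI => hs (hsub hsI) N))
    rw [integral_sub (hFWi.const_mul 2) (hQt.const_mul 2),
      integral_const_mul 2 (fun s => Fl N s + (Gg N s - Φ N s)), integral_const_mul 2 (Q N),
      integral_add hA hB, integral_add (hFlt.const_mul 2) (hGgt.const_mul 2), integral_add hDt' (hnFt.const_mul (1 / lo)),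
      integral_const_mul 2 (Fl N), integral_const_mul 2 (Gg N), integral_neg, integral_const_mul lo (D N),
      integral_const_mul (1 / lo) nF] at hint
    linarith
  -- limits of the four `N`-dependent terms
  have hS_t : Tendsto (fun N => ∑ k ∈ FunctionSpaces.Torus.freqBall N,
      ‖mFourierCoeff (FunctionSpaces.EuclideanSpace.complexify ∘ w t) k‖ ^ 2) atTop (𝓝 (∫ x, ‖w t x‖ ^ 2)) :=
    (FunctionSpaces.Torus.hasSum_sq_norm_mFourierCoeff_complexify hwt).comp FunctionSpaces.Torus.tendsto_freqBall_atTop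
  have hS_0 : Tendsto (fun N => ∑ k ∈ FunctionSpaces.Torus.freqBall N,
      ‖mFourierCoeff (FunctionSpaces.EuclideanSpace.complexify ∘ w₀) k‖ ^ 2) atTop (𝓝 (∫ x, ‖w₀ x‖ ^ 2)) :=
    (FunctionSpaces.Torus.hasSum_sq_norm_mFourierCoeff_complexify hw₀).comp FunctionSpaces.Torus.tendsto_freqBall_atTop
  -- the truncated dissipation on `(0,t]`: monotone convergence
  have hDlim : Tendsto (fun N => ∫ s in Ioc 0 t, D N s) atTop
      (𝓝 ((∫⁻ s in Ioo 0 t, FunctionSpaces.Torus.eGradNormSq (w s)).toReal)) := by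
    set μt : Measure ℝ := volume.restrict (Ioo 0 t) with hμt
    have hle : μt ≤ volume.restrict (Ioo 0 T) := Measure.restrict_mono hsub' le_rfl
    have hG_m : ∀ N, AEMeasurable (fun s => FunctionSpaces.Torus.eGradNormSq (P N (w s))) μt := fun N =>
      (h.aemeasurable_eGradNormSq_fourierTruncate N).mono_measure hle
    have hfin_t : ∫⁻ s in Ioo 0 t, FunctionSpaces.Torus.eGradNormSq (w s) ≠ ⊤ :=
      ((lintegral_mono' hle le_rfl).trans_lt hfin).ne
    have hgood : ∀ᵐ s ∂μt, Integrable (w s) volume :=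
      ae_restrict_of_ae_restrict_of_subset hsub' (h.ae_integrable_slice.mono fun s hs => hs.1)
    have hL : Tendsto (fun N => ∫⁻ s in Ioo 0 t, FunctionSpaces.Torus.eGradNormSq (P N (w s))) atTop
        (𝓝 (∫⁻ s in Ioo 0 t, FunctionSpaces.Torus.eGradNormSq (w s))) := by
      refine lintegral_tendsto_of_tendsto_of_monotone hG_m ?_ ?_
      · filter_upwards [hgood] with s hs
        intro N N' hNN'
        show FunctionSpaces.Torus.eGradNormSq (P N (w s)) ≤ FunctionSpaces.Torus.eGradNormSq (P N' (w s))
        rw [hP, Torus.eGradNormSq_fourierTruncate_eq_sum hs N, Torus.eGradNormSq_fourierTruncate_eq_sum hs N']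
        exact mul_le_mul' le_rfl (Finset.sum_le_sum_of_subset (FunctionSpaces.Torus.freqBall_mono hNN'))
      · filter_upwards [hgood] with s hs
        have hsum := (ENNReal.summable (f := fun k : d → ℤ =>
          ENNReal.ofReal (FunctionSpaces.Torus.freqNormSq k) *
            ‖UnitAddTorus.mFourierCoeff (FunctionSpaces.EuclideanSpace.complexify ∘ w s) k‖ₑ ^ 2)).hasSum
        have h' := ENNReal.Tendsto.const_mul (hsum.comp FunctionSpaces.Torus.tendsto_freqBall_atTop)
          (Or.inr (ENNReal.ofReal_ne_top (r := 4 * Real.pi ^ 2)))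
        rw [← FunctionSpaces.Torus.eGradNormSq_eq_tsum] at h'
        exact h'.congr fun N => (Torus.eGradNormSq_fourierTruncate_eq_sum hs N).symm
    have hL' := (ENNReal.tendsto_toReal hfin_t).comp hL
    refine hL'.congr fun N => ?_
    have hfinN : ∀ᵐ s ∂μt, FunctionSpaces.Torus.eGradNormSq (P N (w s)) < ⊤ := ae_of_all _ fun s =>
      FunctionSpaces.Torus.eGradNormSq_lt_top (FunctionSpaces.Torus.isSmooth_fourierTruncate N _)
    rw [Function.comp_apply, ← integral_toReal (hG_m N) hfinN, hμt, setIntegral_congr_set Ioo_ae_eq_Ioc]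
  -- the transport flux: dominated convergence to `0`
  have hFl_int_lim : Tendsto (fun N => ∫ s in Ioc 0 t, Fl N s) atTop (𝓝 0) := by
    have h1c : IntegrableOn (fun _ : ℝ => (1 : ℝ)) (Ioc 0 t) := integrableOn_const measure_Ioc_lt_top.ne
    have hbound : IntegrableOn (fun s => 2 * K * Real.sqrt C * (1 + Df s)) (Ioc 0 t) :=
      (h1c.add (hDfi.mono_set hsub)).const_mul (2 * K * Real.sqrt C)
    have hlim := tendsto_integral_of_dominated_convergence (fun s => 2 * K * Real.sqrt C * (1 + Df s))
      (fun N => ((hFli N).mono_set hsub).aestronglyMeasurable) hbound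
      (fun N => (ae_restrict_iff' measurableSet_Ioc).2 (hFl_bd'.mono fun s hs hsI => by
        rw [Real.norm_eq_abs]; exact hs (hsub hsI) N))
      ((ae_restrict_iff' measurableSet_Ioc).2 (hFl_lim'.mono fun s hs hsI => hs (hsub hsI)))
    simpa using hlim
  -- the work of the force: dominated convergence
  have hGg_int_lim : Tendsto (fun N => ∫ s in Ioc 0 t, Gg N s) atTop (𝓝 (∫ s in Ioc 0 t, Gw s)) :=
    tendsto_integral_of_dominated_convergence (fun s => Real.sqrt (ng s) * Real.sqrt (En s))
      (fun N => ((hGgi N).mono_set hsub).aestronglyMeasurable) (hprod.mono_set hsub)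
      (fun N => (ae_restrict_iff' measurableSet_Ioc).2 (hGg_bd'.mono fun s hs hsI => by
        rw [Real.norm_eq_abs]; exact hs (hsub hsI) N))
      ((ae_restrict_iff' measurableSet_Ioc).2 (hGg_lim'.mono fun s hs hsI => hs (hsub hsI)))
  -- pass to the limit in (★)
  have hlim := le_of_tendsto_of_tendsto' (hS_t.add (hDlim.const_mul lo))
    (((hS_0.add (hFl_int_lim.const_mul 2)).add (hGg_int_lim.const_mul 2)).add
      (tendsto_const_nhds (x := (1 / lo) * ∫ s in Ioc 0 t, nF s))) hstar
  rw [mul_zero, add_zero] at hlim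
  rw [setIntegral_congr_set Ioo_ae_eq_Ioc, setIntegral_congr_set Ioo_ae_eq_Ioc]
  linarith

end IsWeakTensorPassiveVectorForcedOn

end Torus

end Literature.Analysis.FluidPDE

end
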